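import Literature.NumberTheory.ConnesConsani2021.SemilocalSoninSpace
import Literature.NumberTheory.LFunctions.ConnesProlateGuessHermite
import Literature.NumberTheory.LFunctions.LocalRiemannHypothesisMellin
import Literature.Probability.Distributions.HermiteGaussian
import HarnessLib

/-!
# Connes–Consani–Moscovici 2024, §2–§3: cyclic pairs, their prolate operators, and the canonical form of the scaling operator

RH-FREE corpus literature (operator theory at the archimedean place; NO positivity statement, NO
statement about the zeros of `ζ` beyond the classical facts cited from the tree).  bears_on: W-C/W-P
(sequel, no leaf role).  WHAT THIS IS NOT: any claim about RH; nothing in this file bears on the truth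
of RH.  Statements-first typing (cell rh-crit, seat cc-t12) of

  A. Connes, C. Consani, H. Moscovici, *Zeta zeros and prolate wave operators*,
  Ann. Funct. Anal. 15 (2024) 87, arXiv:2310.18423v2 [cite: ConnesConsaniMoscovici2024],

Section 2 «Cyclic pairs and associated prolate operators» (PDF pp. 6–9) and Section 3
«Hardy–Titchmarsh transform: archimedean place» (PDF pp. 9–15).  Locators: `p. N` = page of the
arXiv v2 PDF; `pNNNN:Lnn` = chunk:line of the held text `paper:arxiv-2310.18423`.  Numbering AS
PRINTED: theorems/definitions/corollaries/lemmas share one counter (Thm 2.1, Def 2.2, Def 2.3,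
Thm 3.1, Cor 3.2, Lemma 3.3) while propositions have their own (Prop 2.1–2.4, Prop 3.1–3.6).

## What is typed, and at which level

* §2 (abstract): a *cyclic pair* `(D, ξ)` is an unbounded self-adjoint operator (Mathlib
  `LinearPMap` + `LinearPMap.IsSelfAdjoint`) with a unit vector `ξ ∈ ⋂ Dom Dⁿ` whose iterates
  `Dʲξ` (`IsIterateSeq`) span a dense subspace (`IsCyclicPair`, p. 6).  Thm 2.1 (canonical form
  `H ≅ L²(ℝ, dμ)`, `D ↦` multiplication by `s`, `ξ ↦ 1`) is typed through `IsCanonicalForm`;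
  TODO(general form): the paper DEFINES `μ` by `∫ f dμ = ⟨f(D)ξ | ξ⟩` (Borel functional calculus of an
  unbounded self-adjoint operator, not in Mathlib); here `μ` is characterised by Thm 2.1 (i), which
  determines it (Thm 2.1 (iii) with `H₁ = H₂`).  The orthonormal basis `(ξ_j)` is Mathlib's
  Gram–Schmidt basis of the iterates (`cyclicBasis`; its phases are the printed ones, `a_n > 0`),
  `a_n = ⟨Dξ_n | ξ_{n+1}⟩` is `jacobiCoeff`, `f(N)` for `f ∈ c_c(ℕ)` is `funcCalcN`, and the
  finite-rank commutator `[D, f]` of Prop 2.2 is `commutatorOp`.  Def 2.2 (the *formal* prolate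
  operator `ω(D,ξ,λ) = −D² + λ²N`, "formal inasmuch as it does not give precisely the domain") and
  §2.2/Prop 2.4 are typed at the paper's own formal level (§2.2 p. 9: "an even cyclic pair is
  determined by the sequence `(a_n)`"), i.e. on coefficient sequences (`jacobiSeq`, `numberSeq`,
  `formalProlateSeq`); Prop 2.4 (the Jacobi matrices `J^±`, eqs. (12)–(13)) is PROVED.
* §3 (archimedean place): the concrete objects as explicit functions — the normalised even Hermite
  functions `h_{2n}` by the printed formula (21) (`evenHermiteFn`; `h_0 = hermiteH0` of the tree,
  dictionary with Mathlib's `Polynomial.hermite`/tree `hermiteR` as `CCM2024_eq_21`), the scaling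
  operator `𝕊 = −i(x∂ₓ + ½)` (`scalingOpFun`; the unitaries it generates are `λ^{1/2}·lpDilation λ`,
  `Literature.Analysis.OperatorTheory.lpDilation`), the Hermite operator `𝐇 = −∂² + (2πq)²`
  (`hermiteOpFun`), the prolate wave operator `W_λ` of eq. (5) (`prolateWaveOpFun`; the SAME
  operator as in `Literature.NumberTheory.LFunctions.IsProlateFunction.eigen`), the multiplicative
  Fourier transform `𝔽_μ` (`mulHaarFourier`, = Mathlib `mellin` at `−is`), `w_∞`, `Σ`, and
  `ℰ = w_∞ ∘ Σ` which IS the tree's `Literature.NumberTheory.LFunctions.connesE` (cited, not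
  restated: `connesE_eq_wInfty_sigmaMap`), the Hardy–Titchmarsh transform `𝒰` (`transformU`,
  eq. (18)), `ℳ`, `𝒱 = ℳ ∘ 𝒰` (eq. (19)), the measure `dm = |𝒰(h_0)|² ds` (`htMeasure`), the
  orthogonal polynomials `𝒫_m` of eq. (23) (`htPoly`), `α_n` (26), the Jacobi coefficients (27)–(28),
  `ψ^±_ℓ` (29), `P^±_ℓ` (32)–(33), `R^±_ℓ`, and `Ξ(s) = ξ(1/2 + is)` which IS the tree's
  `riemannXiUpper` (cited).  Operator identities are typed on the core of Gaussian × polynomial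
  functions / on `C²` functions (the paper's own computations, pp. 10–13); unitarity/self-adjointness
  claims about unbounded operators are typed through norms of representatives (`eLpNorm`).
* PROVED here (RH-free, elementary): uniqueness of the iterate sequence, `D(E_n) ⊆ E_{n+1}`,
  `γ Dʲξ = (−1)ʲ Dʲξ` and the UNIQUENESS half of Prop 2.1, a `ℤ/2`-grading is unitary, Prop 2.4,
  Prop 3.5 (from Prop 2.4 and `α_n`), `W_λ = ∂(x²∂) + λ²𝐇 = −𝕊² − ¼ + λ²𝐇` on `C²` functions
  (display p. 11), the scaling flow has generator `i𝕊`, `h_0 = hermiteH0`, `h_{2n}(0)`,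
  `ψ^±_ℓ(0) = 0`, `|α_n| = √((n+½)(n+1))`, `𝒱(ξ_∞) = 1`, `Ξ(0) = −ζ(½)Γ(¼)/(8π^{1/4})`, and
  `𝒰 = π^{-1/2} 𝔽_μ ∘ w_∞`.  Everything else printed as proved in the source is a NAMED FACT
  `def CCM2024_… : Prop` (D-0014), to be discharged top-down by the same seat.
* NOT typed: Prop 3.6 (ii) (spectrum of multiplication by `s` on the quotient of the Hadamard
  topological ring `ℋ_{≤1}` — no Mathlib carrier; its zero-set content is the tree's
  `Literature.NumberTheory.LFunctions.riemannXi_eq_zero_iff`), the numerical value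
  `Ξ(0) ≈ 0.497121` (numerical in print), §2.1's informal "spectral triple" packaging beyond the
  bounded-commutator content of Prop 2.2 (no `SpectralTriple` structure is introduced, by cell rule).

## References

* A. Connes, C. Consani, H. Moscovici, *Zeta zeros and prolate wave operators*, Ann. Funct. Anal. 15
  (2024), arXiv:2310.18423. [ConnesConsaniMoscovici2024]
* A. Connes, C. Consani, *Weil positivity and trace formula, the archimedean place*, Selecta Math. 27
  (2021) (Sonin space, scaling representation). [ConnesConsani2021]
* A. Connes, *The Riemann Hypothesis: past, present and a letter through time* (2026) (the map `𝓔`).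
  [Connes2026Letter]
-/

noncomputable section

open _root_.MeasureTheory Complex Polynomial InnerProductSpace
open scoped InnerProductSpace ComplexConjugate Nat Real FourierTransform

namespace Literature.NumberTheory.ConnesConsani2024

open Literature.NumberTheory.LFunctions Literature.NumberTheory.ConnesConsani2021
open Literature.Probability.Distributions (hermiteR)

/-! ## §2. Cyclic pairs (p. 6, p0006) -/

section CyclicPairs

variable {H : Type*} [NormedAddCommGroup H] [InnerProductSpace ℂ H] [CompleteSpace H]

/-- RH-FREE. The iterates `v j = Dʲ ξ` of a vector under a (partially defined) operator `D`:
`v 0 = ξ`, `v (j+1) = D (v j)`, each iterate lying in `Dom D` — i.e. `ξ ∈ ⋂ₙ Dom Dⁿ`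
(§2 p. 6: "a unit vector `ξ ∈ ∩_{n∈ℕ} Dom Dⁿ`"). [cite: ConnesConsaniMoscovici2024, §2 p. 6 (p0006:L3)] -/
def IsIterateSeq (D : H →ₗ.[ℂ] H) (ξ : H) (v : ℕ → D.domain) : Prop :=
  (v 0 : H) = ξ ∧ ∀ j : ℕ, (v (j + 1) : H) = D (v j)

/-- RH-FREE. **Cyclic pair** `(D, ξ)` (§2 p. 6): `D` a self-adjoint (unbounded, densely defined)
operator on an infinite-dimensional Hilbert space `H` (Mathlib `LinearPMap`, `IsSelfAdjoint D ↔ D† = D`),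
`ξ` a unit vector in `⋂ₙ Dom Dⁿ` which is cyclic: the linear span of the `Dʲξ`, `j ∈ ℕ`, is dense.
[cite: ConnesConsaniMoscovici2024, §2 p. 6 (p0006:L3)] -/
structure IsCyclicPair (D : H →ₗ.[ℂ] H) (ξ : H) : Prop where
  isSelfAdjoint : IsSelfAdjoint D
  norm_eq_one : ‖ξ‖ = 1
  not_finiteDimensional : ¬ FiniteDimensional ℂ H
  exists_iterateSeq_dense : ∃ v : ℕ → D.domain, IsIterateSeq D ξ v ∧
    Dense (Submodule.span ℂ (Set.range fun j => (v j : H)) : Set H)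

omit [CompleteSpace H] in
/-- The iterate sequence `Dʲξ` is unique (plumbing for §2 p. 6). [cite: ConnesConsaniMoscovici2024, §2 p. 6 (p0006:L3)] -/
theorem IsIterateSeq.unique {D : H →ₗ.[ℂ] H} {ξ : H} {v w : ℕ → D.domain}
    (hv : IsIterateSeq D ξ v) (hw : IsIterateSeq D ξ w) : v = w := by
  funext j
  induction j with
  | zero => exact Subtype.ext (hv.1.trans hw.1.symm)
  | succ j ih => exact Subtype.ext (by rw [hv.2 j, hw.2 j, ih])

/-- RH-FREE. `E_n ⊂ H`, the linear span of the `Dʲξ`, `j ≤ n` (§2 p. 6; `dim E_n = n + 1`).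
[cite: ConnesConsaniMoscovici2024, §2 p. 6 (p0006:L3)] -/
def krylovSpan {D : H →ₗ.[ℂ] H} (v : ℕ → D.domain) (n : ℕ) : Submodule ℂ H :=
  Submodule.span ℂ ((fun j => (v j : H)) '' Set.Iic n)

omit [CompleteSpace H] in
/-- `E_m ⊆ E_n` for `m ≤ n` (the `E_n` form an increasing filtration, §2 p. 6). [cite: ConnesConsaniMoscovici2024, §2 p. 6 (p0006:L3)] -/
theorem krylovSpan_mono {D : H →ₗ.[ℂ] H} (v : ℕ → D.domain) {m n : ℕ} (h : m ≤ n) :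
    krylovSpan v m ≤ krylovSpan v n :=
  Submodule.span_mono (Set.image_mono (Set.Iic_subset_Iic.mpr h))

omit [CompleteSpace H] in
/-- `E_n ⊆ Dom D` (§2 p. 6: `ξ ∈ ⋂ Dom Dⁿ`). [cite: ConnesConsaniMoscovici2024, §2 p. 6 (p0006:L3)] -/
theorem krylovSpan_le_domain {D : H →ₗ.[ℂ] H} (v : ℕ → D.domain) (n : ℕ) :
    krylovSpan v n ≤ D.domain := by
  refine Submodule.span_le.mpr ?_
  rintro _ ⟨j, -, rfl⟩
  exact (v j).2

omit [CompleteSpace H] in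
/-- `D(E_n) ⊂ E_{n+1}` (§2 p. 6: "One has by construction `D(E_n) ⊂ E_{n+1}`").
[cite: ConnesConsaniMoscovici2024, §2 p. 6 (p0006:L3)] -/
theorem IsIterateSeq.apply_mem_krylovSpan_succ {D : H →ₗ.[ℂ] H} {ξ : H} {v : ℕ → D.domain}
    (hv : IsIterateSeq D ξ v) {n : ℕ} (x : D.domain) (hx : (x : H) ∈ krylovSpan v n) :
    D x ∈ krylovSpan v (n + 1) := by
  -- work inside `Dom D`: the preimage of `E_{n+1}` under `D` contains every `v j`, `j ≤ n`
  let S : Submodule ℂ D.domain := (krylovSpan v (n + 1)).comap D.toFun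
  have hvS : ∀ j ∈ Set.Iic n, v j ∈ S := by
    intro j hj
    change D (v j) ∈ krylovSpan v (n + 1)
    rw [← hv.2 j]
    exact Submodule.subset_span ⟨j + 1, Nat.succ_le_succ hj, rfl⟩
  have hxS : x ∈ Submodule.span ℂ (v '' Set.Iic n) := by
    have hmap : Submodule.map D.domain.subtype (Submodule.span ℂ (v '' Set.Iic n)) =
        krylovSpan v n := by
      rw [Submodule.map_span, krylovSpan, ← Set.image_comp]
      rfl
    have hx' : (x : H) ∈ Submodule.map D.domain.subtype (Submodule.span ℂ (v '' Set.Iic n)) := by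
      rw [hmap]; exact hx
    rcases hx' with ⟨y, hy, hyx⟩
    have : y = x := Subtype.ext hyx
    rw [← this]; exact hy
  have hle : Submodule.span ℂ (v '' Set.Iic n) ≤ S := by
    refine Submodule.span_le.mpr ?_
    rintro _ ⟨j, hj, rfl⟩
    exact hvS j hj
  exact hle hxS

/-- RH-FREE. **Theorem 2.1 (i), as a predicate**: `(μ, U)` is a *canonical form* of the pair
`(D, ξ)` — `μ` is a probability measure on `ℝ`, `U : H → L²(ℝ, dμ)` is a unitary isomorphism
transforming `ξ` into the constant function `1` and `D` into the operator of multiplication by the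
variable `s` (with its natural domain `{φ | s φ ∈ L²}`). [cite: ConnesConsaniMoscovici2024, Thm. 2.1 (i) p. 6 (p0006:L7)] -/
structure IsCanonicalForm (D : H →ₗ.[ℂ] H) (ξ : H) (μ : Measure ℝ)
    (U : H ≃ₗᵢ[ℂ] Lp ℂ 2 μ) : Prop where
  isProbabilityMeasure : IsProbabilityMeasure μ
  map_vec : ((U ξ : Lp ℂ 2 μ) : ℝ → ℂ) =ᵐ[μ] fun _ => 1
  mem_domain_iff : ∀ x : H, x ∈ D.domain ↔
    MemLp (fun s : ℝ => (s : ℂ) * ((U x : Lp ℂ 2 μ) : ℝ → ℂ) s) 2 μ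
  map_apply : ∀ x : D.domain,
    ((U (D x) : Lp ℂ 2 μ) : ℝ → ℂ) =ᵐ[μ] fun s : ℝ => (s : ℂ) * ((U (x : H) : Lp ℂ 2 μ) : ℝ → ℂ) s

/-- RH-FREE named fact. **Theorem 2.1 (i)** (spectral theorem, cyclic case): every cyclic pair has a
canonical form — a probability measure `μ` on `ℝ` and a unitary `U : H → L²(ℝ, dμ)` with
`U D U* =` multiplication by `s`, `U ξ = 1`. [cite: ConnesConsaniMoscovici2024, Thm. 2.1 (i) p. 6 (p0006:L7)] -/
def CCM2024_thm_2_1_i : Prop :=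
  ∀ {H : Type} [NormedAddCommGroup H] [InnerProductSpace ℂ H] [CompleteSpace H]
    (D : H →ₗ.[ℂ] H) (ξ : H), IsCyclicPair D ξ →
    ∃ (μ : Measure ℝ) (U : H ≃ₗᵢ[ℂ] Lp ℂ 2 μ), IsCanonicalForm D ξ μ U

/-- RH-FREE named fact. **Theorem 2.1 (ii)**: under `U` the subspace `E_n` becomes the space of
polynomials of degree `≤ n`. [cite: ConnesConsaniMoscovici2024, Thm. 2.1 (ii) p. 6 (p0006:L9)] -/
def CCM2024_thm_2_1_ii : Prop :=
  ∀ {H : Type} [NormedAddCommGroup H] [InnerProductSpace ℂ H] [CompleteSpace H]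
    (D : H →ₗ.[ℂ] H) (ξ : H) (v : ℕ → D.domain) (μ : Measure ℝ) (U : H ≃ₗᵢ[ℂ] Lp ℂ 2 μ),
    IsCyclicPair D ξ → IsIterateSeq D ξ v → IsCanonicalForm D ξ μ U → ∀ n : ℕ,
    (fun x : H => (U x : Lp ℂ 2 μ)) '' (krylovSpan v n : Set H) =
      {g : Lp ℂ 2 μ | ∃ p : ℂ[X], p.natDegree ≤ n ∧ (g : ℝ → ℂ) =ᵐ[μ] fun s => p.eval (s : ℂ)}

/-- RH-FREE named fact. **Theorem 2.1 (iii)**: the spectral measure is a complete invariant of the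
cyclic pair — two cyclic pairs are unitarily equivalent (by a unitary carrying `ξ₁` to `ξ₂` and
`D₁` onto `D₂`, domains included) iff their spectral measures coincide.  TODO(general form): in print
`μ` is defined by `∫ f dμ := ⟨f(D)ξ | ξ⟩`; here it is any measure of a canonical form (Thm. 2.1 (i)),
which this statement shows to be unique. [cite: ConnesConsaniMoscovici2024, Thm. 2.1 (iii) p. 6 (p0006:L11)] -/
def CCM2024_thm_2_1_iii : Prop :=
  ∀ {H₁ : Type} [NormedAddCommGroup H₁] [InnerProductSpace ℂ H₁] [CompleteSpace H₁]
    {H₂ : Type} [NormedAddCommGroup H₂] [InnerProductSpace ℂ H₂] [CompleteSpace H₂]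
    (D₁ : H₁ →ₗ.[ℂ] H₁) (ξ₁ : H₁) (D₂ : H₂ →ₗ.[ℂ] H₂) (ξ₂ : H₂)
    (μ₁ : Measure ℝ) (U₁ : H₁ ≃ₗᵢ[ℂ] Lp ℂ 2 μ₁) (μ₂ : Measure ℝ) (U₂ : H₂ ≃ₗᵢ[ℂ] Lp ℂ 2 μ₂),
    IsCyclicPair D₁ ξ₁ → IsCyclicPair D₂ ξ₂ →
    IsCanonicalForm D₁ ξ₁ μ₁ U₁ → IsCanonicalForm D₂ ξ₂ μ₂ U₂ →
    ((∃ W : H₁ ≃ₗᵢ[ℂ] H₂, W ξ₁ = ξ₂ ∧ (∀ x : H₁, x ∈ D₁.domain ↔ W x ∈ D₂.domain) ∧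
        ∀ (x : D₁.domain) (hx : W (x : H₁) ∈ D₂.domain), W (D₁ x) = D₂ ⟨W (x : H₁), hx⟩) ↔
      μ₁ = μ₂)

/-- RH-FREE. The orthonormal basis `(ξ_j)` of a cyclic pair: Gram–Schmidt orthonormalisation of the
iterates `Dʲξ` (§2 p. 6: "apply the general theory of orthogonal polynomials and obtain an orthonormal
basis `(ξ_j)` where `ξ_0 = ξ` and `E_n` is the span of the `ξ_j` for `j ≤ n`"); Mathlib's
`gramSchmidtNormed`, whose phases make the Jacobi coefficients `a_n` positive as in print.
[cite: ConnesConsaniMoscovici2024, §2 p. 6 (p0006:L14)] -/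
def cyclicBasis {D : H →ₗ.[ℂ] H} (v : ℕ → D.domain) : ℕ → H :=
  gramSchmidtNormed ℂ (fun j => (v j : H))

omit [CompleteSpace H] in
/-- `ξ_n ∈ E_n` (§2 p. 6: "`E_n` is the span of the `ξ_j` for `j ≤ n`"). [cite: ConnesConsaniMoscovici2024, §2 p. 6 (p0006:L14)] -/
theorem cyclicBasis_mem_krylovSpan {D : H →ₗ.[ℂ] H} (v : ℕ → D.domain) (n : ℕ) :
    cyclicBasis v n ∈ krylovSpan v n := by
  unfold cyclicBasis gramSchmidtNormed krylovSpan
  exact Submodule.smul_mem _ _ (gramSchmidt_mem_span ℂ _ le_rfl)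

omit [CompleteSpace H] in
/-- `ξ_n ∈ Dom D` (§2.1 p. 7: "its commutator with `D` makes sense since `ξ_j ∈ Dom D`"). [cite: ConnesConsaniMoscovici2024, §2.1 p. 7 (p0006:L46)] -/
theorem cyclicBasis_mem_domain {D : H →ₗ.[ℂ] H} (v : ℕ → D.domain) (n : ℕ) :
    cyclicBasis v n ∈ D.domain :=
  krylovSpan_le_domain v n (cyclicBasis_mem_krylovSpan v n)

/-- RH-FREE. `ξ_n` as an element of `Dom D`. [cite: ConnesConsaniMoscovici2024, §2.1 p. 7 (p0006:L46)] -/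
def cyclicBasisDom {D : H →ₗ.[ℂ] H} (v : ℕ → D.domain) (n : ℕ) : D.domain :=
  ⟨cyclicBasis v n, cyclicBasis_mem_domain v n⟩

/-- RH-FREE. The Jacobi coefficient `a_n := ⟨D ξ_n | ξ_{n+1}⟩` of eq. (9) (§2.1 p. 7; inner product
antilinear in the first variable as in CC). [cite: ConnesConsaniMoscovici2024, §2.1 eq. (9) p. 7 (p0006:L49)] -/
def jacobiCoeff {D : H →ₗ.[ℂ] H} (v : ℕ → D.domain) (n : ℕ) : ℂ :=
  ⟪D (cyclicBasisDom v n), cyclicBasis v (n + 1)⟫_ℂ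

/-! ### Definition 2.3 and Proposition 2.1: `ℤ/2`-gradings (p. 6, p0006:L23–L34) -/

/-- RH-FREE. **Definition 2.3**: a `ℤ/2`-grading of the cyclic pair `(D, ξ)` is a unitary `γ` of
square `1`, `γ = γ*`, with `γ D = −D γ` (so `γ` preserves `Dom D`) and `γ ξ = ξ`.
[cite: ConnesConsaniMoscovici2024, Def. 2.3 p. 6 (p0006:L23)] -/
structure IsZ2Grading (D : H →ₗ.[ℂ] H) (ξ : H) (γ : H →L[ℂ] H) : Prop where
  mul_self : γ * γ = 1
  isSelfAdjoint : IsSelfAdjoint γ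
  mapsTo_domain : ∀ x : D.domain, γ (x : H) ∈ D.domain
  anticomm : ∀ x : D.domain, γ (D x) = -D ⟨γ (x : H), mapsTo_domain x⟩
  map_vec : γ ξ = ξ

/-- RH-FREE. **Definition 2.3**: a cyclic pair is *even* if it admits a `ℤ/2`-grading.
[cite: ConnesConsaniMoscovici2024, Def. 2.3 p. 6 (p0006:L23)] -/
def IsEvenCyclicPair (D : H →ₗ.[ℂ] H) (ξ : H) : Prop :=
  IsCyclicPair D ξ ∧ ∃ γ : H →L[ℂ] H, IsZ2Grading D ξ γ

/-- RH-FREE named fact. **Eq. (9)** (three-term recurrence; §2.1, whose standing hypothesis is "Let `(D, ξ)`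
be an even cyclic pair", p0006:L38): `D ξ_n = a_{n−1} ξ_{n−1} + a_n ξ_{n+1}` with `a_n ≠ 0`, the phases of the
`ξ_n` being fixed so that `a_n > 0` (here: the Gram–Schmidt phases).  For a general (non-even) cyclic pair the
Jacobi matrix of `D` carries the diagonal `⟨Dξ_n | ξ_n⟩`, which vanishes by parity in the even case and which the
printed display omits; the fact is therefore stated for EVEN cyclic pairs (hypothesis `IsEvenCyclicPair`, added
after cc-t14's faithfulness note of 2026-08-26 — the first typing quantified over all cyclic pairs, which is
false).  PROVED (body, under `IsEvenCyclicPair`) as `CCM2024_eq_9_of_even` by seat t16 in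
`ProlateWaveCyclicPairsJacobiProofs.lean` (general three-term recurrence with diagonal `b_n`, and `b_n = 0` by
`γ ξ_n = (−1)ⁿ ξ_n`); the discharge `CCM2024_eq_9_holds` is a reordering of that theorem.
[cite: ConnesConsaniMoscovici2024, §2.1 eq. (9) p. 7 (p0006:L38, p0006:L49)] -/
def CCM2024_eq_9 : Prop :=
  ∀ {H : Type} [NormedAddCommGroup H] [InnerProductSpace ℂ H] [CompleteSpace H]
    (D : H →ₗ.[ℂ] H) (ξ : H) (v : ℕ → D.domain), IsEvenCyclicPair D ξ → IsIterateSeq D ξ v →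
    (∀ n : ℕ, (((jacobiCoeff v n).re : ℝ) : ℂ) = jacobiCoeff v n ∧ 0 < (jacobiCoeff v n).re) ∧
    D (cyclicBasisDom v 0) = jacobiCoeff v 0 • cyclicBasis v 1 ∧
    ∀ n : ℕ, D (cyclicBasisDom v (n + 1)) =
      jacobiCoeff v n • cyclicBasis v n + jacobiCoeff v (n + 1) • cyclicBasis v (n + 2)

/-- A `ℤ/2`-grading is a unitary ("a unitary of square `1`, `γ = γ*`"). [cite: ConnesConsaniMoscovici2024, Def. 2.3 p. 6 (p0006:L23)] -/
theorem IsZ2Grading.mem_unitary {D : H →ₗ.[ℂ] H} {ξ : H} {γ : H →L[ℂ] H}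
    (hγ : IsZ2Grading D ξ γ) : γ ∈ unitary (H →L[ℂ] H) := by
  rw [Unitary.mem_iff, hγ.isSelfAdjoint.star_eq]
  exact ⟨hγ.mul_self, hγ.mul_self⟩

/-- `γ Dʲξ = (−1)ʲ Dʲξ` (proof of Prop. 2.1, p. 7: "One has `γDʲξ = (−1)ʲDʲξ`").
[cite: ConnesConsaniMoscovici2024, Prop. 2.1 (proof) p. 7 (p0006:L34)] -/
theorem IsZ2Grading.apply_iterate {D : H →ₗ.[ℂ] H} {ξ : H} {γ : H →L[ℂ] H} {v : ℕ → D.domain}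
    (hγ : IsZ2Grading D ξ γ) (hv : IsIterateSeq D ξ v) (j : ℕ) :
    γ (v j : H) = (-1 : ℂ) ^ j • (v j : H) := by
  induction j with
  | zero => rw [hv.1, hγ.map_vec, pow_zero, one_smul]
  | succ j ih =>
    have hmem : γ (v j : H) ∈ D.domain := hγ.mapsTo_domain (v j)
    have hdom : (⟨γ (v j : H), hmem⟩ : D.domain) = (-1 : ℂ) ^ j • v j :=
      Subtype.ext (by rw [Submodule.coe_smul]; exact ih)
    rw [hv.2 j, hγ.anticomm (v j), hdom, LinearPMap.map_smul, ← hv.2 j, pow_succ, mul_comm,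
      ← smul_smul, neg_one_smul]

/-- RH-FREE. **Proposition 2.1, uniqueness half** (PROVED): a cyclic pair admits at most one
`ℤ/2`-grading ("the product `u = γγ′` commutes with `D` and fulfills `uξ = ξ` … since `ξ` is cyclic
one obtains `u = 1`"). [cite: ConnesConsaniMoscovici2024, Prop. 2.1 p. 6 (p0006:L25)] -/
theorem IsZ2Grading.unique {D : H →ₗ.[ℂ] H} {ξ : H} {γ γ' : H →L[ℂ] H} (hD : IsCyclicPair D ξ)
    (hγ : IsZ2Grading D ξ γ) (hγ' : IsZ2Grading D ξ γ') : γ = γ' := by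
  obtain ⟨v, hv, hdense⟩ := hD.exists_iterateSeq_dense
  refine ContinuousLinearMap.ext_on hdense ?_
  rintro _ ⟨j, rfl⟩
  rw [hγ.apply_iterate hv, hγ'.apply_iterate hv]

/-- RH-FREE named fact. **Proposition 2.1**, remaining clause: a cyclic pair is even iff its spectral
measure is invariant under `s ↦ −s`.  The other printed clauses are PROVED separately and therefore not part
of this fact: uniqueness of the grading (`IsZ2Grading.unique`) and `γ = exp(iπN)`, i.e. `γ ξ_j = (−1)ʲ ξ_j`
on the orthonormal basis (`IsZ2Grading.apply_cyclicBasis`, seat t16, `ProlateWaveCyclicPairsJacobiProofs.lean`,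
by Gram–Schmidt equivariance; clause removed from this fact once proved). [cite: ConnesConsaniMoscovici2024, Prop. 2.1 p. 6 (p0006:L25)] -/
def CCM2024_prop_2_1 : Prop :=
  ∀ {H : Type} [NormedAddCommGroup H] [InnerProductSpace ℂ H] [CompleteSpace H]
    (D : H →ₗ.[ℂ] H) (ξ : H) (μ : Measure ℝ) (U : H ≃ₗᵢ[ℂ] Lp ℂ 2 μ),
    IsCyclicPair D ξ → IsCanonicalForm D ξ μ U →
    ((∃ γ : H →L[ℂ] H, IsZ2Grading D ξ γ) ↔ μ.map (fun s : ℝ => -s) = μ)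

/-! ### §2.1 Spectral triple of a cyclic pair: Propositions 2.2 and 2.3 (pp. 7–8) -/

/-- RH-FREE. The action `f(N) = Σ_j f(j) |ξ_j⟩⟨ξ_j|` of `f ∈ c_c(ℕ)` (finitely supported) on `H`
(eq. (8) restricted to `c_c(ℕ) ⊂ c_0(ℕ)`, as in Prop. 2.2), a finite-rank bounded operator.
[cite: ConnesConsaniMoscovici2024, §2.1 eq. (8) p. 7 (p0006:L41)] -/
def funcCalcN (e : ℕ → H) (f : ℕ →₀ ℂ) : H →L[ℂ] H :=
  f.sum fun j c => c • rankOne ℂ (e j) (e j)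

/-- RH-FREE. The finite-rank commutator `[D, f] = Σ_j (f(j) − f(j+1)) a_j (|ξ_{j+1}⟩⟨ξ_j| − |ξ_j⟩⟨ξ_{j+1}|)`
computed in the proof of Prop. 2.2 (display p. 7; the sum is over `j ≤ max supp f`, beyond which the
coefficients vanish). [cite: ConnesConsaniMoscovici2024, Prop. 2.2 (proof) p. 7 (p0007:L8)] -/
def commutatorOp (e : ℕ → H) (a : ℕ → ℂ) (f : ℕ →₀ ℂ) : H →L[ℂ] H :=
  ∑ j ∈ Finset.range (f.support.sup id + 1),
    ((f j - f (j + 1)) * a j) • (rankOne ℂ (e (j + 1)) (e j) - rankOne ℂ (e j) (e (j + 1)))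

/-- RH-FREE named fact. **Proposition 2.2**: with `𝒜 = c₀(ℕ)` acting by `f(N)`, `(𝒜, H, D)` is a
spectral triple — for `f ∈ c_c(ℕ)`, `f(N)` maps `Dom D` into `Dom D`, the commutator `D f(N) − f(N) D`
is the finite-rank operator `commutatorOp`, and (eq. (10))
`max_j |(f(j) − f(j+1)) a_j| ≤ ‖[D, f]‖ ≤ 2 max_j |(f(j) − f(j+1)) a_j|`.
[cite: ConnesConsaniMoscovici2024, Prop. 2.2 & eq. (10) p. 7 (p0006:L44, p0007:L48)] -/
def CCM2024_prop_2_2 : Prop :=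
  ∀ {H : Type} [NormedAddCommGroup H] [InnerProductSpace ℂ H] [CompleteSpace H]
    (D : H →ₗ.[ℂ] H) (ξ : H) (v : ℕ → D.domain), IsCyclicPair D ξ → IsIterateSeq D ξ v →
    ∀ f : ℕ →₀ ℂ,
    (∀ x : D.domain, ∃ hx : funcCalcN (cyclicBasis v) f (x : H) ∈ D.domain,
        D ⟨funcCalcN (cyclicBasis v) f (x : H), hx⟩ - funcCalcN (cyclicBasis v) f (D x) =
          commutatorOp (cyclicBasis v) (jacobiCoeff v) f (x : H)) ∧
    (∀ j : ℕ, ‖(f j - f (j + 1)) * jacobiCoeff v j‖ ≤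
        ‖commutatorOp (cyclicBasis v) (jacobiCoeff v) f‖) ∧
    ∀ M : ℝ, (∀ j : ℕ, ‖(f j - f (j + 1)) * jacobiCoeff v j‖ ≤ M) →
      ‖commutatorOp (cyclicBasis v) (jacobiCoeff v) f‖ ≤ 2 * M

/-- RH-FREE. `φ(n) := Σ_{0 ≤ j ≤ n} a_j⁻¹ ∈ ℝ₊` (Prop. 2.3; `a_j > 0`, written `‖a_j‖⁻¹`).
[cite: ConnesConsaniMoscovici2024, Prop. 2.3 p. 8 (p0007:L52)] -/
def spectralPhi (a : ℕ → ℂ) (n : ℕ) : ℝ :=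
  ∑ j ∈ Finset.range (n + 1), ‖a j‖⁻¹

/-- RH-FREE named fact, TYPED AS PRINTED — and **FALSE AS PRINTED** (index slip found in the kernel by seat
t16, 2026-08-26): **Proposition 2.3** (eq. (11)) states that the spectral distance of `(𝒜, H, D)` on `ℕ` is
equivalent to `d(n,m) := |φ(n) − φ(m)|`, `φ(n) = Σ_{0≤j≤n} a_j⁻¹`:
`½ d(n,m) ≤ sup{|f(n) − f(m)| : ‖[D,f]‖ ≤ 1} ≤ d(n,m)` (sup over `f ∈ c_c(ℕ)`, as in the proof).  The printed
proof's telescoping gives instead `S(n,m) = |Σ_{j<n} a_j⁻¹ − Σ_{j<m} a_j⁻¹| = |φ(n−1) − φ(m−1)|`, and already the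
archimedean pair `(𝕊, ξ_∞)` (`a_0 = 1/√2`, `a_1 = √3`, eq. (26)) violates the printed upper bound at
`(n,m) = (1,0)`; the CORRECTED statement is PROVED as
`Literature.NumberTheory.ConnesConsani2024.CCM2024_prop_2_3_corrected` (seat t16,
`ProlateWaveCyclicPairsJacobiProofs.lean`).  This def is kept verbatim as the record of the printed claim (an
ERRATA-sheet entry; do not use it as a hypothesis). [cite: ConnesConsaniMoscovici2024, Prop. 2.3 eq. (11) p. 8 (p0007:L52)] -/
def CCM2024_prop_2_3 : Prop :=
  ∀ {H : Type} [NormedAddCommGroup H] [InnerProductSpace ℂ H] [CompleteSpace H]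
    (D : H →ₗ.[ℂ] H) (ξ : H) (v : ℕ → D.domain), IsCyclicPair D ξ → IsIterateSeq D ξ v →
    ∀ n m : ℕ,
    let d : ℝ := |spectralPhi (jacobiCoeff v) n - spectralPhi (jacobiCoeff v) m|
    let S : Set ℝ := {r | ∃ f : ℕ →₀ ℂ,
      ‖commutatorOp (cyclicBasis v) (jacobiCoeff v) f‖ ≤ 1 ∧ r = ‖f n - f m‖}
    d / 2 ≤ sSup S ∧ sSup S ≤ d

end CyclicPairs

/-! ### Definition 2.2 and §2.2: the formal prolate operator and its Jacobi matrices (pp. 6, 9)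

At the formal level (§2.2 p. 9: "ignoring the issue of selfadjointness of `D`, an even cyclic pair is
determined by the sequence `(a_n)` which gives the Jacobi matrix of the operator `D` in the basis
`(ξ_n)` by (9) while no longer assuming that the `a_n` are real"), operators act on coefficient
sequences `c : ℕ → ℂ` (column vectors) by their matrices: `D_{n,n+1} = a_n`, `D_{n+1,n} = ā_n`. -/

section Formal

/-! Two-sided convention.  We index coefficient sequences by `ℤ`; the printed `ℕ × ℕ` matrices are the
case `a n = 0` and `c n = 0` for `n < 0` (for the scaling pair of §3, `α_{−1} = 0` automatically).
This avoids case distinctions at `n = 0` and proves Prop. 2.4 uniformly. -/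

/-- RH-FREE. The Jacobi matrix of `D` (eq. (9); display p. 9) acting on a coefficient sequence
(column vector): `(D c)_n = ā_{n−1} c_{n−1} + a_n c_{n+1}` (`D_{n,n+1} = a_n`, `D_{n+1,n} = ā_n`).
[cite: ConnesConsaniMoscovici2024, §2.2 p. 9 (p0007:L71)] -/
def jacobiSeq (a : ℤ → ℂ) (c : ℤ → ℂ) (n : ℤ) : ℂ :=
  conj (a (n - 1)) * c (n - 1) + a n * c (n + 1)

/-- RH-FREE. The number operator `N ξ_j = j ξ_j` (p. 6) on coefficient sequences: `(N c)_n = n c_n`.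
[cite: ConnesConsaniMoscovici2024, §2 p. 6 (p0006:L14)] -/
def numberSeq (c : ℤ → ℂ) (n : ℤ) : ℂ := (n : ℂ) * c n

/-- RH-FREE. **Definition 2.2**: the formal prolate operator `ω(D, ξ, λ) := −D² + λ² N` of a cyclic
pair ("formal inasmuch as it does not give precisely the domain of the operator"), here on coefficient
sequences in the basis `(ξ_n)`. [cite: ConnesConsaniMoscovici2024, Def. 2.2 p. 6 (p0006:L16)] -/
def formalProlateSeq (a : ℤ → ℂ) (lam : ℝ) (c : ℤ → ℂ) (n : ℤ) : ℂ :=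
  -jacobiSeq a (jacobiSeq a c) n + (lam : ℂ) ^ 2 * numberSeq c n

/-- RH-FREE. A hermitian Jacobi (tridiagonal) matrix with diagonal `b` and upper diagonal `u`
(`J_{n,n} = b_n`, `J_{n,n+1} = u_n = conj J_{n+1,n}`; notation of §3.5 p. 13) acting on column vectors.
[cite: ConnesConsaniMoscovici2024, §3.5 p. 13 (p0009:L123)] -/
def triSeq (b u : ℤ → ℂ) (c : ℤ → ℂ) (n : ℤ) : ℂ :=
  conj (u (n - 1)) * c (n - 1) + b n * c n + u n * c (n + 1)

/-- RH-FREE. `J⁺_{n,n} = −a_{2n} ā_{2n} − a_{2n−1} ā_{2n−1} + 2nλ²` (eq. (12)).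
[cite: ConnesConsaniMoscovici2024, Prop. 2.4 eq. (12) p. 9 (p0007:L124)] -/
def jacobiPlusDiag (a : ℤ → ℂ) (lam : ℝ) (n : ℤ) : ℂ :=
  -(a (2 * n) * conj (a (2 * n))) - a (2 * n - 1) * conj (a (2 * n - 1)) + 2 * (n : ℂ) * (lam : ℂ) ^ 2

/-- RH-FREE. `J⁺_{n,n+1} = −a_{2n} a_{2n+1}` (eq. (12)). [cite: ConnesConsaniMoscovici2024, Prop. 2.4 eq. (12) p. 9 (p0007:L124)] -/
def jacobiPlusOff (a : ℤ → ℂ) (n : ℤ) : ℂ := -(a (2 * n) * a (2 * n + 1))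

/-- RH-FREE. `J⁻_{n,n} = −a_{2n} ā_{2n} − a_{2n+1} ā_{2n+1} + (2n+1)λ²` (eq. (13)).
[cite: ConnesConsaniMoscovici2024, Prop. 2.4 eq. (13) p. 9 (p0007:L128)] -/
def jacobiMinusDiag (a : ℤ → ℂ) (lam : ℝ) (n : ℤ) : ℂ :=
  -(a (2 * n) * conj (a (2 * n))) - a (2 * n + 1) * conj (a (2 * n + 1)) +
    (2 * (n : ℂ) + 1) * (lam : ℂ) ^ 2

/-- RH-FREE. `J⁻_{n,n+1} = −a_{2n+1} a_{2n+2}` (eq. (13)). [cite: ConnesConsaniMoscovici2024, Prop. 2.4 eq. (13) p. 9 (p0007:L128)] -/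
def jacobiMinusOff (a : ℤ → ℂ) (n : ℤ) : ℂ := -(a (2 * n + 1) * a (2 * n + 2))

/-- RH-FREE. **Proposition 2.4, even part** (PROVED): the formal prolate operator commutes with the
grading and on `H⁺` (coefficient sequences supported on even indices) it is the Jacobi matrix `J⁺` of
eq. (12); its odd components vanish there. [cite: ConnesConsaniMoscovici2024, Prop. 2.4 eq. (12) p. 9 (p0007:L121)] -/
theorem CCM2024_prop_2_4_even (a : ℤ → ℂ) (lam : ℝ) (c : ℤ → ℂ) (hc : ∀ k : ℤ, c (2 * k + 1) = 0)
    (n : ℤ) :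
    formalProlateSeq a lam c (2 * n) =
        triSeq (jacobiPlusDiag a lam) (jacobiPlusOff a) (fun k => c (2 * k)) n ∧
      formalProlateSeq a lam c (2 * n + 1) = 0 := by
  have h1 : c (2 * n - 1) = 0 := by have := hc (n - 1); rwa [show 2 * (n - 1) + 1 = 2 * n - 1 by ring] at this
  have h2 : c (2 * n + 1) = 0 := hc n
  have h3 : c (2 * n + 3) = 0 := by have := hc (n + 1); rwa [show 2 * (n + 1) + 1 = 2 * n + 3 by ring] at this
  refine ⟨?_, ?_⟩
  · simp only [formalProlateSeq, jacobiSeq, numberSeq, triSeq, jacobiPlusDiag, jacobiPlusOff, map_neg,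
      map_mul, show 2 * n - 1 - 1 = 2 * (n - 1) by ring, show 2 * n - 1 + 1 = 2 * n by ring,
      show 2 * n + 1 - 1 = 2 * n by ring, show 2 * n + 1 + 1 = 2 * (n + 1) by ring,
      show 2 * (n - 1) + 1 = 2 * n - 1 by ring]
    push_cast
    ring
  · simp only [formalProlateSeq, jacobiSeq, numberSeq, show 2 * n + 1 - 1 = 2 * n by ring,
      show 2 * n + 1 + 1 = 2 * n + 2 by ring,
      show 2 * n + 2 - 1 = 2 * n + 1 by ring, show 2 * n + 2 + 1 = 2 * n + 3 by ring, h1, h2, h3]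
    ring

/-- RH-FREE. **Proposition 2.4, odd part** (PROVED): on `H⁻` (sequences supported on odd indices) the
formal prolate operator is the Jacobi matrix `J⁻` of eq. (13); its even components vanish there.
[cite: ConnesConsaniMoscovici2024, Prop. 2.4 eq. (13) p. 9 (p0007:L121)] -/
theorem CCM2024_prop_2_4_odd (a : ℤ → ℂ) (lam : ℝ) (c : ℤ → ℂ) (hc : ∀ k : ℤ, c (2 * k) = 0)
    (n : ℤ) :
    formalProlateSeq a lam c (2 * n + 1) =
        triSeq (jacobiMinusDiag a lam) (jacobiMinusOff a) (fun k => c (2 * k + 1)) n ∧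
      formalProlateSeq a lam c (2 * n) = 0 := by
  have h0 : c (2 * n) = 0 := hc n
  have h2 : c (2 * n + 2) = 0 := by have := hc (n + 1); rwa [show 2 * (n + 1) = 2 * n + 2 by ring] at this
  have hm2 : c (2 * n - 2) = 0 := by have := hc (n - 1); rwa [show 2 * (n - 1) = 2 * n - 2 by ring] at this
  refine ⟨?_, ?_⟩
  · simp only [formalProlateSeq, jacobiSeq, numberSeq, triSeq, jacobiMinusDiag, jacobiMinusOff, map_neg,
      map_mul, show 2 * n + 1 - 1 = 2 * n by ring,
      show 2 * n + 1 + 1 = 2 * n + 2 by ring, show 2 * n + 2 + 1 = 2 * n + 3 by ring,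
      show 2 * n - 1 = 2 * (n - 1) + 1 by ring,
      show 2 * n + 3 = 2 * (n + 1) + 1 by ring]
    push_cast
    ring
  · simp only [formalProlateSeq, jacobiSeq, numberSeq, show 2 * n - 1 - 1 = 2 * n - 2 by ring,
      show 2 * n - 1 + 1 = 2 * n by ring, show 2 * n + 1 - 1 = 2 * n by ring,
      show 2 * n + 1 + 1 = 2 * n + 2 by ring, h0, h2, hm2]
    ring

end Formal

/-! ## §3. Hardy–Titchmarsh transform: archimedean place (pp. 9–15, p0008–p0011) -/

section Archimedean

/-! ### The objects: Hermite functions, `𝕊`, `𝐇`, `W_λ`, the transforms (§3.1–§3.2) -/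

/-- RH-FREE. The normalised even Hermite functions `h_{2n} ∈ L²(ℝ)^{ev}` by the printed formula (21):
`h_{2n}(x) = Σ_{k=0}^{n} (−1)^{n−k} 2^{−n+3k+1/4} ((2n)!)^{1/2}/((2k)!(n−k)!) πᵏ x^{2k} e^{−πx²}`
(eigenfunctions of `𝐇 = −∂² + (2πq)²` for the eigenvalues `2π(4n+1)`; `h_0(x) = 2^{1/4}e^{−πx²}`).
Dictionary with Mathlib's probabilists' Hermite polynomials `Polynomial.hermite` (tree: `hermiteR`):
`h_m(x) = 2^{1/4}(m!)^{−1/2} He_m(2√π x) e^{−πx²}` (`CCM2024_eq_21`).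
[cite: ConnesConsaniMoscovici2024, Prop. 3.2 (ii) eq. (21) p. 11 (p0008:L118)] -/
def evenHermiteFn (n : ℕ) (x : ℝ) : ℝ :=
  ∑ k ∈ Finset.range (n + 1),
    (-1 : ℝ) ^ (n - k) * ((2 : ℝ) ^ (1 / 4 : ℝ) * 2 ^ (3 * k) / 2 ^ n) * Real.sqrt ((2 * n)! : ℝ) /
      (((2 * k)! : ℝ) * ((n - k)! : ℝ)) * π ^ k * x ^ (2 * k) * Real.exp (-π * x ^ 2)

/-- `h_0` of eq. (21) is the tree's `hermiteH0` (`2^{1/4} e^{−πx²}`, §3.2 p. 10: `ξ_∞ = h_0`).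
[cite: ConnesConsaniMoscovici2024, §3.2 p. 10 (p0008:L72)] -/
theorem evenHermiteFn_zero : evenHermiteFn 0 = hermiteH0 := by
  funext x
  simp [evenHermiteFn, hermiteH0]

/-- `h_{2n}(0) = (−1)ⁿ 2^{1/4−n} ((2n)!)^{1/2}/n!` (§3.6 p. 14, display after (29)).
[cite: ConnesConsaniMoscovici2024, §3.6 p. 14 (p0010:L32)] -/
theorem evenHermiteFn_apply_zero (n : ℕ) :
    evenHermiteFn n 0 = (-1 : ℝ) ^ n * ((2 : ℝ) ^ (1 / 4 : ℝ) / 2 ^ n) * Real.sqrt ((2 * n)! : ℝ) /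
      (n ! : ℝ) := by
  unfold evenHermiteFn
  rw [Finset.sum_eq_single 0]
  · simp
  · intro k _ hk
    have : (0 : ℝ) ^ (2 * k) = 0 := zero_pow (by omega)
    simp [this]
  · intro h; simp at h

/-- RH-FREE named fact (dictionary). **Eq. (21) versus Hermite polynomials**: the printed `h_{2n}` is
`2^{1/4}((2n)!)^{−1/2} He_{2n}(2√π x) e^{−πx²}` with Mathlib's `Polynomial.hermite` (`hermiteR`), i.e.
the `h_n` ARE the `L²(ℝ, dx)`-normalised Hermite functions for the weight `e^{−πx²}`
("`h_n(x) = H_n(x)h_0(x)` where the `H_n` are orthogonal (and normalized) polynomials", p. 10).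
[cite: ConnesConsaniMoscovici2024, Thm. 3.1 p. 10 (p0008:L23); Prop. 3.2 (ii) eq. (21) p. 11] -/
def CCM2024_eq_21 : Prop :=
  ∀ (n : ℕ) (x : ℝ), evenHermiteFn n x =
    (2 : ℝ) ^ (1 / 4 : ℝ) / Real.sqrt ((2 * n)! : ℝ) * (hermiteR (2 * n)).eval (2 * Real.sqrt π * x) *
      Real.exp (-π * x ^ 2)

/-- RH-FREE. The complex-valued version of a real test function (coercion helper). [folklore] -/
def toC (f : ℝ → ℝ) : ℝ → ℂ := fun x => (f x : ℂ)

/-- RH-FREE. The scaling operator `𝕊 := −i(H + ½)`, `H = x∂ₓ`, acting on (differentiable) functions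
(§3.2 p. 10).  It is the self-adjoint generator of the scaling unitaries `f ↦ λ^{1/2} f(λ·)` of
`L²(ℝ)^{ev}`, which in the tree are `λ^{1/2} • Literature.Analysis.OperatorTheory.lpDilation λ`
(`hasDerivAt_scalingFlow` below is the generator statement on differentiable representatives).
[cite: ConnesConsaniMoscovici2024, §3.2 p. 10 (p0008:L63)] -/
def scalingOpFun (f : ℝ → ℂ) (x : ℝ) : ℂ := -I * ((x : ℂ) * deriv f x + f x / 2)

/-- RH-FREE. The Hermite operator `𝐇 = −∂² + (2πq)²` on (twice differentiable) functions (Prop. 3.2,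
eq. (20)). [cite: ConnesConsaniMoscovici2024, Prop. 3.2 eq. (20) p. 11 (p0008:L112)] -/
def hermiteOpFun (f : ℝ → ℂ) (x : ℝ) : ℂ := -deriv (deriv f) x + ((2 * π * x : ℝ) : ℂ) ^ 2 * f x

/-- RH-FREE. The prolate wave operator `(W_λ ψ)(q) = −∂((λ² − q²)∂)ψ(q) + (2πλq)² ψ(q)` of eq. (5),
on (twice differentiable) functions on the whole line; the SAME differential expression as in the
tree's `IsProlateFunction.eigen` (there restricted to `[−λ, λ]` and real-valued).
[cite: ConnesConsaniMoscovici2024, eq. (5) p. 4 (p0004:L21)] -/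
def prolateWaveOpFun (lam : ℝ) (f : ℝ → ℂ) (x : ℝ) : ℂ :=
  -deriv (fun y : ℝ => ((lam ^ 2 - y ^ 2 : ℝ) : ℂ) * deriv f y) x + ((2 * π * lam * x : ℝ) : ℂ) ^ 2 * f x

/-- RH-FREE (PROVED dictionary). The scaling flow `U_t f(x) = e^{t/2} f(eᵗ x)` (= `λ^{1/2} f(λx)`,
`λ = eᵗ`) has generator `i𝕊` on differentiable `f`: `d/dt|_{t=0} U_t f(x) = i(𝕊f)(x) = x f′(x) + f(x)/2`
(§3.2 p. 10: "`𝕊` is the selfadjoint generator of the scaling unitary transformations"; the printed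
display parametrises `λ = e^{t/2}`). [cite: ConnesConsaniMoscovici2024, §3.2 p. 10 (p0008:L66)] -/
theorem hasDerivAt_scalingFlow {f : ℝ → ℂ} {x : ℝ} (hf : DifferentiableAt ℝ f x) :
    HasDerivAt (fun t : ℝ => (Real.exp (t / 2) : ℂ) * f (Real.exp t * x))
      (I * scalingOpFun f x) 0 := by
  have h1 : HasDerivAt (fun t : ℝ => (Real.exp (t / 2) : ℂ))
      (((Real.exp (0 / 2) * (1 / 2) : ℝ) : ℂ)) 0 :=
    (((hasDerivAt_id (0 : ℝ)).div_const 2).exp).ofReal_comp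
  have h2 : HasDerivAt (fun t : ℝ => Real.exp t * x) (Real.exp 0 * x) 0 :=
    (Real.hasDerivAt_exp 0).mul_const x
  have hfx : HasDerivAt f (deriv f x) (Real.exp 0 * x) := by
    simpa using hf.hasDerivAt
  have h2' : HasDerivAt (fun t : ℝ => f (Real.exp t * x)) ((Real.exp 0 * x) • deriv f x) 0 :=
    hfx.scomp (0 : ℝ) h2
  have h := h1.mul h2'
  refine h.congr_deriv ?_
  simp only [scalingOpFun, zero_div, Real.exp_zero, one_mul, ofReal_one, Complex.real_smul]
  push_cast
  ring_nf
  rw [I_sq]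
  ring

/-- RH-FREE (PROVED; display p. 11, proof of Cor. 3.2): `W_λ ψ = ∂(q² ∂ψ) + λ² 𝐇 ψ` for `C²`
functions. [cite: ConnesConsaniMoscovici2024, Cor. 3.2 (proof) p. 11 (p0009:L10)] -/
theorem prolateWaveOpFun_eq_add_hermite (lam : ℝ) {f : ℝ → ℂ} (hf : ContDiff ℝ 2 f) (x : ℝ) :
    prolateWaveOpFun lam f x =
      deriv (fun y : ℝ => ((y ^ 2 : ℝ) : ℂ) * deriv f y) x + (lam : ℂ) ^ 2 * hermiteOpFun f x := by
  have hd1 : Differentiable ℝ (deriv f) := hf.differentiable_deriv_two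
  have hA : HasDerivAt (fun y : ℝ => ((y ^ 2 : ℝ) : ℂ) * deriv f y)
      (((2 * x : ℝ) : ℂ) * deriv f x + ((x ^ 2 : ℝ) : ℂ) * deriv (deriv f) x) x := by
    have h1 : HasDerivAt (fun y : ℝ => ((y ^ 2 : ℝ) : ℂ)) ((2 * x : ℝ) : ℂ) x := by
      have := (hasDerivAt_pow 2 x).ofReal_comp
      simpa using this
    exact h1.mul (hd1 x).hasDerivAt
  have hB : HasDerivAt (fun y : ℝ => ((lam ^ 2 - y ^ 2 : ℝ) : ℂ) * deriv f y)
      (((-(2 * x) : ℝ) : ℂ) * deriv f x + ((lam ^ 2 - x ^ 2 : ℝ) : ℂ) * deriv (deriv f) x) x := by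
    have h1 : HasDerivAt (fun y : ℝ => ((lam ^ 2 - y ^ 2 : ℝ) : ℂ)) ((-(2 * x) : ℝ) : ℂ) x := by
      have := ((hasDerivAt_pow 2 x).const_sub (lam ^ 2)).ofReal_comp
      simpa using this
    exact h1.mul (hd1 x).hasDerivAt
  rw [prolateWaveOpFun, hermiteOpFun, hA.deriv, hB.deriv]
  push_cast
  ring

/-- RH-FREE (PROVED; display p. 11): `−𝕊² ψ − ¼ ψ = ∂(q² ∂ψ)` for `C²` functions, so that
`W_λ = −𝕊² + λ²𝐇 − ¼` ("which gives (22) using (20)"). [cite: ConnesConsaniMoscovici2024, Cor. 3.2 (proof) p. 11 (p0009:L11)] -/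
theorem neg_scalingOpFun_sq_eq {f : ℝ → ℂ} (hf : ContDiff ℝ 2 f) (x : ℝ) :
    -scalingOpFun (scalingOpFun f) x - f x / 4 =
      deriv (fun y : ℝ => ((y ^ 2 : ℝ) : ℂ) * deriv f y) x := by
  have hd0 : Differentiable ℝ f := hf.differentiable (by norm_num)
  have hd1 : Differentiable ℝ (deriv f) := hf.differentiable_deriv_two
  have hX : HasDerivAt (fun y : ℝ => (y : ℂ)) 1 x := by
    simpa using (hasDerivAt_id x).ofReal_comp
  -- derivative of `𝕊 f`
  have hS : HasDerivAt (fun y : ℝ => -I * ((y : ℂ) * deriv f y + f y / 2))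
      (-I * ((1 : ℂ) * deriv f x + (x : ℂ) * deriv (deriv f) x + deriv f x / 2)) x := by
    have h1 : HasDerivAt (fun y : ℝ => (y : ℂ) * deriv f y)
        ((1 : ℂ) * deriv f x + (x : ℂ) * deriv (deriv f) x) x := hX.mul (hd1 x).hasDerivAt
    have h2 : HasDerivAt (fun y : ℝ => f y / 2) (deriv f x / 2) x := (hd0 x).hasDerivAt.div_const 2
    exact (h1.add h2).const_mul (-I)
  have hA : HasDerivAt (fun y : ℝ => ((y ^ 2 : ℝ) : ℂ) * deriv f y)
      (((2 * x : ℝ) : ℂ) * deriv f x + ((x ^ 2 : ℝ) : ℂ) * deriv (deriv f) x) x := by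
    have h1 : HasDerivAt (fun y : ℝ => ((y ^ 2 : ℝ) : ℂ)) ((2 * x : ℝ) : ℂ) x := by
      simpa using (hasDerivAt_pow 2 x).ofReal_comp
    exact h1.mul (hd1 x).hasDerivAt
  have hSf : scalingOpFun f = fun y : ℝ => -I * ((y : ℂ) * deriv f y + f y / 2) := rfl
  rw [hA.deriv]
  conv_lhs => rw [scalingOpFun, hSf, hS.deriv]
  push_cast
  ring_nf
  rw [I_sq]
  ring

/-- RH-FREE. The multiplicative Fourier transform `𝔽_μ(f)(s) := ∫₀^∞ f(u) u^{−is} d*u` of §3.1.3,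
eq. (17) (`d*u = du/u`), written with Mathlib's Mellin transform: `𝔽_μ(f)(s) = (mellin f)(−is)`.
[cite: ConnesConsaniMoscovici2024, §3.1.3 eq. (17) p. 10 (p0008:L50)] -/
def mulHaarFourier (f : ℝ → ℂ) (s : ℂ) : ℂ := mellin f (-(I * s))

/-- RH-FREE. `w_∞(f)(u) := u^{1/2} f(u)`, `u > 0` (§3.1.2 eq. (16)). [cite: ConnesConsaniMoscovici2024, §3.1.2 eq. (16) p. 10 (p0008:L42)] -/
def wInfty (f : ℝ → ℝ) (u : ℝ) : ℝ := Real.sqrt u * f u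

/-- RH-FREE. `Σ(f)(x) := Σ_{n ≥ 1} f(nx)` (§3.6 p. 14). [cite: ConnesConsaniMoscovici2024, §3.6 p. 14 (p0010:L22)] -/
def sigmaMap (f : ℝ → ℝ) (x : ℝ) : ℝ := ∑' n : ℕ, f ((n + 1 : ℕ) * x)

/-- Dictionary (PROVED, by `rfl`): the map `ℰ := w_∞ ∘ Σ` of §3.6 is the tree's `connesE`
(`𝓔(f)(u) = u^{1/2} Σ_{n≥1} f(nu)`, Connes 2026 Letter (6.1)). [cite: ConnesConsaniMoscovici2024, §3.6 p. 14 (p0010:L22)] -/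
theorem connesE_eq_wInfty_sigmaMap (f : ℝ → ℝ) : connesE f = wInfty (sigmaMap f) := rfl

/-- RH-FREE. The Hardy–Titchmarsh transform `𝒰 : L²(ℝ)^{ev} → L²(ℝ)`,
`𝒰(f)(s) = π^{−1/2} ∫₀^∞ f(v) v^{1/2 − is} d*v` (§3.1.4 eq. (18); `𝒰 := π^{−1/2} 𝔽_μ ∘ w_∞`), as a
Mellin transform at `1/2 − is` (complex `s` allowed; the integral converges for `Im s > −1/2` on the
Gaussian core). [cite: ConnesConsaniMoscovici2024, §3.1.4 eq. (18) p. 10 (p0008:L58)] -/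
def transformU (f : ℝ → ℂ) (s : ℂ) : ℂ := ((Real.sqrt π : ℝ) : ℂ)⁻¹ * mellin f (1 / 2 - I * s)

/-- `𝒰 = π^{−1/2} 𝔽_μ ∘ w_∞` (§3.1.4; PROVED). [cite: ConnesConsaniMoscovici2024, §3.1.4 p. 10 (p0008:L55)] -/
theorem transformU_eq_mulHaarFourier (f : ℝ → ℂ) (s : ℂ) :
    transformU f s =
      ((Real.sqrt π : ℝ) : ℂ)⁻¹ * mulHaarFourier (fun u : ℝ => ((u : ℂ) ^ (1 / 2 : ℂ)) • f u) s := by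
  rw [transformU, mulHaarFourier, mellin_cpow_smul]
  congr 2
  ring

/-- RH-FREE. `𝒰(h_0)`, the image of `ξ_∞ = h_0` (display p. 10; by Thm. 3.1 (i) it equals
`2^{−3/4} π^{−1/2} L_∞(1/2 − is)`). [cite: ConnesConsaniMoscovici2024, §3.2 p. 10 (p0008:L78)] -/
def htBase (s : ℂ) : ℂ := transformU (toC hermiteH0) s

/-- RH-FREE named fact. **Theorem 3.1 (i)**: `𝒰(h_0) = 2^{−3/4} π^{−1/2} L_∞(1/2 − is)`, where
`L_∞(z) := π^{−z/2} Γ(z/2)` is the archimedean Euler factor — Mathlib's `Complex.Gammaℝ`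
(equivalently, display p. 10: `2^{−1/4} π^{1/2} 𝒰(h_0)(s) = ½ π^{−1/4 + is/2} Γ(1/4 − is/2)`); stated on
the half-plane `Im s > −1/2` of convergence (contains `ℝ`). [cite: ConnesConsaniMoscovici2024, Thm. 3.1 (i) p. 9 (p0008:L7)] -/
def CCM2024_thm_3_1_i : Prop :=
  ∀ s : ℂ, -1 / 2 < s.im →
    htBase s = (((2 : ℝ) ^ (-(3 / 4 : ℝ)) : ℝ) : ℂ) * ((Real.sqrt π : ℝ) : ℂ)⁻¹ * Gammaℝ (1 / 2 - I * s)

/-- RH-FREE (PROVED arithmetic behind the closed form of `dm`):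
`|2^{−3/4} π^{−1/2} L_∞(1/2 − is)|² = (2π)^{−3/2} |Γ(1/4 + is/2)|²` for real `s`.
[cite: ConnesConsaniMoscovici2024, Thm. 3.1 (ii) p. 9 (p0008:L9)] -/
theorem norm_sq_htClosedForm (s : ℝ) :
    ‖(((2 : ℝ) ^ (-(3 / 4 : ℝ)) : ℝ) : ℂ) * ((Real.sqrt π : ℝ) : ℂ)⁻¹ * Gammaℝ (1 / 2 - I * s)‖ ^ 2 =
      (2 * π) ^ (-(3 / 2 : ℝ)) * ‖Complex.Gamma (1 / 4 + I * s / 2)‖ ^ 2 := by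
  have hπ : (0 : ℝ) < π := Real.pi_pos
  -- `|π^{-z/2}| = π^{-1/4}` for `z = 1/2 - is`
  have hz : -(1 / 2 - I * (s : ℂ)) / 2 = ⟨-(1 / 4 : ℝ), s / 2⟩ := by
    apply Complex.ext
    · simp; ring
    · simp
  have hcpow : ‖(π : ℂ) ^ (-(1 / 2 - I * (s : ℂ)) / 2)‖ = π ^ (-(1 / 4 : ℝ)) := by
    rw [hz, Complex.norm_cpow_eq_rpow_re_of_pos hπ]
  -- `|Γ((1/2 - is)/2)| = |Γ(1/4 + is/2)|` (complex conjugates, `s` real)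
  have hΓ : ‖Complex.Gamma ((1 / 2 - I * (s : ℂ)) / 2)‖ = ‖Complex.Gamma (1 / 4 + I * s / 2)‖ := by
    rw [← Complex.norm_conj (Complex.Gamma ((1 / 2 - I * (s : ℂ)) / 2)), ← Complex.Gamma_conj]
    congr 2
    have : (1 / 2 - I * (s : ℂ)) / 2 = ⟨1 / 4, -(s / 2)⟩ := by
      apply Complex.ext
      · simp; ring
      · simp; ring
    rw [this]
    apply Complex.ext
    · simp
    · simp
  rw [Gammaℝ_def, norm_mul, norm_mul, norm_mul, hcpow, hΓ, norm_inv, Complex.norm_real,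
    Complex.norm_real, Real.norm_eq_abs, Real.norm_eq_abs,
    abs_of_pos (Real.rpow_pos_of_pos two_pos _), abs_of_pos (Real.sqrt_pos.mpr hπ),
    Real.sqrt_eq_rpow]
  have h2 : ((2 : ℝ) ^ (-(3 / 4 : ℝ))) ^ 2 = (2 : ℝ) ^ (-(3 / 2 : ℝ)) := by
    rw [← Real.rpow_natCast, ← Real.rpow_mul (by norm_num)]; norm_num
  have hπ' : ((π ^ (1 / 2 : ℝ))⁻¹ * π ^ (-(1 / 4 : ℝ))) ^ 2 = π ^ (-(3 / 2 : ℝ)) := by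
    rw [← Real.rpow_neg hπ.le, ← Real.rpow_add hπ, ← Real.rpow_natCast,
      ← Real.rpow_mul hπ.le]
    norm_num
  rw [Real.mul_rpow (by norm_num) hπ.le]
  calc (2 ^ (-(3 / 4 : ℝ)) * (π ^ (1 / 2 : ℝ))⁻¹ * (π ^ (-(1 / 4 : ℝ)) *
        ‖Complex.Gamma (1 / 4 + I * ↑s / 2)‖)) ^ 2
      = ((2 : ℝ) ^ (-(3 / 4 : ℝ))) ^ 2 * ((π ^ (1 / 2 : ℝ))⁻¹ * π ^ (-(1 / 4 : ℝ))) ^ 2 *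
          ‖Complex.Gamma (1 / 4 + I * ↑s / 2)‖ ^ 2 := by ring
    _ = _ := by rw [h2, hπ']

/-- RH-FREE. The density of the measure `dm := |𝒰(h_0)|² ds` on `ℝ` (eq. (19), p. 10).
[cite: ConnesConsaniMoscovici2024, §3.2 eq. (19) p. 10 (p0008:L87)] -/
def htDensity (s : ℝ) : ℝ := ‖htBase s‖ ^ 2

/-- RH-FREE. The measure `dm = |𝒰(h_0)|² ds` (eq. (19)); by Thm. 3.1 (ii) the probability measure
`(2π)^{−3/2} |Γ(1/4 + is/2)|² ds`. [cite: ConnesConsaniMoscovici2024, §3.2 eq. (19) p. 10 (p0008:L87)] -/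
def htMeasure : Measure ℝ := volume.withDensity fun s => ENNReal.ofReal (htDensity s)

/-- RH-FREE. `ℳ(f)(s) := 𝒰(h_0)(s)⁻¹ f(s)`, `ℳ : L²(ℝ) → L²(ℝ, dm)` (eq. (19)).
[cite: ConnesConsaniMoscovici2024, §3.2 eq. (19) p. 10 (p0008:L84)] -/
def transformM (f : ℝ → ℂ) (s : ℝ) : ℂ := (htBase s)⁻¹ * f s

/-- RH-FREE. `𝒱 := ℳ ∘ 𝒰 : L²(ℝ)^{ev} → L²(ℝ, dm)` (eq. (4), Prop. 3.1). [cite: ConnesConsaniMoscovici2024, Prop. 3.1 (i) p. 10 (p0008:L91)] -/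
def transformV (f : ℝ → ℂ) (s : ℝ) : ℂ := transformM (fun t : ℝ => transformU f t) s

/-- `𝒱(ξ_∞)` is the constant function `1` (Prop. 3.1 (i), proof p. 10: "by construction `𝒱(ξ_∞)(s) = 1`"),
at every `s` where `𝒰(h_0)(s) ≠ 0` (everywhere, by Thm. 3.1 (i)). PROVED. [cite: ConnesConsaniMoscovici2024, Prop. 3.1 (i) p. 10 (p0008:L101)] -/
theorem transformV_hermiteH0 {s : ℝ} (hs : htBase s ≠ 0) : transformV (toC hermiteH0) s = 1 := by
  unfold transformV transformM
  exact inv_mul_cancel₀ hs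

/-- RH-FREE. The Gaussian core: `x ↦ P(x) e^{−πx²}` for a polynomial `P` (the spaces `E_n` consist of
such functions with `P` even of degree `≤ 2n`, Prop. 3.2 proof p. 11). [cite: ConnesConsaniMoscovici2024, Prop. 3.2 (proof) p. 11 (p0008:L121)] -/
def gaussPolyFn (P : ℂ[X]) (x : ℝ) : ℂ := P.eval (x : ℂ) * (Real.exp (-π * x ^ 2) : ℂ)

/-- RH-FREE. The orthogonal polynomials `𝒫_m` of eq. (23):
`𝒫_m(x) = ((2m)!)^{1/2} Σ_{k=0}^{m} (−1)ᵏ 2^{3k−m} (Π_{j=0}^{k−1} (j − ix/2 + 1/4)) / ((2k)!(m−k)!)`.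
[cite: ConnesConsaniMoscovici2024, §3.4 eq. (23) p. 11 (p0009:L23)] -/
def htPoly (m : ℕ) : ℂ[X] :=
  C ((Real.sqrt ((2 * m)! : ℝ) : ℝ) : ℂ) *
    ∑ k ∈ Finset.range (m + 1),
      C ((-1 : ℂ) ^ k * 2 ^ (3 * k) / 2 ^ m / (((2 * k)! : ℂ) * ((m - k)! : ℂ))) *
        ∏ j ∈ Finset.range k, (C ((j : ℂ) + 1 / 4) - C (I / 2) * X)

/-- RH-FREE named fact. **Theorem 3.1 (ii)**, remaining measure-theoretic content: the polynomials `𝒫_n`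
of (23) are orthonormal in `L²(dm)`, `dm(s) = |𝒰(h_0)(s)|² ds = (2π)^{−3/2} |Γ(1/4 + is/2)|² ds` (printed
proof: `𝒰` isometric by Mellin–Plancherel and `h_{2n}` orthonormal).  Four printed clauses are PROVED separately
and therefore not part of this fact: the formula `𝒰(h_{2n}) = (−1)ⁿ 𝒫_n · 𝒰(h_0)` (`transformU_evenHermiteFn`),
the parity of `𝒫_n` (`htPoly_parity`), the closed form of `|𝒰(h_0)|² ds` (`htDensity_eq`), and "`dm` is a
probability measure" (`Literature.NumberTheory.ConnesConsani2024.isProbabilityMeasure_htMeasure`, seat t10,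
`ProlateWaveMomentsProofs.lean`, via the Beta integral). [cite: ConnesConsaniMoscovici2024, Thm. 3.1 (ii) p. 9 (p0008:L9); Prop. 3.3 (i) p. 11] -/
def CCM2024_thm_3_1_ii : Prop :=
  ∀ n m : ℕ, ∫ s : ℝ, conj ((htPoly n).eval (s : ℂ)) * (htPoly m).eval (s : ℂ) ∂htMeasure =
    if n = m then 1 else 0

/-- RH-FREE named fact. **Theorem 3.1 (iii)**: `ℳ : L²(ℝ, ds) → L²(ℝ, dm)` is a unitary
isomorphism (isometric on representatives and onto). [cite: ConnesConsaniMoscovici2024, Thm. 3.1 (iii) p. 9 (p0008:L11)] -/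
def CCM2024_thm_3_1_iii : Prop :=
  (∀ f : ℝ → ℂ, MemLp f 2 volume →
      MemLp (transformM f) 2 htMeasure ∧ eLpNorm (transformM f) 2 htMeasure = eLpNorm f 2 volume) ∧
  ∀ g : ℝ → ℂ, MemLp g 2 htMeasure → ∃ f : ℝ → ℂ, MemLp f 2 volume ∧ transformM f =ᵐ[htMeasure] g

/-- RH-FREE named fact. **Theorem 3.1 (iv)** (second half) / proof of Prop. 3.1 (i): `𝒱 = ℳ ∘ 𝒰`
transforms the scaling operator `𝕊` into multiplication by `s` — on the Gaussian core,
`𝒰(𝕊 f)(s) = s · 𝒰(f)(s)` (display p. 10: `∫((H+½)f)(v) v^{1/2−is} d*v = is ∫ f(v) v^{1/2−is} d*v`),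
and transforms `h_{2n}` into `(−1)ⁿ𝒫_n`. [cite: ConnesConsaniMoscovici2024, Thm. 3.1 (iv) p. 9 (p0008:L13); Prop. 3.1 (i) proof p. 10 (p0008:L98)] -/
def CCM2024_thm_3_1_iv : Prop :=
  (∀ (P : ℂ[X]) (s : ℂ), -1 / 2 < s.im →
      transformU (scalingOpFun (gaussPolyFn P)) s = s * transformU (gaussPolyFn P) s) ∧
  ∀ (n : ℕ) (s : ℝ), transformV (toC (evenHermiteFn n)) s = (-1) ^ n * (htPoly n).eval (s : ℂ)

/-- RH-FREE named fact. **Proposition 3.1**: (i) `𝒱 = ℳ ∘ 𝒰` gives the canonical form of the cyclic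
pair `(𝕊, ξ_∞)`, `ξ_∞ = h_0` — beyond Thm. 3.1 (iv) and `transformV_hermiteH0`, the cyclicity: the
Gaussian core `{P(x²)e^{−πx²}}` (= `⋃ E_n`, Prop. 3.2) is dense in `L²(ℝ)^{ev}` (the tree's
`evenPart`); (ii) `(𝕊, ξ_∞)` is even with grading the Fourier transform `𝔽_{e_ℝ}` (eq. (15)):
`𝔽 h_0 = h_0`, `𝔽² = 1` on `L²(ℝ)^{ev}`, and `𝔽 𝕊 = −𝕊 𝔽` on the core.
[cite: ConnesConsaniMoscovici2024, Prop. 3.1 p. 10 (p0008:L89–L101)] -/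
def CCM2024_prop_3_1 : Prop :=
  (∀ ξ ∈ evenPart, ∀ ε : ℝ, 0 < ε → ∃ P : ℂ[X],
      eLpNorm (fun x : ℝ => (ξ : ℝ → ℂ) x - gaussPolyFn (P.comp (X ^ 2)) x) 2 volume < ENNReal.ofReal ε) ∧
  (𝓕 (toC hermiteH0) = toC hermiteH0) ∧
  (∀ ξ ∈ evenPart, (𝓕 (𝓕 ξ : Lp ℂ 2 (volume : Measure ℝ)) : Lp ℂ 2 (volume : Measure ℝ)) = ξ) ∧
  ∀ (P : ℂ[X]) (x : ℝ), 𝓕 (scalingOpFun (gaussPolyFn P)) x = -scalingOpFun (𝓕 (gaussPolyFn P)) x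

/-- RH-FREE named fact. **Proposition 3.2**: (i) the number operator of `(𝕊, ξ_∞)` is
`N = 𝐇/(8π) − ¼`; (ii) its eigenfunctions are the even Hermite functions `h_{2n}`:
`𝐇 h_{2n} = 2π(4n+1) h_{2n}`, and `E_n = span{𝕊ʲξ_∞ : j ≤ n} = {e^{−πx²}P(x) : P even, deg P ≤ 2n}
= span{h_{2j} : j ≤ n}`. [cite: ConnesConsaniMoscovici2024, Prop. 3.2 eqs. (20)–(21) p. 11 (p0008:L107–L121)] -/
def CCM2024_prop_3_2 : Prop :=
  (∀ (n : ℕ) (x : ℝ),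
      hermiteOpFun (toC (evenHermiteFn n)) x = 2 * π * (4 * n + 1) * (evenHermiteFn n x : ℂ)) ∧
  ∀ n : ℕ,
    Submodule.span ℂ (Set.range fun j : Fin (n + 1) => scalingOpFun^[j] (toC hermiteH0)) =
      Submodule.span ℂ (Set.range fun k : Fin (n + 1) => gaussPolyFn (X ^ (2 * (k : ℕ)))) ∧
    Submodule.span ℂ (Set.range fun k : Fin (n + 1) => gaussPolyFn (X ^ (2 * (k : ℕ)))) =
      Submodule.span ℂ (Set.range fun j : Fin (n + 1) => toC (evenHermiteFn j))

/-- Prop. 3.2 (i) on eigenfunctions: `(𝐇/(8π) − ¼) h_{2n} = n h_{2n}` (PROVED from Prop. 3.2 (ii)).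
[cite: ConnesConsaniMoscovici2024, Prop. 3.2 (i) eq. (20) p. 11 (p0008:L112)] -/
theorem numberOp_evenHermiteFn (h : CCM2024_prop_3_2) (n : ℕ) (x : ℝ) :
    (1 / (8 * π) : ℂ) * hermiteOpFun (toC (evenHermiteFn n)) x - (1 / 4 : ℂ) * (evenHermiteFn n x : ℂ)
      = n * (evenHermiteFn n x : ℂ) := by
  rw [h.1 n x]
  have hπ : (π : ℂ) ≠ 0 := by exact_mod_cast Real.pi_ne_zero
  field_simp
  ring

/-- RH-FREE named fact. **Corollary 3.2 = Theorem 3.1 (v)** (eq. (14) = (22)):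
`(ℳ∘𝒰) ∘ W_λ ∘ (ℳ∘𝒰)* = −s² + 2πλ²(4N+1) − ¼` in `L²(ℝ, dm)`, `N 𝒫_n = n 𝒫_n` — on the
eigenbasis: `𝒰(W_λ h_{2n})(s) = (−s² + 2πλ²(4n+1) − ¼) 𝒰(h_{2n})(s)`.
[cite: ConnesConsaniMoscovici2024, Cor. 3.2 eq. (22) p. 11 (p0009:L1); Thm. 3.1 (v) eq. (14) p. 9] -/
def CCM2024_cor_3_2 : Prop :=
  ∀ (lam : ℝ) (n : ℕ) (s : ℂ), -1 / 2 < s.im →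
    transformU (prolateWaveOpFun lam (toC (evenHermiteFn n))) s =
      (-s ^ 2 + 2 * π * lam ^ 2 * (4 * n + 1) - 1 / 4) * transformU (toC (evenHermiteFn n)) s

/-! ### §3.4–§3.5: Jacobi matrices of `𝕊` and of `W_λ` (Propositions 3.3–3.5, pp. 11–13) -/

/-- RH-FREE. `α_n := (i/2) √((2n+1)(2n+2))`, the upper-diagonal entries of the Jacobi matrix of
multiplication by `x` in the basis `𝒫_m` (Prop. 3.3 (ii), eq. (26)); two-sided in `n ∈ ℤ`
(`α_{−1} = 0`, and `√` of a negative number is `0`, irrelevant). [cite: ConnesConsaniMoscovici2024, Prop. 3.3 (ii) eq. (26) p. 12 (p0009:L90)] -/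
def htAlpha (n : ℤ) : ℂ := I / 2 * (Real.sqrt ((2 * n + 1) * (2 * n + 2) : ℝ) : ℂ)

/-- `α_{−1} = 0` (so the two-sided Jacobi matrix restricts to `ℕ`, as printed). [cite: ConnesConsaniMoscovici2024, Prop. 3.3 (ii) eq. (26) p. 12 (p0009:L90)] -/
theorem htAlpha_neg_one : htAlpha (-1) = 0 := by
  simp [htAlpha]

/-- RH-FREE. `a_n = √((n+½)(n+1))`, the (positive, rephased) Jacobi sequence of `(𝕊, ξ_∞)`
(Prop. 3.4 proof p. 13). [cite: ConnesConsaniMoscovici2024, Prop. 3.4 (proof) p. 13 (p0009:L98)] -/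
def scalingJacobiA (n : ℕ) : ℝ := Real.sqrt ((n + 1 / 2) * (n + 1))

/-- `|α_n| = √((n+½)(n+1)) = a_n` (PROVED; "obtained after a change of phase", p. 13).
[cite: ConnesConsaniMoscovici2024, Prop. 3.4 (proof) p. 13 (p0009:L98)] -/
theorem norm_htAlpha (n : ℕ) : ‖htAlpha n‖ = scalingJacobiA n := by
  rw [htAlpha, norm_mul, norm_div, Complex.norm_I, Complex.norm_real, Real.norm_eq_abs,
    abs_of_nonneg (Real.sqrt_nonneg _), scalingJacobiA, Complex.norm_ofNat]
  rw [show ((2 * (n : ℤ) + 1) * (2 * (n : ℤ) + 2) : ℝ) = 2 ^ 2 * ((n + 1 / 2) * (n + 1)) by push_cast; ring,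
    Real.sqrt_mul (by norm_num), Real.sqrt_sq (by norm_num)]
  ring

/-- Prop. 3.3 (i) (PROVED projection of Thm. 3.1 (ii)): the `𝒫_m` are orthonormal for
`(2π)^{−3/2}|Γ(1/4 − ix/2)|² dx`. [cite: ConnesConsaniMoscovici2024, Prop. 3.3 (i) p. 11 (p0009:L28)] -/
theorem CCM2024_prop_3_3_i (h : CCM2024_thm_3_1_ii) (n m : ℕ) :
    ∫ s : ℝ, conj ((htPoly n).eval (s : ℂ)) * (htPoly m).eval (s : ℂ) ∂htMeasure =
      if n = m then 1 else 0 :=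
  h n m

/-- RH-FREE named fact. **Proposition 3.3 (ii)** (eq. (26)): in the basis `𝒫_m` the operator of
multiplication by `x` (acting on column vectors) is the hermitian Jacobi matrix with `0` on the
diagonal and `α_n = (i/2)√((2n+1)(2n+2))` on the upper diagonal:
`x 𝒫_n = ᾱ_n 𝒫_{n+1} + α_{n−1} 𝒫_{n−1}`. [cite: ConnesConsaniMoscovici2024, Prop. 3.3 (ii) eq. (26) p. 11–12 (p0009:L30, p0009:L90)] -/
def CCM2024_prop_3_3_ii : Prop :=
  X * htPoly 0 = C (conj (htAlpha 0)) * htPoly 1 ∧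
  ∀ n : ℕ, X * htPoly (n + 1) =
    C (conj (htAlpha (n + 1))) * htPoly (n + 2) + C (htAlpha n) * htPoly n

/-- RH-FREE named fact. **Eq. (25)**: `⟨(H + ½) h_{2n}, h_{2n+2}⟩ = −½ √((2n+1)(2n+2))`
(`H = x∂ₓ`; real `L²(ℝ, dx)` inner product). [cite: ConnesConsaniMoscovici2024, Prop. 3.3 (proof) eq. (25) p. 12 (p0009:L59)] -/
def CCM2024_eq_25 : Prop :=
  ∀ n : ℕ, ∫ x : ℝ, (x * deriv (evenHermiteFn n) x + evenHermiteFn n x / 2) * evenHermiteFn (n + 1) x =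
    -(1 / 2) * Real.sqrt ((2 * n + 1) * (2 * n + 2) : ℝ)

/-- RH-FREE named fact. **Proposition 3.4**: the spectral metric of `(𝕊, ξ_∞)` is equivalent to the
metric induced on `ℕ* ⊂ ℝ₊*` by the invariant metric of `ℝ₊*`; quantitatively (proof p. 13)
`1 ≤ a_n log(1 + 1/n) ≤ √3 log 2` for `n > 0`, `a_n = √((n+½)(n+1))`, whence
`|φ(n) − φ(m)| ≤ |log(n+1) − log(m+1)| ≤ √3 log 2 · |φ(n) − φ(m)|`, `φ(n) = Σ_{j≤n} a_j⁻¹`.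
[cite: ConnesConsaniMoscovici2024, Prop. 3.4 p. 13 (p0009:L96–L104)] -/
def CCM2024_prop_3_4 : Prop :=
  (∀ n : ℕ, 1 ≤ n →
      1 ≤ scalingJacobiA n * Real.log (1 + 1 / n) ∧
        scalingJacobiA n * Real.log (1 + 1 / n) ≤ Real.sqrt 3 * Real.log 2) ∧
  ∀ n m : ℕ,
    |spectralPhi (fun j => (scalingJacobiA j : ℂ)) n - spectralPhi (fun j => (scalingJacobiA j : ℂ)) m|
        ≤ |Real.log (n + 1) - Real.log (m + 1)| ∧
      |Real.log (n + 1) - Real.log (m + 1)| ≤ Real.sqrt 3 * Real.log 2 *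
        |spectralPhi (fun j => (scalingJacobiA j : ℂ)) n - spectralPhi (fun j => (scalingJacobiA j : ℂ)) m|

/-- RH-FREE. Eq. (27): `a_n = ¼((4n+1)(4n+2)(4n+3)(4n+4))^{1/2}` (off-diagonal of `W_λ⁺`; two-sided in
`n`). [cite: ConnesConsaniMoscovici2024, Prop. 3.5 eq. (27) p. 13 (p0010:L2)] -/
def prolatePlusA (n : ℤ) : ℝ :=
  1 / 4 * Real.sqrt ((4 * n + 1) * (4 * n + 2) * (4 * n + 3) * (4 * n + 4) : ℝ)

/-- RH-FREE. Eq. (27): `b_n = −8n² − 2n − ¾ + 2πλ²(8n+1)` (diagonal of `W_λ⁺`).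
[cite: ConnesConsaniMoscovici2024, Prop. 3.5 eq. (27) p. 13 (p0010:L3)] -/
def prolatePlusB (lam : ℝ) (n : ℤ) : ℝ := -8 * n ^ 2 - 2 * n - 3 / 4 + 2 * π * lam ^ 2 * (8 * n + 1)

/-- RH-FREE. Eq. (28): `a_n = ¼((4n+3)(4n+4)(4n+5)(4n+6))^{1/2}` (off-diagonal of `W_λ⁻`).
[cite: ConnesConsaniMoscovici2024, Prop. 3.5 eq. (28) p. 13 (p0010:L8)] -/
def prolateMinusA (n : ℤ) : ℝ :=
  1 / 4 * Real.sqrt ((4 * n + 3) * (4 * n + 4) * (4 * n + 5) * (4 * n + 6) : ℝ)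

/-- RH-FREE. Eq. (28): `b_n = −8n² − 10n − 15/4 + 2πλ²(8n+5)` (diagonal of `W_λ⁻`).
[cite: ConnesConsaniMoscovici2024, Prop. 3.5 eq. (28) p. 13 (p0010:L9)] -/
def prolateMinusB (lam : ℝ) (n : ℤ) : ℝ := -8 * n ^ 2 - 10 * n - 15 / 4 + 2 * π * lam ^ 2 * (8 * n + 5)

/-- RH-FREE. The canonical form `−s² + 2πλ²(4N+1) − ¼` of `W_λ` (eq. (22)) in the basis `𝒫_n`, at the
formal level of §2.2: `s` acts by the Jacobi matrix of Prop. 3.3 (ii) (`α_n`), `N` diagonally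
("This follows from (22) combined with Prop. 2.4 applied to the coefficients `α_n`", p. 13).
[cite: ConnesConsaniMoscovici2024, Cor. 3.2 eq. (22) p. 11 (p0009:L4); Prop. 3.5 (proof) p. 13 (p0010:L11)] -/
def canonicalProlateSeq (lam : ℝ) (c : ℤ → ℂ) (n : ℤ) : ℂ :=
  -jacobiSeq htAlpha (jacobiSeq htAlpha c) n + ((2 * π * lam ^ 2 * (4 * n + 1) - 1 / 4 : ℝ) : ℂ) * c n

/-- For an integer `m`, `(2m+1)(2m+2) ≥ 0`. [folklore] -/
private theorem int_consec_nonneg (m : ℤ) : (0 : ℝ) ≤ (2 * m + 1) * (2 * m + 2) := by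
  rcases le_or_gt 0 m with h | h
  · have : (0 : ℝ) ≤ m := by exact_mod_cast h
    positivity
  · have h' : m + 1 ≤ 0 := by omega
    have : (m : ℝ) + 1 ≤ 0 := by exact_mod_cast h'
    nlinarith

/-- `conj α_n = −α_n` (`α_n` is purely imaginary; hermitian Jacobi matrix of Prop. 3.3 (ii)). [cite: ConnesConsaniMoscovici2024, Prop. 3.3 (ii) eq. (26) p. 12 (p0009:L90)] -/
theorem conj_htAlpha (n : ℤ) : conj (htAlpha n) = -htAlpha n := by
  rw [htAlpha]
  simp only [map_mul, map_div₀, Complex.conj_I, Complex.conj_ofReal, map_ofNat]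
  ring

/-- `α_m ᾱ_m = (2m+1)(2m+2)/4` (diagonal entries in Prop. 3.5's computation). [cite: ConnesConsaniMoscovici2024, Prop. 3.5 (proof) p. 13 (p0010:L11)] -/
theorem htAlpha_mul_conj (m : ℤ) :
    htAlpha m * conj (htAlpha m) = (((2 * m + 1) * (2 * m + 2) / 4 : ℝ) : ℂ) := by
  rw [conj_htAlpha, htAlpha]
  have hs : ((Real.sqrt ((2 * m + 1) * (2 * m + 2) : ℝ) : ℂ)) ^ 2 = (((2 * m + 1) * (2 * m + 2) : ℝ) : ℂ) := by
    rw [← ofReal_pow, Real.sq_sqrt (int_consec_nonneg m)]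
  have : I / 2 * (Real.sqrt ((2 * m + 1) * (2 * m + 2) : ℝ) : ℂ) *
      -(I / 2 * (Real.sqrt ((2 * m + 1) * (2 * m + 2) : ℝ) : ℂ)) =
      -(I ^ 2) / 4 * ((Real.sqrt ((2 * m + 1) * (2 * m + 2) : ℝ) : ℂ)) ^ 2 := by ring
  rw [this, hs, I_sq]
  push_cast; ring

/-- `−α_m α_{m+1} = ¼ √((2m+1)(2m+2)(2m+3)(2m+4))` (off-diagonal entries in Prop. 3.5's computation). [cite: ConnesConsaniMoscovici2024, Prop. 3.5 (proof) p. 13 (p0010:L11)] -/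
theorem neg_htAlpha_mul_succ (m : ℤ) :
    -(htAlpha m * htAlpha (m + 1)) =
      ((1 / 4 * Real.sqrt ((2 * m + 1) * (2 * m + 2) * (2 * m + 3) * (2 * m + 4) : ℝ) : ℝ) : ℂ) := by
  rw [htAlpha, htAlpha]
  have e1 : ((2 * ((m + 1 : ℤ) : ℝ) + 1) * (2 * ((m + 1 : ℤ) : ℝ) + 2) : ℝ) =
      (2 * m + 3) * (2 * m + 4) := by push_cast; ring
  have : I / 2 * (Real.sqrt ((2 * m + 1) * (2 * m + 2) : ℝ) : ℂ) *
      (I / 2 * (Real.sqrt ((2 * ((m + 1 : ℤ) : ℝ) + 1) * (2 * ((m + 1 : ℤ) : ℝ) + 2) : ℝ) : ℂ)) =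
      I ^ 2 / 4 * ((Real.sqrt ((2 * m + 1) * (2 * m + 2) : ℝ) *
        Real.sqrt ((2 * m + 3) * (2 * m + 4) : ℝ) : ℝ) : ℂ) := by
    rw [e1]; push_cast; ring
  rw [this, I_sq, ← Real.sqrt_mul (int_consec_nonneg m),
    show ((2 * m + 1) * (2 * m + 2) * ((2 * m + 3) * (2 * m + 4)) : ℝ) =
      (2 * m + 1) * (2 * m + 2) * (2 * m + 3) * (2 * m + 4) by ring]
  push_cast
  ring

/-- RH-FREE. **Proposition 3.5, even part** (PROVED from Prop. 2.4 and `α_n`): the Jacobi matrix of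
`W_λ⁺` (even `𝒫`-coefficients) has the coefficients (27).
[cite: ConnesConsaniMoscovici2024, Prop. 3.5 eq. (27) p. 13 (p0009:L127–p0010:L3)] -/
theorem CCM2024_prop_3_5_even (lam : ℝ) (c : ℤ → ℂ) (hc : ∀ k : ℤ, c (2 * k + 1) = 0) (n : ℤ) :
    canonicalProlateSeq lam c (2 * n) =
      triSeq (fun k => (prolatePlusB lam k : ℂ)) (fun k => (prolatePlusA k : ℂ)) (fun k => c (2 * k)) n := by
  have h8 : ((Real.sqrt (8 * π) * lam : ℝ) : ℂ) ^ 2 = ((8 * π * lam ^ 2 : ℝ) : ℂ) := by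
    rw [← ofReal_pow, mul_pow, Real.sq_sqrt (by positivity)]
  -- `canonicalProlateSeq = formalProlateSeq α λ'  + (2πλ² − ¼)·id`, with `λ'² = 8πλ²`
  have key : canonicalProlateSeq lam c (2 * n) =
      formalProlateSeq htAlpha (Real.sqrt (8 * π) * lam) c (2 * n) +
        ((2 * π * lam ^ 2 - 1 / 4 : ℝ) : ℂ) * c (2 * n) := by
    simp only [canonicalProlateSeq, formalProlateSeq, numberSeq, h8]
    push_cast; ring
  rw [key, (CCM2024_prop_2_4_even htAlpha _ c hc n).1]
  simp only [triSeq, jacobiPlusDiag, jacobiPlusOff, prolatePlusB, prolatePlusA, h8, map_neg, map_mul,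
    conj_htAlpha, neg_mul_neg, Complex.conj_ofReal]
  have hA : htAlpha (2 * (n - 1)) * htAlpha (2 * (n - 1) + 1) =
      -(((1 / 4 * Real.sqrt ((4 * ((n - 1 : ℤ) : ℝ) + 1) * (4 * ((n - 1 : ℤ) : ℝ) + 2) *
        (4 * ((n - 1 : ℤ) : ℝ) + 3) * (4 * ((n - 1 : ℤ) : ℝ) + 4) : ℝ) : ℝ) : ℂ)) := by
    have h := neg_htAlpha_mul_succ (2 * (n - 1))
    rw [neg_eq_iff_eq_neg] at h
    rw [h]; push_cast; ring_nf
  have hB : htAlpha (2 * n) * htAlpha (2 * n + 1) =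
      -(((1 / 4 * Real.sqrt ((4 * n + 1) * (4 * n + 2) * (4 * n + 3) * (4 * n + 4) : ℝ) : ℝ) : ℂ)) := by
    have h := neg_htAlpha_mul_succ (2 * n)
    rw [neg_eq_iff_eq_neg] at h
    rw [h]; push_cast; ring_nf
  have hC : htAlpha (2 * n) * conj (htAlpha (2 * n)) = ((((4 * n + 1) * (4 * n + 2) / 4 : ℝ)) : ℂ) := by
    rw [htAlpha_mul_conj]; push_cast; ring
  have hD : htAlpha (2 * n - 1) * conj (htAlpha (2 * n - 1)) = ((((4 * n - 1) * (4 * n) / 4 : ℝ)) : ℂ) := by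
    rw [htAlpha_mul_conj]; push_cast; ring
  rw [conj_htAlpha] at hC hD
  rw [hA, hB]
  simp only [mul_neg, neg_neg] at hC hD ⊢
  rw [show htAlpha (2 * n) * htAlpha (2 * n) = -(((4 * n + 1) * (4 * n + 2) / 4 : ℝ) : ℂ) by
        rw [← hC]; ring,
      show htAlpha (2 * n - 1) * htAlpha (2 * n - 1) = -(((4 * n - 1) * (4 * n) / 4 : ℝ) : ℂ) by
        rw [← hD]; ring]
  push_cast
  ring

/-- RH-FREE. **Proposition 3.5, odd part** (PROVED): the Jacobi matrix of `W_λ⁻` (odd `𝒫`-coefficients)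
has the coefficients (28). [cite: ConnesConsaniMoscovici2024, Prop. 3.5 eq. (28) p. 13 (p0010:L5–L9)] -/
theorem CCM2024_prop_3_5_odd (lam : ℝ) (c : ℤ → ℂ) (hc : ∀ k : ℤ, c (2 * k) = 0) (n : ℤ) :
    canonicalProlateSeq lam c (2 * n + 1) =
      triSeq (fun k => (prolateMinusB lam k : ℂ)) (fun k => (prolateMinusA k : ℂ))
        (fun k => c (2 * k + 1)) n := by
  have h8 : ((Real.sqrt (8 * π) * lam : ℝ) : ℂ) ^ 2 = ((8 * π * lam ^ 2 : ℝ) : ℂ) := by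
    rw [← ofReal_pow, mul_pow, Real.sq_sqrt (by positivity)]
  have key : canonicalProlateSeq lam c (2 * n + 1) =
      formalProlateSeq htAlpha (Real.sqrt (8 * π) * lam) c (2 * n + 1) +
        ((2 * π * lam ^ 2 - 1 / 4 : ℝ) : ℂ) * c (2 * n + 1) := by
    simp only [canonicalProlateSeq, formalProlateSeq, numberSeq, h8]
    push_cast; ring
  rw [key, (CCM2024_prop_2_4_odd htAlpha _ c hc n).1]
  simp only [triSeq, jacobiMinusDiag, jacobiMinusOff, prolateMinusB, prolateMinusA, h8, map_neg, map_mul,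
    conj_htAlpha, neg_mul_neg, Complex.conj_ofReal]
  have hA : htAlpha (2 * (n - 1) + 1) * htAlpha (2 * (n - 1) + 2) =
      -(((1 / 4 * Real.sqrt ((4 * ((n - 1 : ℤ) : ℝ) + 3) * (4 * ((n - 1 : ℤ) : ℝ) + 4) *
        (4 * ((n - 1 : ℤ) : ℝ) + 5) * (4 * ((n - 1 : ℤ) : ℝ) + 6) : ℝ) : ℝ) : ℂ)) := by
    have h := neg_htAlpha_mul_succ (2 * (n - 1) + 1)
    rw [neg_eq_iff_eq_neg, show 2 * (n - 1) + 1 + 1 = 2 * (n - 1) + 2 by ring] at h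
    rw [h]; push_cast; ring_nf
  have hB : htAlpha (2 * n + 1) * htAlpha (2 * n + 2) =
      -(((1 / 4 * Real.sqrt ((4 * n + 3) * (4 * n + 4) * (4 * n + 5) * (4 * n + 6) : ℝ) : ℝ) : ℂ)) := by
    have h := neg_htAlpha_mul_succ (2 * n + 1)
    rw [neg_eq_iff_eq_neg, show 2 * n + 1 + 1 = 2 * n + 2 by ring] at h
    rw [h]; push_cast; ring_nf
  have hC : htAlpha (2 * n) * conj (htAlpha (2 * n)) = ((((4 * n + 1) * (4 * n + 2) / 4 : ℝ)) : ℂ) := by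
    rw [htAlpha_mul_conj]; push_cast; ring
  have hD : htAlpha (2 * n + 1) * conj (htAlpha (2 * n + 1)) =
      ((((4 * n + 3) * (4 * n + 4) / 4 : ℝ)) : ℂ) := by
    rw [htAlpha_mul_conj]; push_cast; ring
  rw [conj_htAlpha] at hC hD
  rw [hA, hB]
  simp only [mul_neg, neg_neg] at hC hD ⊢
  rw [show htAlpha (2 * n) * htAlpha (2 * n) = -(((4 * n + 1) * (4 * n + 2) / 4 : ℝ) : ℂ) by
        rw [← hC]; ring,
      show htAlpha (2 * n + 1) * htAlpha (2 * n + 1) = -(((4 * n + 3) * (4 * n + 4) / 4 : ℝ) : ℂ) by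
        rw [← hD]; ring]
  push_cast
  ring

/-! ### §3.6 Link with the map `ℰ` and zeta (pp. 14–15, p0010–p0011) -/

/-- RH-FREE. `ψ⁺_ℓ := h_{4ℓ} − (h_{4ℓ}(0)/h_0(0)) h_0 ∈ 𝒮(ℝ)₀^{ev}` (eq. (29)). [cite: ConnesConsaniMoscovici2024, §3.6 eq. (29) p. 14 (p0010:L28)] -/
def psiPlus (ℓ : ℕ) (x : ℝ) : ℝ :=
  evenHermiteFn (2 * ℓ) x - evenHermiteFn (2 * ℓ) 0 / hermiteH0 0 * hermiteH0 x

/-- RH-FREE. `ψ⁻_ℓ := −h_{4ℓ+2} + (h_{4ℓ+2}(0)/h_2(0)) h_2 ∈ 𝒮(ℝ)₀^{ev}` (eq. (29)). [cite: ConnesConsaniMoscovici2024, §3.6 eq. (29) p. 14 (p0010:L28)] -/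
def psiMinus (ℓ : ℕ) (x : ℝ) : ℝ :=
  -evenHermiteFn (2 * ℓ + 1) x + evenHermiteFn (2 * ℓ + 1) 0 / evenHermiteFn 1 0 * evenHermiteFn 1 x

/-- `ψ⁺_ℓ(0) = 0` (first of the two conditions `f(0) = f̂(0) = 0` of `𝒮(ℝ)₀^{ev}`; PROVED).
[cite: ConnesConsaniMoscovici2024, §3.6 p. 14 (p0010:L25)] -/
theorem psiPlus_zero (ℓ : ℕ) : psiPlus ℓ 0 = 0 := by
  have h : hermiteH0 0 ≠ 0 := (hermiteH0_pos 0).ne'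
  rw [psiPlus, div_mul_cancel₀ _ h, sub_self]

/-- `h_2(0) = −2^{−3/4}·√2 ≠ 0` (the denominator in eq. (29)). [cite: ConnesConsaniMoscovici2024, §3.6 eq. (29) p. 14 (p0010:L28)] -/
theorem evenHermiteFn_one_zero_ne : evenHermiteFn 1 0 ≠ 0 := by
  rw [evenHermiteFn_apply_zero]
  have : (0 : ℝ) < (2 : ℝ) ^ (1 / 4 : ℝ) := Real.rpow_pos_of_pos two_pos _
  have h2 : (0 : ℝ) < Real.sqrt ((2 * 1)! : ℝ) := Real.sqrt_pos.mpr (by positivity)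
  intro h
  norm_num [this.ne', h2.ne'] at h

/-- `ψ⁻_ℓ(0) = 0` (PROVED). [cite: ConnesConsaniMoscovici2024, §3.6 p. 14 (p0010:L25)] -/
theorem psiMinus_zero (ℓ : ℕ) : psiMinus ℓ 0 = 0 := by
  rw [psiMinus, div_mul_cancel₀ _ evenHermiteFn_one_zero_ne, neg_add_cancel]

/-- RH-FREE named fact. **Eqs. (30)–(31)**: the explicit expansions
`ψ⁺_ℓ(x) = Σ_{k=1}^{2ℓ} (−1)ᵏ 2^{−2ℓ+3k+1/4} ((4ℓ)!)^{1/2}/((2ℓ−k)!(2k)!) πᵏx^{2k}e^{−πx²}` and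
`ψ⁻_ℓ(x) = (−ℓ 2^{−2ℓ+9/4}((4ℓ+2)!)^{1/2}/(2ℓ+1)! · πx² + Σ_{k=2}^{2ℓ+1} (−1)ᵏ 2^{3k−2ℓ−1+1/4}
((4ℓ+2)!)^{1/2}/((2ℓ+1−k)!(2k)!) πᵏ x^{2k}) e^{−πx²}`.
[cite: ConnesConsaniMoscovici2024, §3.6 eqs. (30)–(31) p. 14 (p0010:L36, p0010:L48)] -/
def CCM2024_eq_30_31 : Prop :=
  (∀ (ℓ : ℕ) (x : ℝ), psiPlus ℓ x =
      ∑ k ∈ Finset.Icc 1 (2 * ℓ),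
        (-1 : ℝ) ^ k * ((2 : ℝ) ^ (1 / 4 : ℝ) * 2 ^ (3 * k) / 2 ^ (2 * ℓ)) * Real.sqrt ((4 * ℓ)! : ℝ) /
          (((2 * ℓ - k)! : ℝ) * ((2 * k)! : ℝ)) * π ^ k * x ^ (2 * k) * Real.exp (-π * x ^ 2)) ∧
  ∀ (ℓ : ℕ) (x : ℝ), psiMinus ℓ x =
    (-(ℓ * ((2 : ℝ) ^ (1 / 4 : ℝ) * 2 ^ 2 / 2 ^ (2 * ℓ)) * Real.sqrt ((4 * ℓ + 2)! : ℝ) /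
          ((2 * ℓ + 1)! : ℝ)) * (π * x ^ 2) +
      ∑ k ∈ Finset.Icc 2 (2 * ℓ + 1),
        (-1 : ℝ) ^ k * ((2 : ℝ) ^ (1 / 4 : ℝ) * 2 ^ (3 * k) / 2 ^ (2 * ℓ + 1)) *
          Real.sqrt ((4 * ℓ + 2)! : ℝ) / ((((2 * ℓ + 1 - k)! : ℝ)) * ((2 * k)! : ℝ)) * π ^ k *
            x ^ (2 * k)) * Real.exp (-π * x ^ 2)

/-- RH-FREE. The Pochhammer-type product `Π_{j=0}^{k−1} (j − is/2 + 1/4)` of eqs. (23), (32), (33), as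
a polynomial in `s`. [cite: ConnesConsaniMoscovici2024, §3.4 eq. (23) p. 11 (p0009:L23)] -/
def htPoch (k : ℕ) : ℂ[X] := ∏ j ∈ Finset.range k, (C ((j : ℂ) + 1 / 4) - C (I / 2) * X)

/-- RH-FREE. `P⁺_ℓ(s)` of eq. (32):
`Σ_{k=1}^{2ℓ} (−1)ᵏ 2^{−2ℓ+3k−3/4} ((4ℓ)!)^{1/2}/((2ℓ−k)!(2k)!) Π_{j<k}(j − is/2 + 1/4)`.
[cite: ConnesConsaniMoscovici2024, Lemma 3.3 eq. (32) p. 14 (p0010:L59)] -/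
def polyPplus (ℓ : ℕ) : ℂ[X] :=
  ∑ k ∈ Finset.Icc 1 (2 * ℓ),
    C ((((-1 : ℝ) ^ k * ((2 : ℝ) ^ (-(3 / 4 : ℝ)) * 2 ^ (3 * k) / 2 ^ (2 * ℓ)) *
        Real.sqrt ((4 * ℓ)! : ℝ) / (((2 * ℓ - k)! : ℝ) * ((2 * k)! : ℝ)) : ℝ) : ℂ)) * htPoch k

/-- RH-FREE. `P⁻_ℓ(s)` of eq. (33):
`−ℓ 2^{−2ℓ+5/4}((4ℓ+2)!)^{1/2}/(2ℓ+1)! · (−is/2 + 1/4) + Σ_{k=2}^{2ℓ+1} (−1)ᵏ 2^{3k−2ℓ−7/4}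
((4ℓ+2)!)^{1/2}/((2ℓ+1−k)!(2k)!) Π_{j<k}(j − is/2 + 1/4)`. [cite: ConnesConsaniMoscovici2024, Lemma 3.3 eq. (33) p. 14–15 (p0010:L65–L70)] -/
def polyPminus (ℓ : ℕ) : ℂ[X] :=
  C (((-(ℓ * ((2 : ℝ) ^ (1 / 4 : ℝ) * 2 / 2 ^ (2 * ℓ)) * Real.sqrt ((4 * ℓ + 2)! : ℝ) /
        ((2 * ℓ + 1)! : ℝ)) : ℝ) : ℂ)) * htPoch 1 +
    ∑ k ∈ Finset.Icc 2 (2 * ℓ + 1),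
      C ((((-1 : ℝ) ^ k * ((2 : ℝ) ^ (-(3 / 4 : ℝ)) * 2 ^ (3 * k) / 2 ^ (2 * ℓ + 1)) *
          Real.sqrt ((4 * ℓ + 2)! : ℝ) / (((2 * ℓ + 1 - k)! : ℝ) * ((2 * k)! : ℝ)) : ℝ) : ℂ)) * htPoch k

/-- RH-FREE named fact. **Lemma 3.3 (i), transform**: `𝔽_μ(w_∞(ψ^±_ℓ))(s) = L_∞(1/2 − is) · P^±_ℓ(s)`
with the archimedean local factor `π^{−z/2}Γ(z/2)` at `z = 1/2 − is` (= `Complex.Gammaℝ`), on the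
half-plane `Im s > −1/2` (contains `ℝ` and the point `s = i/2` used in the proof), and the vanishing
`𝔽_μ(w(ψ^±_ℓ))(i/2) = ∫₀^∞ x ψ^±_ℓ(x) d*x = ½∫ψ^±_ℓ = 0` (display p. 15).
[cite: ConnesConsaniMoscovici2024, Lemma 3.3 (i) p. 14 (p0010:L55); proof p. 15 (p0010:L83)] -/
def CCM2024_lemma_3_3_i : Prop :=
  (∀ (ℓ : ℕ) (s : ℂ), -1 / 2 < s.im →
      mulHaarFourier (toC (wInfty (psiPlus ℓ))) s = Gammaℝ (1 / 2 - I * s) * (polyPplus ℓ).eval s ∧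
        mulHaarFourier (toC (wInfty (psiMinus ℓ))) s = Gammaℝ (1 / 2 - I * s) * (polyPminus ℓ).eval s) ∧
  ∀ ℓ : ℕ, mulHaarFourier (toC (wInfty (psiPlus ℓ))) (I / 2) = 0 ∧
    mulHaarFourier (toC (wInfty (psiMinus ℓ))) (I / 2) = 0

/-- RH-FREE named fact. **Lemma 3.3 (i), algebra**: `P⁺_ℓ` is even, divisible by `¼ + s²`, with real
coefficients; `P⁻_ℓ` is odd, divisible by `¼ + s²`, with purely imaginary coefficients.
[cite: ConnesConsaniMoscovici2024, Lemma 3.3 (i) p. 14–15 (p0010:L62, p0010:L72)] -/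
def CCM2024_lemma_3_3_i' : Prop :=
  ∀ ℓ : ℕ,
    ((polyPplus ℓ).comp (-X) = polyPplus ℓ ∧ (X ^ 2 + C (1 / 4 : ℂ)) ∣ polyPplus ℓ ∧
        ∀ k : ℕ, ((polyPplus ℓ).coeff k).im = 0) ∧
      ((polyPminus ℓ).comp (-X) = -polyPminus ℓ ∧ (X ^ 2 + C (1 / 4 : ℂ)) ∣ polyPminus ℓ ∧
        ∀ k : ℕ, ((polyPminus ℓ).coeff k).re = 0)

/-- RH-FREE named fact. **Lemma 3.3 (ii)** (eq. (34)):
`P⁺_ℓ(s) = 2^{−3/4}(𝒫_{2ℓ}(s) − 𝒫_{2ℓ}(i/2))`, `P⁻_ℓ(s) = 2^{−3/4}(𝒫_{2ℓ+1}(s) + 2is 𝒫_{2ℓ+1}(i/2))`.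
[cite: ConnesConsaniMoscovici2024, Lemma 3.3 (ii) eq. (34) p. 15 (p0010:L77)] -/
def CCM2024_lemma_3_3_ii : Prop :=
  ∀ ℓ : ℕ,
    polyPplus ℓ = C ((((2 : ℝ) ^ (-(3 / 4 : ℝ)) : ℝ) : ℂ)) *
        (htPoly (2 * ℓ) - C ((htPoly (2 * ℓ)).eval (I / 2))) ∧
      polyPminus ℓ = C ((((2 : ℝ) ^ (-(3 / 4 : ℝ)) : ℝ) : ℂ)) *
        (htPoly (2 * ℓ + 1) + C (2 * I * (htPoly (2 * ℓ + 1)).eval (I / 2)) * X)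

/-- RH-FREE (PROVED). The Riemann–Landau function `Ξ(s) = z(z−1)/2 · Γ(z/2)π^{−z/2}ζ(z)`,
`z = ½ + is` (eq. (35)) IS the tree's `riemannXiUpper s = ξ(½ + is)`; its central value is
`Ξ(0) = −ζ(½)Γ(¼)/(8π^{1/4})` (display p. 14; numerically `≈ 0.497121`, numerical in print, not typed).
Evenness: `riemannXiUpper_neg`; Hadamard product: `riemannXi_eq_mul_tprod`; order one:
`riemannXi_order_le_one`; zeros ↔ non-trivial zeros of `ζ`: `riemannXi_eq_zero_iff` (all tree).
[cite: ConnesConsaniMoscovici2024, §3.6 eq. (35) p. 14 (p0010:L89–L96)] -/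
theorem riemannXiUpper_zero_eq :
    riemannXiUpper 0 = -(riemannZeta (1 / 2) * Complex.Gamma (1 / 4)) / (8 * (π : ℂ) ^ (1 / 4 : ℂ)) := by
  have hhalf : (1 / 2 : ℂ) ≠ 0 := by norm_num
  have hhalf' : (1 / 2 : ℂ) ≠ 1 := by norm_num
  have hG : Gammaℝ (1 / 2) ≠ 0 := Gammaℝ_ne_zero_of_re_pos (by norm_num)
  rw [riemannXiUpper, mul_zero, add_zero, riemannXi_eq_mul_completedRiemannZeta hhalf hhalf']
  have hΛ : completedRiemannZeta (1 / 2) = Gammaℝ (1 / 2) * riemannZeta (1 / 2) := by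
    rw [riemannZeta_def_of_ne_zero hhalf, mul_div_cancel₀ _ hG]
  rw [hΛ, Gammaℝ_def]
  have hπ : (π : ℂ) ^ (-(1 / 2 : ℂ) / 2) = ((π : ℂ) ^ (1 / 4 : ℂ))⁻¹ := by
    rw [← Complex.cpow_neg]; congr 1; ring
  rw [hπ, show (1 / 2 : ℂ) / 2 = 1 / 4 by ring]
  have hπ0 : (π : ℂ) ^ (1 / 4 : ℂ) ≠ 0 := by
    rw [Ne, Complex.cpow_eq_zero_iff]; simp [Real.pi_ne_zero]
  field_simp
  ring

/-- RH-FREE. `R⁺_ℓ`, defined by `P⁺_ℓ(s) = −½(¼ + s²) R⁺_ℓ(s)` (p. 15; polynomial division by the monic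
`s² + ¼`, exact by Lemma 3.3 (i)). [cite: ConnesConsaniMoscovici2024, §3.6 p. 15 (p0011:L1)] -/
def polyRplus (ℓ : ℕ) : ℂ[X] := (-2 : ℂ) • (polyPplus ℓ /ₘ (X ^ 2 + C (1 / 4 : ℂ)))

/-- RH-FREE. `R⁻_ℓ`, defined by `P⁻_ℓ(s) = −½(¼ + s²) R⁻_ℓ(s)` (p. 15). [cite: ConnesConsaniMoscovici2024, §3.6 p. 15 (p0011:L1)] -/
def polyRminus (ℓ : ℕ) : ℂ[X] := (-2 : ℂ) • (polyPminus ℓ /ₘ (X ^ 2 + C (1 / 4 : ℂ)))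

/-- `P = −½(¼ + X²)·R` once `X² + ¼ ∣ P` (PROVED bookkeeping for the definition of `R^±_ℓ`).
[cite: ConnesConsaniMoscovici2024, §3.6 p. 15 (p0011:L1)] -/
theorem eq_neg_half_mul_of_dvd {P : ℂ[X]} (h : (X ^ 2 + C (1 / 4 : ℂ)) ∣ P) :
    P = C (-(1 / 2 : ℂ)) * (C (1 / 4 : ℂ) + X ^ 2) * ((-2 : ℂ) • (P /ₘ (X ^ 2 + C (1 / 4 : ℂ)))) := by
  have hmonic : (X ^ 2 + C (1 / 4 : ℂ)).Monic := monic_X_pow_add_C _ (by norm_num)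
  have hdiv := (Polynomial.modByMonic_eq_zero_iff_dvd hmonic).mpr h
  have key := Polynomial.modByMonic_add_div P (X ^ 2 + C (1 / 4 : ℂ))
  rw [hdiv, zero_add] at key
  conv_lhs => rw [← key]
  rw [Polynomial.smul_eq_C_mul]
  have : C (-(1 / 2 : ℂ)) * (C (1 / 4 : ℂ) + X ^ 2) * (C (-2 : ℂ) * (P /ₘ (X ^ 2 + C (1 / 4 : ℂ)))) =
      (C (-(1 / 2 : ℂ)) * C (-2 : ℂ)) * ((X ^ 2 + C (1 / 4 : ℂ)) * (P /ₘ (X ^ 2 + C (1 / 4 : ℂ)))) := by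
    ring
  rw [this, ← C_mul]
  norm_num

/-- RH-FREE named fact. **Proposition 3.6 (i)**: `𝔽_μ(ℰ(ψ^±_ℓ))(s) = R^±_ℓ(s) Ξ(s)` — the images under
`𝔽_μ ∘ ℰ` (`ℰ = connesE`) of the `ψ^±_ℓ` are the polynomial multiples `R^±_ℓ Ξ` of Riemann's `Ξ`
(and, (ii), all polynomial multiples of `Ξ` are so obtained; Prop. 3.6 (ii)'s spectral reformulation on
the Hadamard ring `ℋ_{≤1}` is not typed — module docstring). [cite: ConnesConsaniMoscovici2024, Prop. 3.6 (i) p. 15 (p0011:L6–L12)] -/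
def CCM2024_prop_3_6_i : Prop :=
  ∀ (ℓ : ℕ) (s : ℂ),
    mulHaarFourier (toC (connesE (psiPlus ℓ))) s = (polyRplus ℓ).eval s * riemannXiUpper s ∧
      mulHaarFourier (toC (connesE (psiMinus ℓ))) s = (polyRminus ℓ).eval s * riemannXiUpper s

end Archimedean

end Literature.NumberTheory.ConnesConsani2024


/-! ## Discharges (fact → theorem), top-down -/

namespace Literature.NumberTheory.ConnesConsani2024

open Literature.NumberTheory.LFunctions

/-- **Theorem 3.1 (i), PROVED**: `𝒰(h_0)(s) = 2^{−3/4} π^{−1/2} L_∞(1/2 − is)` on `Im s > −1/2` — the Mellin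
transform of the Gaussian, `∫₀^∞ x^{z−1} e^{−πx²} dx = ½ π^{−z/2} Γ(z/2)` (substitution `u = x²` and
Euler's integral). [cite: ConnesConsaniMoscovici2024, Thm. 3.1 (i) p. 9 (p0008:L7)] -/
theorem CCM2024_thm_3_1_i_holds : CCM2024_thm_3_1_i := by
  intro s hs
  have hzre : 0 < (1 / 2 - I * s).re := by
    simp only [Complex.sub_re, Complex.mul_re, Complex.I_re, Complex.I_im, zero_mul, one_mul,
      zero_sub]
    norm_num
    linarith
  have hz2 : 0 < ((1 / 2 - I * s) / 2).re := by
    have : ((1 / 2 - I * s) / 2).re = (1 / 2 - I * s).re / 2 := by simp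
    rw [this]; linarith
  -- `h_0(x) = 2^{1/4} · g(x²)` with `g(u) = e^{-π u}`
  have h1 : toC hermiteH0 =
      fun x : ℝ => (((2 : ℝ) ^ (1 / 4 : ℝ) : ℝ) : ℂ) •
        (fun u : ℝ => ((Real.exp (-(π * u)) : ℝ) : ℂ)) (x ^ (2 : ℝ)) := by
    funext x
    simp only [toC, hermiteH0, Real.rpow_two, smul_eq_mul]
    push_cast
    ring_nf
  have h2 : mellin (fun u : ℝ => ((Real.exp (-(π * u)) : ℝ) : ℂ)) ((1 / 2 - I * s) / 2) =
      ((π : ℂ) ^ (-((1 / 2 - I * s) / 2))) •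
        mellin (fun u : ℝ => ((Real.exp (-u) : ℝ) : ℂ)) ((1 / 2 - I * s) / 2) := by
    rw [← mellin_comp_mul_left _ _ Real.pi_pos]
  have h3 : mellin (fun u : ℝ => ((Real.exp (-u) : ℝ) : ℂ)) ((1 / 2 - I * s) / 2) =
      Complex.Gamma ((1 / 2 - I * s) / 2) := by
    rw [← Complex.GammaIntegral_eq_mellin, Complex.Gamma_eq_integral hz2]
  have hc : (((2 : ℝ) ^ (-(3 / 4 : ℝ)) : ℝ) : ℂ) = (((2 : ℝ) ^ (1 / 4 : ℝ) : ℝ) : ℂ) * 2⁻¹ := by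
    have : (2 : ℝ) ^ (-(3 / 4 : ℝ)) = (2 : ℝ) ^ (1 / 4 : ℝ) * 2⁻¹ := by
      rw [show (-(3 / 4 : ℝ)) = 1 / 4 + (-1) by norm_num, Real.rpow_add two_pos, Real.rpow_neg_one]
    rw [this]; push_cast; ring
  unfold htBase transformU
  rw [h1, mellin_const_smul,
    mellin_comp_rpow (fun u : ℝ => ((Real.exp (-(π * u)) : ℝ) : ℂ)) (1 / 2 - I * s) 2,
    show ((1 / 2 - I * s) / (2 : ℝ)) = (1 / 2 - I * s) / 2 by norm_num, h2, h3, Gammaℝ_def, hc,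
    abs_of_pos (by norm_num : (0 : ℝ) < 2)]
  simp only [smul_eq_mul, Complex.real_smul]
  rw [show -((1 / 2 - I * s) / 2) = -(1 / 2 - I * s) / 2 by ring]
  push_cast
  ring

/-- `𝒰(h_0)(s) ≠ 0` for real `s` (no zeros of `Γ`; PROVED from Thm. 3.1 (i)).
[cite: ConnesConsaniMoscovici2024, Thm. 3.1 (iii) p. 9 (p0008:L11)] -/
theorem htBase_ne_zero (s : ℝ) : htBase s ≠ 0 := by
  rw [CCM2024_thm_3_1_i_holds s (by simp; norm_num)]
  have hre : 0 < (1 / 2 - I * (s : ℂ)).re := by simp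
  refine mul_ne_zero (mul_ne_zero ?_ ?_) (Gammaℝ_ne_zero_of_re_pos hre)
  · exact_mod_cast (Real.rpow_pos_of_pos two_pos _).ne'
  · exact inv_ne_zero (by exact_mod_cast (Real.sqrt_pos.mpr Real.pi_pos).ne')

/-- **Theorem 3.1 (ii), closed form of the measure, PROVED**: `dm(s) = |𝒰(h_0)(s)|² ds =
(2π)^{−3/2} |Γ(1/4 + is/2)|² ds`. [cite: ConnesConsaniMoscovici2024, Thm. 3.1 (ii) p. 9 (p0008:L9)] -/
theorem htDensity_eq (s : ℝ) :
    htDensity s = (2 * π) ^ (-(3 / 2 : ℝ)) * ‖Complex.Gamma (1 / 4 + I * s / 2)‖ ^ 2 := by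
  rw [htDensity, CCM2024_thm_3_1_i_holds s (by simp; norm_num), norm_sq_htClosedForm]

/-- `𝒱(ξ_∞) = 1` everywhere (Prop. 3.1 (i); PROVED, unconditional form of `transformV_hermiteH0`).
[cite: ConnesConsaniMoscovici2024, Prop. 3.1 (i) p. 10 (p0008:L101)] -/
theorem transformV_hermiteH0_eq_one (s : ℝ) : transformV (toC hermiteH0) s = 1 :=
  transformV_hermiteH0 (htBase_ne_zero s)

end Literature.NumberTheory.ConnesConsani2024

/-! ## Discharges, algebraic cluster: Prop. 3.3 (ii), Lemma 3.3 (ii), Lemma 3.3 (i) (algebra), parity in Thm. 3.1 (ii)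

RH-FREE.  Pure polynomial algebra in `ℂ[X]`: the three-term recurrence of the `𝒫_m` (eq. (26)) by
coefficient comparison in the Pochhammer basis `Π_{j<k}(j + ¼ − ix/2)` of eq. (23); the binomial
identity `S_m(i/2) = (−1)^m/(2^m m!)`; hence eq. (34), the parities, the reality/imaginarity of the
coefficients and the divisibility by `¼ + s²` of `P^±_ℓ`.  Nothing here bears on the truth of RH. -/

namespace Literature.NumberTheory.ConnesConsani2024

open Finset


/-- RH-FREE. The coefficient `c_{m,k} = (−1)ᵏ 2^{3k−m}/((2k)!(m−k)!)` of eq. (23), so that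
`𝒫_m = ((2m)!)^{1/2} Σ_k c_{m,k} Π_{j<k}(j − ix/2 + ¼)`. [cite: ConnesConsaniMoscovici2024, §3.4 eq. (23) p. 11 (p0009:L23)] -/
def htCoef (m k : ℕ) : ℂ := (-1 : ℂ) ^ k * 2 ^ (3 * k) / 2 ^ m / (((2 * k)! : ℂ) * ((m - k)! : ℂ))

/-- `x · Π_{j<k}(j + ¼ − ix/2) = 2i (Π_{j<k+1} − (k + ¼) Π_{j<k})` — multiplication by `x` in the
Pochhammer basis of eq. (23) (the mechanism behind Prop. 3.3 (ii)). [cite: ConnesConsaniMoscovici2024, Prop. 3.3 (ii) p. 11–12 (p0009:L30)] -/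
theorem X_mul_htPoch (k : ℕ) :
    X * htPoch k = C (2 * I) * (htPoch (k + 1) - C ((k : ℂ) + 1 / 4) * htPoch k) := by
  rw [htPoch, htPoch, Finset.prod_range_succ]
  have hI : C (2 * I) * C (I / 2) = (-1 : ℂ[X]) := by
    rw [← C_mul, show (2 * I) * (I / 2) = I ^ 2 by ring, I_sq, C_neg, C_1]
  set q := ∏ j ∈ Finset.range k, (C ((j : ℂ) + 1 / 4) - C (I / 2) * X)
  calc X * q = -(C (2 * I) * C (I / 2)) * X * q := by rw [hI]; ring
    _ = _ := by ring

/-- Scalar form of `X_mul_htPoch`. [folklore] -/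
private theorem X_mul_smul_htPoch (c : ℂ) (k : ℕ) :
    X * (c • htPoch k) = (2 * I * c) • htPoch (k + 1) - (2 * I * ((k : ℂ) + 1 / 4) * c) • htPoch k := by
  rw [mul_smul_comm, X_mul_htPoch, smul_eq_C_mul, smul_eq_C_mul, smul_eq_C_mul]
  simp only [map_mul]
  ring

/-- Coefficient identity (top boundary term) for the three-term recurrence. [folklore] -/
private theorem htCoefB2 (n : ℕ) :
    2 * I * htCoef (n + 1) (n + 1) = -(I / 2) * ((2 * n + 3) * (2 * n + 4)) * htCoef (n + 2) (n + 2) := by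
  unfold htCoef
  have e1 : (2 * (n + 2))! = (2 * n + 4) * ((2 * n + 3) * (2 * (n + 1))!) := by
    rw [show 2 * (n + 2) = (2 * n + 3) + 1 by ring, Nat.factorial_succ,
      show 2 * n + 3 = (2 * (n + 1)) + 1 by ring, Nat.factorial_succ]
    ring_nf
  rw [e1, Nat.sub_self, Nat.sub_self]
  have h3 : (2 * (n : ℂ) + 3) ≠ 0 := by norm_cast
  have h4 : (2 * (n : ℂ) + 4) ≠ 0 := by norm_cast
  have hf : (((2 * (n + 1))! : ℕ) : ℂ) ≠ 0 := by exact_mod_cast Nat.factorial_ne_zero _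
  push_cast
  field_simp
  ring

/-- Coefficient identity (second boundary term) for the three-term recurrence. [folklore] -/
private theorem htCoefB1 (n : ℕ) :
    2 * I * htCoef (n + 1) n - 2 * I * ((((n + 1 : ℕ) : ℂ)) + 1 / 4) * htCoef (n + 1) (n + 1) =
      -(I / 2) * ((2 * n + 3) * (2 * n + 4)) * htCoef (n + 2) (n + 1) := by
  unfold htCoef
  have e1 : (2 * (n + 1))! = (2 * n + 2) * ((2 * n + 1) * (2 * n)!) := by
    rw [show 2 * (n + 1) = (2 * n + 1) + 1 by ring, Nat.factorial_succ, Nat.factorial_succ]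
  rw [e1, show n + 1 - n = 1 by omega, Nat.sub_self, show n + 2 - (n + 1) = 1 by omega]
  have h1 : (2 * (n : ℂ) + 1) ≠ 0 := by norm_cast
  have h2 : (2 * (n : ℂ) + 2) ≠ 0 := by norm_cast
  have hf : (((2 * n)! : ℕ) : ℂ) ≠ 0 := by exact_mod_cast Nat.factorial_ne_zero _
  push_cast
  field_simp
  ring

/-- Coefficient identity (constant term) for the three-term recurrence. [folklore] -/
private theorem htCoefB0 (n : ℕ) :
    -(2 * I * ((((0 : ℕ) : ℂ)) + 1 / 4) * htCoef (n + 1) 0) =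
      -(I / 2) * ((2 * n + 3) * (2 * n + 4)) * htCoef (n + 2) 0 + I / 2 * htCoef n 0 := by
  unfold htCoef
  simp only [Nat.sub_zero, Nat.mul_zero, Nat.factorial_zero, pow_zero]
  rw [show (n + 2)! = (n + 2) * ((n + 1) * Nat.factorial n) by
      rw [Nat.factorial_succ, Nat.factorial_succ],
    show (n + 1)! = (n + 1) * Nat.factorial n by rw [Nat.factorial_succ]]
  have h1 : ((n : ℂ) + 1) ≠ 0 := by norm_cast
  have h2 : ((n : ℂ) + 2) ≠ 0 := by norm_cast
  have hf : ((Nat.factorial n : ℕ) : ℂ) ≠ 0 := by exact_mod_cast Nat.factorial_ne_zero _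
  push_cast
  field_simp
  ring

/-- Coefficient identity (interior terms) for the three-term recurrence. [folklore] -/
private theorem htCoefT (n j : ℕ) (hj : j < n) :
    2 * I * htCoef (n + 1) j - 2 * I * ((((j + 1 : ℕ) : ℂ)) + 1 / 4) * htCoef (n + 1) (j + 1) =
      -(I / 2) * ((2 * n + 3) * (2 * n + 4)) * htCoef (n + 2) (j + 1) + I / 2 * htCoef n (j + 1) := by
  obtain ⟨d, rfl⟩ : ∃ d, n = j + 1 + d := ⟨n - (j + 1), by omega⟩
  unfold htCoef
  rw [show j + 1 + d + 1 - j = d + 2 by omega, show j + 1 + d + 1 - (j + 1) = d + 1 by omega,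
    show j + 1 + d + 2 - (j + 1) = d + 2 by omega, show j + 1 + d - (j + 1) = d by omega,
    show (d + 2)! = (d + 2) * ((d + 1) * Nat.factorial d) by rw [Nat.factorial_succ, Nat.factorial_succ],
    show (d + 1)! = (d + 1) * Nat.factorial d by rw [Nat.factorial_succ],
    show (2 * (j + 1))! = (2 * j + 2) * ((2 * j + 1) * (2 * j)!) by
      rw [show 2 * (j + 1) = (2 * j + 1) + 1 by ring, Nat.factorial_succ, Nat.factorial_succ]]
  have h1 : ((d : ℂ) + 1) ≠ 0 := by norm_cast
  have h2 : ((d : ℂ) + 2) ≠ 0 := by norm_cast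
  have h3 : (2 * (j : ℂ) + 1) ≠ 0 := by norm_cast
  have h4 : (2 * (j : ℂ) + 2) ≠ 0 := by norm_cast
  have hf : ((Nat.factorial d : ℕ) : ℂ) ≠ 0 := by exact_mod_cast Nat.factorial_ne_zero _
  have hg : (((2 * j)! : ℕ) : ℂ) ≠ 0 := by exact_mod_cast Nat.factorial_ne_zero _
  push_cast
  field_simp
  ring

/-- RH-FREE. `S_m := Σ_{k≤m} c_{m,k} • Π_{j<k}(j + ¼ − ix/2)`, the bracket of eq. (23): `𝒫_m = ((2m)!)^{1/2} S_m`
(`htPoly_eq_smul_htPolyS`). [cite: ConnesConsaniMoscovici2024, §3.4 eq. (23) p. 11 (p0009:L23)] -/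
def htPolyS (m : ℕ) : ℂ[X] := ∑ k ∈ Finset.range (m + 1), htCoef m k • htPoch k

/-- The three-term recurrence at the level of `S_m` (PROVED):
`x S_{n+1} = −(i/2)(2n+3)(2n+4) S_{n+2} + (i/2) S_n`. [cite: ConnesConsaniMoscovici2024, Prop. 3.3 (ii) eq. (26) p. 12 (p0009:L90)] -/
theorem X_mul_htPolyS (n : ℕ) :
    X * htPolyS (n + 1) =
      (-(I / 2) * ((2 * n + 3) * (2 * n + 4))) • htPolyS (n + 2) + (I / 2) • htPolyS n := by
  -- notation for the coefficient families
  set u : ℕ → ℂ := fun k => 2 * I * htCoef (n + 1) k with hu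
  set w : ℕ → ℂ := fun k => 2 * I * ((k : ℂ) + 1 / 4) * htCoef (n + 1) k with hw
  set a : ℕ → ℂ := fun k => -(I / 2) * ((2 * n + 3) * (2 * n + 4)) * htCoef (n + 2) k with ha
  set b : ℕ → ℂ := fun k => I / 2 * htCoef n k with hb
  -- Step 1: expand `X * S_{n+1}`
  have h1 : X * htPolyS (n + 1) =
      ∑ k ∈ Finset.range (n + 2), u k • htPoch (k + 1) - ∑ k ∈ Finset.range (n + 2), w k • htPoch k := by
    rw [htPolyS, Finset.mul_sum, ← Finset.sum_sub_distrib]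
    refine Finset.sum_congr rfl fun k _ => ?_
    rw [X_mul_smul_htPoch]
  have h2 : (-(I / 2) * ((2 * n + 3) * (2 * n + 4))) • htPolyS (n + 2) =
      ∑ k ∈ Finset.range (n + 3), a k • htPoch k := by
    rw [htPolyS, Finset.smul_sum]
    refine Finset.sum_congr rfl fun k _ => ?_
    rw [smul_smul]
  have h3 : (I / 2) • htPolyS n = ∑ k ∈ Finset.range (n + 1), b k • htPoch k := by
    rw [htPolyS, Finset.smul_sum]
    refine Finset.sum_congr rfl fun k _ => ?_
    rw [smul_smul]
  rw [h1, h2, h3]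
  -- Step 2: peel boundary terms and shift indices
  have eA : ∑ k ∈ Finset.range (n + 2), u k • htPoch (k + 1) =
      ∑ k ∈ Finset.range n, u k • htPoch (k + 1) + u n • htPoch (n + 1) + u (n + 1) • htPoch (n + 2) := by
    rw [Finset.sum_range_succ, Finset.sum_range_succ]
  have eB : ∑ k ∈ Finset.range (n + 2), w k • htPoch k =
      w 0 • htPoch 0 + ∑ k ∈ Finset.range n, w (k + 1) • htPoch (k + 1) + w (n + 1) • htPoch (n + 1) := by
    rw [Finset.sum_range_succ', Finset.sum_range_succ]
    abel
  have eC : ∑ k ∈ Finset.range (n + 3), a k • htPoch k =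
      a 0 • htPoch 0 + ∑ k ∈ Finset.range n, a (k + 1) • htPoch (k + 1) + a (n + 1) • htPoch (n + 1) +
        a (n + 2) • htPoch (n + 2) := by
    rw [Finset.sum_range_succ', Finset.sum_range_succ, Finset.sum_range_succ]
    abel
  have eD : ∑ k ∈ Finset.range (n + 1), b k • htPoch k =
      b 0 • htPoch 0 + ∑ k ∈ Finset.range n, b (k + 1) • htPoch (k + 1) := by
    rw [Finset.sum_range_succ']
    abel
  rw [eA, eB, eC, eD]
  -- Step 3: the interior sum, termwise
  have hmain : ∑ k ∈ Finset.range n, u k • htPoch (k + 1) =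
      ∑ k ∈ Finset.range n, w (k + 1) • htPoch (k + 1) + ∑ k ∈ Finset.range n, a (k + 1) • htPoch (k + 1) +
        ∑ k ∈ Finset.range n, b (k + 1) • htPoch (k + 1) := by
    rw [← Finset.sum_add_distrib, ← Finset.sum_add_distrib]
    refine Finset.sum_congr rfl fun k hk => ?_
    rw [← add_smul, ← add_smul]
    congr 1
    have := htCoefT n k (Finset.mem_range.mp hk)
    simp only [hu, hw, ha, hb]
    linear_combination this
  -- boundary scalars
  have hB0 : b 0 = -w 0 - a 0 := by
    have := htCoefB0 n
    simp only [Nat.cast_zero, zero_add] at this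
    simp only [hw, ha, hb, Nat.cast_zero, zero_add]
    linear_combination -this
  have hB1 : u n = a (n + 1) + w (n + 1) := by
    have := htCoefB1 n
    simp only [hu, hw, ha]
    linear_combination this
  have hB2 : u (n + 1) = a (n + 2) := by
    have := htCoefB2 n
    simp only [hu, ha]
    linear_combination this
  rw [hmain, hB0, hB1, hB2]
  module

/-- `𝒫_m = ((2m)!)^{1/2} • S_m` (eq. (23)). [cite: ConnesConsaniMoscovici2024, §3.4 eq. (23) p. 11 (p0009:L23)] -/
theorem htPoly_eq_smul_htPolyS (m : ℕ) :
    htPoly m = ((Real.sqrt ((2 * m)! : ℝ) : ℝ) : ℂ) • htPolyS m := by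
  rw [htPoly, htPolyS, smul_eq_C_mul]
  congr 1
  refine Finset.sum_congr rfl fun k _ => ?_
  rw [smul_eq_C_mul]
  rfl

/-- `S_0 = 1` (`𝒫_0 = 1` gives the normalization, p. 12). [cite: ConnesConsaniMoscovici2024, Prop. 3.3 (proof) p. 12 (p0009:L38)] -/
theorem htPolyS_zero : htPolyS 0 = 1 := by
  simp [htPolyS, htCoef, htPoch]

/-- `S_1 = i x`, i.e. `𝒫_1(x) = i√2 x` (p. 12). [cite: ConnesConsaniMoscovici2024, Prop. 3.3 (proof) p. 12 (p0009:L70)] -/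
theorem htPolyS_one : htPolyS 1 = I • X := by
  apply Polynomial.funext
  intro x
  simp [htPolyS, htCoef, htPoch, Finset.sum_range_succ, Nat.factorial]
  ring

/-- `(2n+2)! = (2n+2)(2n+1)(2n)!`. [folklore] -/
private theorem fact_2n2 (n : ℕ) : (2 * (n + 1))! = (2 * n + 2) * ((2 * n + 1) * (2 * n)!) := by
  rw [show 2 * (n + 1) = (2 * n + 1) + 1 by ring, Nat.factorial_succ, Nat.factorial_succ]

/-- **Proposition 3.3 (ii), PROVED** (`n ≥ 1`): `x 𝒫_{n+1} = ᾱ_{n+1} 𝒫_{n+2} + α_n 𝒫_n` (eq. (26)).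
[cite: ConnesConsaniMoscovici2024, Prop. 3.3 (ii) eq. (26) p. 12 (p0009:L90)] -/
theorem X_mul_htPoly_succ (n : ℕ) :
    X * htPoly (n + 1) = C (conj (htAlpha (n + 1))) * htPoly (n + 2) + C (htAlpha n) * htPoly n := by
  -- real square-root bookkeeping
  have hG : (0 : ℝ) ≤ (2 * n + 3) * (2 * n + 4) := by positivity
  have hG' : (0 : ℝ) ≤ (2 * n + 1) * (2 * n + 2) := by positivity
  have hF2 : (((2 * (n + 2))! : ℕ) : ℝ) = ((2 * n + 3) * (2 * n + 4)) * (((2 * (n + 1))! : ℕ) : ℝ) := by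
    rw [show n + 2 = (n + 1) + 1 by ring, fact_2n2 (n + 1)]; push_cast; ring
  have hF1 : (((2 * (n + 1))! : ℕ) : ℝ) = ((2 * n + 1) * (2 * n + 2)) * (((2 * n)! : ℕ) : ℝ) := by
    rw [fact_2n2 n]; push_cast; ring
  have r1 : Real.sqrt ((2 * n + 3) * (2 * n + 4)) * Real.sqrt (((2 * (n + 2))! : ℕ) : ℝ) =
      ((2 * n + 3) * (2 * n + 4)) * Real.sqrt (((2 * (n + 1))! : ℕ) : ℝ) := by
    rw [hF2, Real.sqrt_mul hG, ← mul_assoc, Real.mul_self_sqrt hG]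
  have r2 : Real.sqrt (((2 * (n + 1))! : ℕ) : ℝ) =
      Real.sqrt ((2 * n + 1) * (2 * n + 2)) * Real.sqrt (((2 * n)! : ℕ) : ℝ) := by
    rw [hF1, Real.sqrt_mul hG']
  -- the two scalar identities in `ℂ`
  have s1 : ((Real.sqrt (((2 * (n + 1))! : ℕ) : ℝ) : ℝ) : ℂ) * (-(I / 2) * ((2 * n + 3) * (2 * n + 4))) =
      conj (htAlpha (n + 1)) * ((Real.sqrt (((2 * (n + 2))! : ℕ) : ℝ) : ℝ) : ℂ) := by
    rw [conj_htAlpha, htAlpha]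
    push_cast
    have e : ((2 * ((n : ℝ) + 1) + 1) * (2 * ((n : ℝ) + 1) + 2)) = (2 * n + 3) * (2 * n + 4) := by ring
    rw [e]
    have r1c : ((Real.sqrt ((2 * n + 3) * (2 * n + 4)) : ℝ) : ℂ) * ((Real.sqrt (((2 * (n + 2))! : ℕ) : ℝ) : ℝ) : ℂ)
        = (((2 * n + 3) * (2 * n + 4) : ℝ) : ℂ) * ((Real.sqrt (((2 * (n + 1))! : ℕ) : ℝ) : ℝ) : ℂ) := by
      rw [← ofReal_mul, r1, ofReal_mul]
    push_cast at r1c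
    linear_combination (I / 2) * r1c
  have s2 : ((Real.sqrt (((2 * (n + 1))! : ℕ) : ℝ) : ℝ) : ℂ) * (I / 2) =
      htAlpha n * ((Real.sqrt (((2 * n)! : ℕ) : ℝ) : ℝ) : ℂ) := by
    rw [htAlpha, r2]
    push_cast
    ring
  rw [htPoly_eq_smul_htPolyS, htPoly_eq_smul_htPolyS, htPoly_eq_smul_htPolyS, mul_smul_comm, X_mul_htPolyS,
    smul_add, smul_smul, smul_smul, ← smul_eq_C_mul, ← smul_eq_C_mul, smul_smul, smul_smul, s1, s2]

/-- **Proposition 3.3 (ii), PROVED** (`n = 0`): `x 𝒫_0 = ᾱ_0 𝒫_1` (`x𝒫_0 = −(i/√2)𝒫_1`, p. 12).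
[cite: ConnesConsaniMoscovici2024, Prop. 3.3 (ii) p. 12 (p0009:L72)] -/
theorem X_mul_htPoly_zero : X * htPoly 0 = C (conj (htAlpha 0)) * htPoly 1 := by
  rw [htPoly_eq_smul_htPolyS, htPoly_eq_smul_htPolyS, htPolyS_zero, htPolyS_one, conj_htAlpha, htAlpha]
  have h2 : ((Real.sqrt 2 : ℝ) : ℂ) * ((Real.sqrt 2 : ℝ) : ℂ) = 2 := by
    rw [← ofReal_mul, Real.mul_self_sqrt (by norm_num)]; norm_num
  simp only [Nat.factorial_zero, Nat.cast_one, Real.sqrt_one, ofReal_one, one_smul,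
    Nat.mul_one, Int.cast_zero, mul_zero, zero_add, show (2 : ℕ)! = 2 by rfl, Nat.cast_ofNat]
  rw [show ((1 : ℝ) * 2 : ℝ) = 2 by norm_num, ← smul_eq_C_mul, smul_smul, smul_smul]
  have : -(I / 2 * ((Real.sqrt 2 : ℝ) : ℂ)) * ((Real.sqrt 2 : ℝ) : ℂ) * I = 1 := by
    have hI : I * I = -1 := by rw [← sq, I_sq]
    linear_combination (-(I * I) / 2) * h2 - hI
  rw [this, one_smul, mul_one]

/-- At `s = i/2` the factors become `j + ½`: `Π_{j<k}(j + ¼ − i(i/2)/2) = Π_{j<k}(j + ½)`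
(proof of Lemma 3.3, p. 15). [cite: ConnesConsaniMoscovici2024, Lemma 3.3 (proof) p. 15 (p0010:L83)] -/
theorem htPoch_eval_I_half (k : ℕ) : (htPoch k).eval (I / 2) = ∏ j ∈ Finset.range k, ((j : ℂ) + 1 / 2) := by
  rw [htPoch, Polynomial.eval_prod]
  refine Finset.prod_congr rfl fun j _ => ?_
  simp only [eval_sub, eval_mul, eval_C, eval_X]
  have : I / 2 * (I / 2) = -1 / 4 := by rw [show I / 2 * (I / 2) = I ^ 2 / 4 by ring, I_sq]
  linear_combination -this

/-- `Π_{j<k}(j + ½) = (2k)!/(4ᵏ k!)`. [folklore] -/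
private theorem prod_add_half (k : ℕ) :
    ∏ j ∈ Finset.range k, ((j : ℂ) + 1 / 2) = ((2 * k)! : ℂ) / (4 ^ k * (k ! : ℂ)) := by
  induction k with
  | zero => simp
  | succ k ih =>
    rw [Finset.prod_range_succ, ih, fact_2n2 k, Nat.factorial_succ]
    have hk : ((k ! : ℕ) : ℂ) ≠ 0 := by exact_mod_cast Nat.factorial_ne_zero _
    have hk1 : ((k : ℂ) + 1) ≠ 0 := by norm_cast
    push_cast
    field_simp
    ring

/-- `S_m(i/2) = (−1)^m/(2^m m!)` — the binomial identity `Σ_k C(m,k)(−2)ᵏ = (−1)^m` behind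
Lemma 3.3 (ii) (PROVED). [cite: ConnesConsaniMoscovici2024, Lemma 3.3 (ii) p. 15 (p0010:L77)] -/
theorem htPolyS_eval_I_half (m : ℕ) : (htPolyS m).eval (I / 2) = (-1) ^ m / (2 ^ m * (m ! : ℂ)) := by
  rw [htPolyS, eval_finsetSum]
  have hterm : ∀ k ∈ Finset.range (m + 1), (htCoef m k • htPoch k).eval (I / 2) =
      (1 / (2 ^ m * (m ! : ℂ))) * ((-2 : ℂ) ^ k * 1 ^ (m - k) * (m.choose k : ℂ)) := by
    intro k hk
    have hkm : k ≤ m := Nat.lt_succ_iff.mp (Finset.mem_range.mp hk)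
    rw [eval_smul, htPoch_eval_I_half, prod_add_half, htCoef, smul_eq_mul, Nat.cast_choose ℂ hkm]
    have h1 : ((k ! : ℕ) : ℂ) ≠ 0 := by exact_mod_cast Nat.factorial_ne_zero _
    have h2 : (((m - k)! : ℕ) : ℂ) ≠ 0 := by exact_mod_cast Nat.factorial_ne_zero _
    have h3 : (((2 * k)! : ℕ) : ℂ) ≠ 0 := by exact_mod_cast Nat.factorial_ne_zero _
    have h4 : ((m ! : ℕ) : ℂ) ≠ 0 := by exact_mod_cast Nat.factorial_ne_zero _
    have h8 : (2 : ℂ) ^ (3 * k) = 4 ^ k * 2 ^ k := by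
      rw [pow_mul, ← mul_pow]; norm_num
    have h9 : (-2 : ℂ) ^ k = (-1) ^ k * 2 ^ k := by
      rw [show (-2 : ℂ) = (-1) * 2 by norm_num, mul_pow]
    rw [h8, one_pow, mul_one, h9]
    field_simp
  rw [Finset.sum_congr rfl hterm, ← Finset.mul_sum, ← add_pow]
  norm_num
  ring

/-- `c_{m,0} = 1/(2^m m!)`. [folklore] -/
private theorem htCoef_zero_right (m : ℕ) : htCoef m 0 = 1 / (2 ^ m * (m ! : ℂ)) := by
  rw [htCoef]
  simp only [pow_zero, Nat.mul_zero, Nat.factorial_zero, Nat.cast_one, one_mul, Nat.sub_zero, mul_one]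
  ring

/-- Empty Pochhammer product. [folklore] -/
private theorem htPoch_zero : htPoch 0 = 1 := by simp [htPoch]

/-- `Π_{j<1}(j + ¼ − ix/2) = ¼ − (i/2)x`. [folklore] -/
private theorem htPoch_one : htPoch 1 = (1 / 4 : ℂ) • (1 : ℂ[X]) - (I / 2) • X := by
  rw [htPoch, Finset.prod_range_one, smul_eq_C_mul, smul_eq_C_mul, mul_one]
  simp

/-- Evaluation of `𝒫_m` through `S_m`. [folklore] -/
private theorem htPoly_eval (m : ℕ) (x : ℂ) :
    (htPoly m).eval x = ((Real.sqrt ((2 * m)! : ℝ) : ℝ) : ℂ) * (htPolyS m).eval x := by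
  rw [htPoly_eq_smul_htPolyS, eval_smul, smul_eq_mul]

/-- **Lemma 3.3 (ii), even part, PROVED**: `P⁺_ℓ = 2^{−3/4}(𝒫_{2ℓ} − 𝒫_{2ℓ}(i/2))`.
[cite: ConnesConsaniMoscovici2024, Lemma 3.3 (ii) eq. (34) p. 15 (p0010:L77)] -/
theorem polyPplus_eq (ℓ : ℕ) :
    polyPplus ℓ = C ((((2 : ℝ) ^ (-(3 / 4 : ℝ)) : ℝ) : ℂ)) *
      (htPoly (2 * ℓ) - C ((htPoly (2 * ℓ)).eval (I / 2))) := by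
  set c34 : ℂ := (((2 : ℝ) ^ (-(3 / 4 : ℝ)) : ℝ) : ℂ) with hc34
  set sF : ℂ := ((Real.sqrt ((4 * ℓ)! : ℝ) : ℝ) : ℂ) with hsF
  have h42 : ((Real.sqrt ((2 * (2 * ℓ))! : ℝ) : ℝ) : ℂ) = sF := by
    rw [hsF, show 2 * (2 * ℓ) = 4 * ℓ by ring]
  -- the printed coefficients are `c34 * √((4ℓ)!) * c_{2ℓ,k}`
  have hd : ∀ k ∈ Finset.Icc 1 (2 * ℓ),
      C ((((-1 : ℝ) ^ k * ((2 : ℝ) ^ (-(3 / 4 : ℝ)) * 2 ^ (3 * k) / 2 ^ (2 * ℓ)) *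
        Real.sqrt ((4 * ℓ)! : ℝ) / (((2 * ℓ - k)! : ℝ) * ((2 * k)! : ℝ)) : ℝ) : ℂ)) * htPoch k =
      (c34 * sF) • (htCoef (2 * ℓ) k • htPoch k) := by
    intro k hk
    rw [smul_smul, smul_eq_C_mul]
    congr 2
    rw [hc34, hsF, htCoef]
    push_cast
    ring
  have hsum : ∑ k ∈ Finset.Icc 1 (2 * ℓ), htCoef (2 * ℓ) k • htPoch k =
      htPolyS (2 * ℓ) - htCoef (2 * ℓ) 0 • htPoch 0 := by
    have hI : Finset.Icc 1 (2 * ℓ) = Finset.Ico 1 (2 * ℓ + 1) := by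
      ext k; simp only [Finset.mem_Icc, Finset.mem_Ico]; omega
    rw [hI, Finset.sum_Ico_eq_sub _ (by omega), Finset.sum_range_one, htPolyS]
  rw [polyPplus, Finset.sum_congr rfl hd, ← Finset.smul_sum, hsum, htPoly_eval, htPolyS_eval_I_half,
    htPoly_eq_smul_htPolyS, h42, htPoch_zero, htCoef_zero_right,
    show ((-1 : ℂ) ^ (2 * ℓ)) = 1 by rw [pow_mul]; norm_num]
  rw [smul_sub, sub_eq_add_neg, mul_sub, smul_eq_C_mul, smul_eq_C_mul, smul_eq_C_mul, smul_eq_C_mul]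
  simp only [map_mul]
  ring

/-- **Lemma 3.3 (ii), odd part, PROVED**: `P⁻_ℓ = 2^{−3/4}(𝒫_{2ℓ+1} + 2is 𝒫_{2ℓ+1}(i/2))`.
[cite: ConnesConsaniMoscovici2024, Lemma 3.3 (ii) eq. (34) p. 15 (p0010:L77)] -/
theorem polyPminus_eq (ℓ : ℕ) :
    polyPminus ℓ = C ((((2 : ℝ) ^ (-(3 / 4 : ℝ)) : ℝ) : ℂ)) *
      (htPoly (2 * ℓ + 1) + C (2 * I * (htPoly (2 * ℓ + 1)).eval (I / 2)) * X) := by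
  set c34 : ℂ := (((2 : ℝ) ^ (-(3 / 4 : ℝ)) : ℝ) : ℂ) with hc34
  set sF : ℂ := ((Real.sqrt ((4 * ℓ + 2)! : ℝ) : ℝ) : ℂ) with hsF
  have h42 : ((Real.sqrt ((2 * (2 * ℓ + 1))! : ℝ) : ℝ) : ℂ) = sF := by
    rw [hsF, show 2 * (2 * ℓ + 1) = 4 * ℓ + 2 by ring]
  have h14 : ((2 : ℝ) ^ (1 / 4 : ℝ)) = 2 * (2 : ℝ) ^ (-(3 / 4 : ℝ)) := by
    rw [show (1 / 4 : ℝ) = 1 + (-(3 / 4)) by norm_num, Real.rpow_add two_pos, Real.rpow_one]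
  -- coefficients `k ≥ 2`
  have hd : ∀ k ∈ Finset.Icc 2 (2 * ℓ + 1),
      C ((((-1 : ℝ) ^ k * ((2 : ℝ) ^ (-(3 / 4 : ℝ)) * 2 ^ (3 * k) / 2 ^ (2 * ℓ + 1)) *
          Real.sqrt ((4 * ℓ + 2)! : ℝ) / (((2 * ℓ + 1 - k)! : ℝ) * ((2 * k)! : ℝ)) : ℝ) : ℂ)) * htPoch k =
      (c34 * sF) • (htCoef (2 * ℓ + 1) k • htPoch k) := by
    intro k hk
    rw [smul_smul, smul_eq_C_mul]
    congr 2
    rw [hc34, hsF, htCoef]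
    push_cast
    ring
  have hsum : ∑ k ∈ Finset.Icc 2 (2 * ℓ + 1), htCoef (2 * ℓ + 1) k • htPoch k =
      htPolyS (2 * ℓ + 1) - htCoef (2 * ℓ + 1) 0 • htPoch 0 - htCoef (2 * ℓ + 1) 1 • htPoch 1 := by
    have hI : Finset.Icc 2 (2 * ℓ + 1) = Finset.Ico 2 (2 * ℓ + 2) := by
      ext k; simp only [Finset.mem_Icc, Finset.mem_Ico]; omega
    have h2 : ∑ k ∈ Finset.range 2, htCoef (2 * ℓ + 1) k • htPoch k =
        htCoef (2 * ℓ + 1) 0 • htPoch 0 + htCoef (2 * ℓ + 1) 1 • htPoch 1 := by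
      simp [Finset.sum_range_succ]
    rw [hI, Finset.sum_Ico_eq_sub _ (by omega), h2, htPolyS, show 2 * ℓ + 1 + 1 = 2 * ℓ + 2 by ring]
    abel
  -- the `k = 1` coefficient
  have he : ((-(ℓ * ((2 : ℝ) ^ (1 / 4 : ℝ) * 2 / 2 ^ (2 * ℓ)) * Real.sqrt ((4 * ℓ + 2)! : ℝ) /
        ((2 * ℓ + 1)! : ℝ)) : ℝ) : ℂ) = -(8 * (ℓ : ℂ)) * (c34 * sF * htCoef (2 * ℓ + 1) 0) := by
    rw [h14, htCoef_zero_right, hc34, hsF]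
    have hf : (((2 * ℓ + 1)! : ℕ) : ℂ) ≠ 0 := by exact_mod_cast Nat.factorial_ne_zero _
    push_cast
    field_simp
    ring
  have hcoef1 : htCoef (2 * ℓ + 1) 1 = -(4 * (2 * ℓ + 1)) * htCoef (2 * ℓ + 1) 0 := by
    rw [htCoef, htCoef_zero_right, show 2 * ℓ + 1 - 1 = 2 * ℓ by omega, Nat.factorial_succ (2 * ℓ)]
    have hf : (((2 * ℓ)! : ℕ) : ℂ) ≠ 0 := by exact_mod_cast Nat.factorial_ne_zero _
    have h21 : (2 * (ℓ : ℂ) + 1) ≠ 0 := by norm_cast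
    push_cast
    field_simp
    ring
  have hev : (htPolyS (2 * ℓ + 1)).eval (I / 2) = -htCoef (2 * ℓ + 1) 0 := by
    rw [htPolyS_eval_I_half, htCoef_zero_right, pow_succ, pow_mul]
    norm_num
    ring
  rw [polyPminus, Finset.sum_congr rfl hd, ← Finset.smul_sum, hsum, htPoly_eval, hev,
    htPoly_eq_smul_htPolyS, h42, htPoch_zero, he, hcoef1, htPoch_one]
  simp only [Polynomial.C_mul']
  module

/-- The recurrence coefficient `−(i/2)(2n+3)(2n+4)` is non-zero. [folklore] -/
private theorem recCoef_ne_zero (n : ℕ) : (-(I / 2) * ((2 * (n : ℂ) + 3) * (2 * n + 4))) ≠ 0 := by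
  have h3 : (2 * (n : ℂ) + 3) ≠ 0 := by norm_cast
  have h4 : (2 * (n : ℂ) + 4) ≠ 0 := by norm_cast
  have hI : -(I / 2) ≠ 0 := by simp [I_ne_zero]
  exact mul_ne_zero hI (mul_ne_zero h3 h4)

/-- Parity of `S_m`, two consecutive indices at a time (induction on the recurrence). [folklore] -/
private theorem htPolyS_parity_pair (n : ℕ) :
    (htPolyS n).comp (-X) = (-1 : ℂ) ^ n • htPolyS n ∧
      (htPolyS (n + 1)).comp (-X) = (-1 : ℂ) ^ (n + 1) • htPolyS (n + 1) := by
  induction n with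
  | zero =>
    refine ⟨by simp [htPolyS_zero], ?_⟩
    rw [htPolyS_one, smul_comp, X_comp]
    simp
  | succ n ih =>
    refine ⟨ih.2, ?_⟩
    have hrec := X_mul_htPolyS n
    -- apply `comp (-X)` to the recurrence
    have hc := congrArg (fun p : ℂ[X] => p.comp (-X)) hrec
    simp only [mul_comp, X_comp, add_comp, smul_comp, ih.1, ih.2] at hc
    have hne := recCoef_ne_zero n
    refine smul_right_injective ℂ[X] hne ?_
    show (-(I / 2) * ((2 * (n : ℂ) + 3) * (2 * n + 4))) • (htPolyS (n + 2)).comp (-X) =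
      (-(I / 2) * ((2 * (n : ℂ) + 3) * (2 * n + 4))) • ((-1 : ℂ) ^ (n + 1 + 1) • htPolyS (n + 1 + 1))
    calc (-(I / 2) * ((2 * (n : ℂ) + 3) * (2 * n + 4))) • (htPolyS (n + 2)).comp (-X)
        = -X * ((-1 : ℂ) ^ (n + 1) • htPolyS (n + 1)) - (I / 2) • ((-1 : ℂ) ^ n • htPolyS n) := by
          rw [eq_sub_iff_add_eq]; exact hc.symm
      _ = (-1 : ℂ) ^ (n + 2) • (X * htPolyS (n + 1) - (I / 2) • htPolyS n) := by
          rw [neg_mul, mul_smul_comm]; module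
      _ = (-1 : ℂ) ^ (n + 2) • ((-(I / 2) * ((2 * (n : ℂ) + 3) * (2 * n + 4))) • htPolyS (n + 2)) := by
          congr 1; rw [hrec]; abel
      _ = (-(I / 2) * ((2 * (n : ℂ) + 3) * (2 * n + 4))) • ((-1 : ℂ) ^ (n + 1 + 1) • htPolyS (n + 1 + 1)) :=
          smul_comm _ _ _

/-- `S_m(−x) = (−1)^m S_m(x)` (PROVED from the three-term recurrence). [cite: ConnesConsaniMoscovici2024, Thm. 3.1 (ii) p. 9 (p0008:L9)] -/
theorem htPolyS_parity (m : ℕ) : (htPolyS m).comp (-X) = (-1 : ℂ) ^ m • htPolyS m := (htPolyS_parity_pair m).1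

/-- **Theorem 3.1 (ii), parity clause, PROVED**: the `𝒫_n` are "polynomials of the same parity as `n`":
`𝒫_n(−s) = (−1)ⁿ𝒫_n(s)`. [cite: ConnesConsaniMoscovici2024, Thm. 3.1 (ii) p. 9 (p0008:L9)] -/
theorem htPoly_parity (m : ℕ) : (htPoly m).comp (-X) = (-1 : ℂ) ^ m • htPoly m := by
  rw [htPoly_eq_smul_htPolyS, smul_comp, htPolyS_parity, smul_comm]

/-- `S_m ∈ iᵐ ℝ[X]`, two consecutive indices at a time. [folklore] -/
private theorem htPolyS_real_pair (n : ℕ) :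
    (∃ q : ℝ[X], htPolyS n = I ^ n • q.map Complex.ofRealHom) ∧
      (∃ q : ℝ[X], htPolyS (n + 1) = I ^ (n + 1) • q.map Complex.ofRealHom) := by
  induction n with
  | zero =>
    exact ⟨⟨1, by simp [htPolyS_zero]⟩, ⟨X, by simp [htPolyS_one]⟩⟩
  | succ n ih =>
    refine ⟨ih.2, ?_⟩
    obtain ⟨q₀, h₀⟩ := ih.1
    obtain ⟨q₁, h₁⟩ := ih.2
    set q₂ : ℝ[X] := (2 / ((2 * n + 3) * (2 * n + 4)) : ℝ) • (X * q₁ - (1 / 2 : ℝ) • q₀) with hq₂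
    refine ⟨q₂, ?_⟩
    have hrec := X_mul_htPolyS n
    have hne := recCoef_ne_zero n
    have h2 : (-(I / 2) * ((2 * (n : ℂ) + 3) * (2 * n + 4))) • htPolyS (n + 2) =
        X * htPolyS (n + 1) - (I / 2) • htPolyS n := by
      rw [hrec]; abel
    have h3 : (2 * (n : ℂ) + 3) ≠ 0 := by norm_cast
    have h4 : (2 * (n : ℂ) + 4) ≠ 0 := by norm_cast
    have key : (-(I / 2) * ((2 * (n : ℂ) + 3) * (2 * n + 4))) • htPolyS (n + 2) =
        (-(I / 2) * ((2 * (n : ℂ) + 3) * (2 * n + 4))) • (I ^ (n + 2) • q₂.map Complex.ofRealHom) := by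
      rw [h2, h₀, h₁, hq₂]
      simp only [Polynomial.map_smul, Polynomial.map_sub, Polynomial.map_mul, Polynomial.map_X,
        Complex.ofRealHom_eq_coe]
      rw [show I ^ (n + 2) = -I ^ n by rw [pow_succ, pow_succ, mul_assoc, I_mul_I]; ring,
        show I ^ (n + 1) = I ^ n * I by rw [pow_succ], mul_smul_comm]
      push_cast
      match_scalars <;> field_simp
    exact smul_right_injective ℂ[X] hne key

/-- `𝒫_{2ℓ}` has real coefficients (its bracket `S_{2ℓ}` does). [cite: ConnesConsaniMoscovici2024, Lemma 3.3 (i) p. 14 (p0010:L62)] -/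
theorem htPolyS_even_coeff_im (ℓ k : ℕ) : ((htPolyS (2 * ℓ)).coeff k).im = 0 := by
  obtain ⟨q, hq⟩ := (htPolyS_real_pair (2 * ℓ)).1
  rw [hq, Polynomial.coeff_smul, Polynomial.coeff_map, pow_mul, I_sq, smul_eq_mul]
  rw [show ((-1 : ℂ) ^ ℓ) = (((-1 : ℝ) ^ ℓ : ℝ) : ℂ) by push_cast; ring]
  simp only [Complex.ofRealHom_eq_coe, ← Complex.ofReal_mul, Complex.ofReal_im]

/-- `𝒫_{2ℓ+1}` has purely imaginary coefficients. [cite: ConnesConsaniMoscovici2024, Lemma 3.3 (i) p. 15 (p0010:L72)] -/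
theorem htPolyS_odd_coeff_re (ℓ k : ℕ) : ((htPolyS (2 * ℓ + 1)).coeff k).re = 0 := by
  obtain ⟨q, hq⟩ := (htPolyS_real_pair (2 * ℓ)).2
  rw [hq, Polynomial.coeff_smul, Polynomial.coeff_map, pow_succ, pow_mul, I_sq, smul_eq_mul]
  rcases neg_one_pow_eq_or ℂ ℓ with h | h <;> simp [h, Complex.ofRealHom_eq_coe]

/-- `X² + ¼` divides a complex polynomial vanishing at `± i/2`. [folklore] -/
private theorem quarter_dvd_of_eval {P : ℂ[X]} (h1 : P.eval (I / 2) = 0) (h2 : P.eval (-(I / 2)) = 0) :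
    (X ^ 2 + C (1 / 4 : ℂ)) ∣ P := by
  obtain ⟨Q, hQ⟩ : (X - C (I / 2)) ∣ P := Polynomial.dvd_iff_isRoot.mpr h1
  have hQ0 : Q.eval (-(I / 2)) = 0 := by
    have := h2
    rw [hQ, eval_mul, eval_sub, eval_X, eval_C] at this
    have hne : (-(I / 2) - I / 2 : ℂ) ≠ 0 := by
      rw [show (-(I / 2) - I / 2 : ℂ) = -I by ring]; exact neg_ne_zero.mpr I_ne_zero
    exact (mul_eq_zero.mp this).resolve_left hne
  obtain ⟨R, hR⟩ : (X - C (-(I / 2))) ∣ Q := Polynomial.dvd_iff_isRoot.mpr hQ0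
  refine ⟨R, ?_⟩
  rw [hQ, hR, ← mul_assoc]
  congr 1
  have : (X - C (I / 2)) * (X - C (-(I / 2))) = X ^ 2 - C ((I / 2) ^ 2) := by
    rw [map_neg, map_pow]; ring
  rw [this, show (I / 2) ^ 2 = -(1 / 4 : ℂ) by rw [div_pow, I_sq]; ring, map_neg]
  ring

/-- `S_{2ℓ}(i/2)` as a real number. [folklore] -/
private theorem htPolyS_eval_I_half_even (ℓ : ℕ) :
    (htPolyS (2 * ℓ)).eval (I / 2) = ((1 / (2 ^ (2 * ℓ) * ((2 * ℓ)! : ℝ)) : ℝ) : ℂ) := by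
  rw [htPolyS_eval_I_half, pow_mul]; push_cast; norm_num

/-- `S_{2ℓ+1}(i/2)` as a real number. [folklore] -/
private theorem htPolyS_eval_I_half_odd (ℓ : ℕ) :
    (htPolyS (2 * ℓ + 1)).eval (I / 2) = ((-(1 / (2 ^ (2 * ℓ + 1) * ((2 * ℓ + 1)! : ℝ))) : ℝ) : ℂ) := by
  rw [htPolyS_eval_I_half, pow_succ, pow_mul]; push_cast; norm_num; ring

/-- `P⁺_ℓ` is (the image of) a real polynomial. [cite: ConnesConsaniMoscovici2024, Lemma 3.3 (i) p. 14 (p0010:L62)] -/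
theorem polyPplus_real (ℓ : ℕ) : ∃ R : ℝ[X], polyPplus ℓ = R.map Complex.ofRealHom := by
  obtain ⟨q, hq⟩ := (htPolyS_real_pair (2 * ℓ)).1
  refine ⟨((2 : ℝ) ^ (-(3 / 4 : ℝ))) • (((Real.sqrt ((2 * (2 * ℓ))! : ℝ)) * (-1) ^ ℓ) • q -
    C (Real.sqrt ((2 * (2 * ℓ))! : ℝ) * (1 / (2 ^ (2 * ℓ) * ((2 * ℓ)! : ℝ))))), ?_⟩
  rw [polyPplus_eq, htPoly_eval, htPolyS_eval_I_half_even, htPoly_eq_smul_htPolyS, hq, pow_mul, I_sq]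
  simp only [Polynomial.map_smul, Polynomial.map_sub, Polynomial.map_C, Complex.ofRealHom_eq_coe,
    Polynomial.C_mul', smul_smul]
  push_cast
  ring_nf

/-- `P⁻_ℓ` is `i` times a real polynomial. [cite: ConnesConsaniMoscovici2024, Lemma 3.3 (i) p. 15 (p0010:L72)] -/
theorem polyPminus_imag (ℓ : ℕ) : ∃ R : ℝ[X], polyPminus ℓ = I • R.map Complex.ofRealHom := by
  obtain ⟨q, hq⟩ := (htPolyS_real_pair (2 * ℓ)).2
  refine ⟨((2 : ℝ) ^ (-(3 / 4 : ℝ))) • (((Real.sqrt ((2 * (2 * ℓ + 1))! : ℝ)) * (-1) ^ ℓ) • q +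
    C (2 * (Real.sqrt ((2 * (2 * ℓ + 1))! : ℝ) * (-(1 / (2 ^ (2 * ℓ + 1) * ((2 * ℓ + 1)! : ℝ)))))) * X), ?_⟩
  rw [polyPminus_eq, htPoly_eval, htPolyS_eval_I_half_odd, htPoly_eq_smul_htPolyS, hq, pow_succ, pow_mul,
    I_sq]
  simp only [Polynomial.map_smul, Polynomial.map_add, Polynomial.map_X, Complex.ofRealHom_eq_coe,
    Polynomial.C_mul', smul_smul]
  push_cast
  module

/-- **Lemma 3.3 (i), PROVED**: `P⁺_ℓ` is even. [cite: ConnesConsaniMoscovici2024, Lemma 3.3 (i) p. 14 (p0010:L62)] -/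
theorem polyPplus_comp_neg (ℓ : ℕ) : (polyPplus ℓ).comp (-X) = polyPplus ℓ := by
  rw [polyPplus_eq, mul_comp, C_comp, sub_comp, C_comp, htPoly_parity, pow_mul]
  norm_num

/-- **Lemma 3.3 (i), PROVED**: `P⁻_ℓ` is odd. [cite: ConnesConsaniMoscovici2024, Lemma 3.3 (i) p. 15 (p0010:L72)] -/
theorem polyPminus_comp_neg (ℓ : ℕ) : (polyPminus ℓ).comp (-X) = -polyPminus ℓ := by
  rw [polyPminus_eq, mul_comp, C_comp, add_comp, mul_comp, C_comp, X_comp, htPoly_parity, pow_succ,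
    pow_mul]
  norm_num
  ring

/-- `P⁺_ℓ(i/2) = 0` (proof of Lemma 3.3 (i), p. 15: `𝔽_μ(wψ)(i/2) = ½∫ψ = 0`; here from (ii)).
[cite: ConnesConsaniMoscovici2024, Lemma 3.3 (i) (proof) p. 15 (p0010:L83)] -/
theorem polyPplus_eval_I_half (ℓ : ℕ) : (polyPplus ℓ).eval (I / 2) = 0 := by
  rw [polyPplus_eq]
  simp

/-- `P⁻_ℓ(i/2) = 0`. [cite: ConnesConsaniMoscovici2024, Lemma 3.3 (i) (proof) p. 15 (p0010:L83)] -/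
theorem polyPminus_eval_I_half (ℓ : ℕ) : (polyPminus ℓ).eval (I / 2) = 0 := by
  rw [polyPminus_eq]
  simp only [eval_mul, eval_C, eval_add, eval_X]
  have hI : I * I = -1 := I_mul_I
  linear_combination (((2 : ℝ) ^ (-(3 / 4 : ℝ)) : ℝ) : ℂ) * eval (I / 2) (htPoly (2 * ℓ + 1)) * hI

/-- `P(−i/2) = (P ∘ (−X))(i/2)`. [folklore] -/
private theorem eval_neg_I_half_eq (P : ℂ[X]) : P.eval (-(I / 2)) = (P.comp (-X)).eval (I / 2) := by
  simp [eval_comp]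

/-- **Lemma 3.3 (i), PROVED**: `¼ + s²` divides `P⁺_ℓ` ("the parity of the polynomial `P^±_ℓ` then shows
that it is divisible by `¼ + s²`"). [cite: ConnesConsaniMoscovici2024, Lemma 3.3 (i) p. 14–15 (p0010:L62, p0010:L86)] -/
theorem quarter_dvd_polyPplus (ℓ : ℕ) : (X ^ 2 + C (1 / 4 : ℂ)) ∣ polyPplus ℓ :=
  quarter_dvd_of_eval (polyPplus_eval_I_half ℓ)
    (by rw [eval_neg_I_half_eq, polyPplus_comp_neg, polyPplus_eval_I_half])

/-- **Lemma 3.3 (i), PROVED**: `¼ + s²` divides `P⁻_ℓ`. [cite: ConnesConsaniMoscovici2024, Lemma 3.3 (i) p. 15 (p0010:L72, p0010:L86)] -/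
theorem quarter_dvd_polyPminus (ℓ : ℕ) : (X ^ 2 + C (1 / 4 : ℂ)) ∣ polyPminus ℓ :=
  quarter_dvd_of_eval (polyPminus_eval_I_half ℓ)
    (by rw [eval_neg_I_half_eq, polyPminus_comp_neg, eval_neg, polyPminus_eval_I_half, neg_zero])

/-- **Lemma 3.3 (i), PROVED**: `P⁺_ℓ` has real coefficients. [cite: ConnesConsaniMoscovici2024, Lemma 3.3 (i) p. 14 (p0010:L62)] -/
theorem polyPplus_coeff_im (ℓ k : ℕ) : ((polyPplus ℓ).coeff k).im = 0 := by
  obtain ⟨R, h⟩ := polyPplus_real ℓ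
  rw [h, Polynomial.coeff_map]
  simp

/-- **Lemma 3.3 (i), PROVED**: `P⁻_ℓ` has purely imaginary coefficients. [cite: ConnesConsaniMoscovici2024, Lemma 3.3 (i) p. 15 (p0010:L72)] -/
theorem polyPminus_coeff_re (ℓ k : ℕ) : ((polyPminus ℓ).coeff k).re = 0 := by
  obtain ⟨R, h⟩ := polyPminus_imag ℓ
  rw [h, Polynomial.coeff_smul, Polynomial.coeff_map]
  simp


/-- **Proposition 3.3 (ii) DISCHARGED.** [cite: ConnesConsaniMoscovici2024, Prop. 3.3 (ii) eq. (26) p. 11–12 (p0009:L30, p0009:L90)] -/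
theorem CCM2024_prop_3_3_ii_holds : CCM2024_prop_3_3_ii :=
  ⟨X_mul_htPoly_zero, X_mul_htPoly_succ⟩

/-- **Lemma 3.3 (ii) DISCHARGED.** [cite: ConnesConsaniMoscovici2024, Lemma 3.3 (ii) eq. (34) p. 15 (p0010:L77)] -/
theorem CCM2024_lemma_3_3_ii_holds : CCM2024_lemma_3_3_ii :=
  fun ℓ => ⟨polyPplus_eq ℓ, polyPminus_eq ℓ⟩

/-- **Lemma 3.3 (i), algebraic clauses, DISCHARGED.** [cite: ConnesConsaniMoscovici2024, Lemma 3.3 (i) p. 14–15 (p0010:L62, p0010:L72)] -/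
theorem CCM2024_lemma_3_3_i'_holds : CCM2024_lemma_3_3_i' :=
  fun ℓ => ⟨⟨polyPplus_comp_neg ℓ, quarter_dvd_polyPplus ℓ, polyPplus_coeff_im ℓ⟩,
    ⟨polyPminus_comp_neg ℓ, quarter_dvd_polyPminus ℓ, polyPminus_coeff_re ℓ⟩⟩

end Literature.NumberTheory.ConnesConsani2024

/-! ## Discharge: Theorem 3.1 (iii) — `ℳ : L²(ℝ, ds) → L²(ℝ, dm)` is unitary (proofs only)

The printed argument [ConnesConsaniMoscovici2024, proof of Thm. 3.1 (iii) p. 10]: `dm = |𝒰(h_0)|² ds` and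
`ℳ(f) = 𝒰(h_0)^{-1} f`, so `∫ |ℳf|² dm = ∫ |f|² ds`; `𝒰(h_0)(s) ≠ 0` for real `s` (`htBase_ne_zero`),
so `g ↦ 𝒰(h_0)·g` inverts `ℳ`, and `dm`, `ds` are mutually absolutely continuous. -/

namespace Literature.NumberTheory.ConnesConsani2024

open _root_.MeasureTheory Complex
open scoped ENNReal Real
open Literature.NumberTheory.LFunctions

/-- `s ↦ 𝒰(h_0)(s)` is measurable on `ℝ`: it is `2^{−3/4}π^{−1/2}·L_∞(1/2 − is)` (Thm. 3.1 (i)) and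
`1/Γ_ℝ` is entire. [cite: ConnesConsaniMoscovici2024, Thm. 3.1 (i) p. 9 (p0008:L7)] -/
theorem measurable_htBase : Measurable fun s : ℝ => htBase s := by
  have hcont : Continuous fun s : ℝ => (Gammaℝ (1 / 2 - I * s))⁻¹ :=
    differentiable_Gammaℝ_inv.continuous.comp (by fun_prop)
  have heq : (fun s : ℝ => htBase s) = fun s : ℝ =>
      (((2 : ℝ) ^ (-(3 / 4 : ℝ)) : ℝ) : ℂ) * ((Real.sqrt π : ℝ) : ℂ)⁻¹ *
        ((Gammaℝ (1 / 2 - I * s))⁻¹)⁻¹ := by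
    funext s
    rw [CCM2024_thm_3_1_i_holds s (by simp; norm_num), inv_inv]
  rw [heq]
  exact measurable_const.mul hcont.measurable.inv

/-- measurability of the density `|𝒰(h_0)|²` of `dm`. [cite: ConnesConsaniMoscovici2024, Thm. 3.1 (ii) p. 9 (p0008:L9)] -/
private theorem measurable_htDensityE : Measurable fun s : ℝ => ENNReal.ofReal (htDensity s) :=
  ENNReal.measurable_ofReal.comp ((measurable_htBase.norm).pow_const 2)

/-- the density of `dm` is pointwise nonzero. [cite: ConnesConsaniMoscovici2024, Thm. 3.1 (iii) p. 9 (p0008:L11)] -/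
private theorem htDensityE_ne_zero (s : ℝ) : ENNReal.ofReal (htDensity s) ≠ 0 := by
  have : 0 < htDensity s := by
    rw [htDensity]; exact pow_pos (norm_pos_iff.mpr (htBase_ne_zero s)) 2
  simpa [ENNReal.ofReal_eq_zero, not_le] using this

/-- the density of `dm` as an extended norm square. [cite: ConnesConsaniMoscovici2024, Thm. 3.1 (iii) p. 9 (p0008:L11)] -/
private theorem htDensityE_eq_enorm_sq (s : ℝ) : ENNReal.ofReal (htDensity s) = ‖htBase s‖ₑ ^ 2 := by
  rw [htDensity, ENNReal.ofReal_pow (norm_nonneg _), ofReal_norm]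

/-- Core identity of Thm. 3.1 (iii): `∫ |ℳu|² dm = ∫ |u|² ds` (any `u : ℝ → ℂ`).
[cite: ConnesConsaniMoscovici2024, Thm. 3.1 (iii) p. 9 (p0008:L11)] -/
theorem lintegral_transformM (u : ℝ → ℂ) :
    ∫⁻ s, ‖transformM u s‖ₑ ^ (2 : ℝ) ∂htMeasure = ∫⁻ s, ‖u s‖ₑ ^ (2 : ℝ) ∂volume := by
  rw [htMeasure, lintegral_withDensity_eq_lintegral_mul_non_measurable₀ _
    measurable_htDensityE.aemeasurable (Filter.Eventually.of_forall fun s => by simp)]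
  refine lintegral_congr fun s => ?_
  simp only [Pi.mul_apply, transformM, htDensityE_eq_enorm_sq]
  have h0 : ‖htBase s‖ₑ ≠ 0 := by simpa using htBase_ne_zero s
  have htop : ‖htBase s‖ₑ ≠ ⊤ := enorm_ne_top
  rw [enorm_mul, enorm_inv (htBase_ne_zero s), ENNReal.rpow_two, ENNReal.rpow_two, mul_pow,
    ← mul_assoc, ← ENNReal.inv_pow, ENNReal.mul_inv_cancel (pow_ne_zero 2 h0) (ENNReal.pow_ne_top htop),
    one_mul]

/-- `L²` norm through the lintegral of `‖·‖ₑ²`. [folklore] -/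
private theorem eLpNorm_two_eq (u : ℝ → ℂ) (μ : Measure ℝ) :
    eLpNorm u 2 μ = (∫⁻ s, ‖u s‖ₑ ^ (2 : ℝ) ∂μ) ^ (1 / (2 : ℝ)) := by
  rw [eLpNorm_eq_lintegral_rpow_enorm_toReal (by norm_num) (by norm_num)]
  norm_num

/-- `‖ℳu‖_{L²(dm)} = ‖u‖_{L²(ds)}`. [cite: ConnesConsaniMoscovici2024, Thm. 3.1 (iii) p. 9 (p0008:L11)] -/
theorem eLpNorm_transformM (u : ℝ → ℂ) :
    eLpNorm (transformM u) 2 htMeasure = eLpNorm u 2 volume := by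
  rw [eLpNorm_two_eq, eLpNorm_two_eq, lintegral_transformM]

/-- `dm ≪ ds`. [cite: ConnesConsaniMoscovici2024, Thm. 3.1 (ii) p. 9 (p0008:L9)] -/
theorem htMeasure_absolutelyContinuous : htMeasure ≪ volume := withDensity_absolutelyContinuous _ _

/-- `ds ≪ dm` (the density `|𝒰(h_0)|²` never vanishes). [cite: ConnesConsaniMoscovici2024, Thm. 3.1 (iii) p. 9 (p0008:L11)] -/
theorem volume_absolutelyContinuous_htMeasure : (volume : Measure ℝ) ≪ htMeasure :=
  withDensity_absolutelyContinuous' measurable_htDensityE.aemeasurable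
    (Filter.Eventually.of_forall htDensityE_ne_zero)

/-- **Theorem 3.1 (iii) DISCHARGED**: `ℳ : L²(ℝ, ds) → L²(ℝ, dm)`, `ℳ(f) = 𝒰(h_0)^{-1} f`, is isometric
and onto. [cite: ConnesConsaniMoscovici2024, Thm. 3.1 (iii) p. 9 (p0008:L11), proof p. 10] -/
theorem CCM2024_thm_3_1_iii_holds : CCM2024_thm_3_1_iii := by
  refine ⟨fun f hf => ?_, fun g hg => ?_⟩
  · have hae : AEStronglyMeasurable (transformM f) htMeasure :=
      measurable_htBase.inv.aestronglyMeasurable.mul (hf.1.mono_ac htMeasure_absolutelyContinuous)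
    refine ⟨⟨hae, ?_⟩, eLpNorm_transformM f⟩
    rw [eLpNorm_transformM]
    exact hf.2
  · refine ⟨fun s => htBase s * g s, ⟨?_, ?_⟩, Filter.Eventually.of_forall fun s => ?_⟩
    · exact measurable_htBase.aestronglyMeasurable.mul (hg.1.mono_ac volume_absolutelyContinuous_htMeasure)
    · rw [← eLpNorm_transformM]
      have : transformM (fun s => htBase s * g s) = g := by
        funext s; rw [transformM, inv_mul_cancel_left₀ (htBase_ne_zero s)]
      rw [this]; exact hg.2
    · rw [transformM, inv_mul_cancel_left₀ (htBase_ne_zero s)]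

end Literature.NumberTheory.ConnesConsani2024

/-! ## Discharges: Theorem 3.1 (ii) (formula clause), Theorem 3.1 (iv), Corollary 3.2 (from Prop. 3.2 (i))

RH-FREE.  The printed proof of Thm. 3.1 (p. 10): (ii) `∫₀^∞ x^{2k} h_0(x) x^{w−1} dx` is the Mellin
transform of `h_0` at `w + 2k`, and `Γ_ℝ(w + 2) = Γ_ℝ(w)·w/(2π)` produces the Pochhammer factors
`Π_{j<k}(j + ¼ − is/2)` of (23); (iv) integration by parts
`∫₀^∞ x f′(x) x^{w−1} dx = −w ∫₀^∞ f(x) x^{w−1} dx` for `f = P(x)e^{−πx²}`, `Re w > 0` (boundary terms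
vanish), so `𝒰(𝕊f)(s) = −i(−w + ½)𝒰f(s) = s·𝒰f(s)` at `w = ½ − is`; Cor. 3.2 from
`W_λ = −𝕊² − ¼ + λ²𝐇` and Prop. 3.2 (i).  Nothing here bears on the truth of RH. -/

namespace Literature.NumberTheory.ConnesConsani2024

open _root_.MeasureTheory Complex Polynomial Filter Set Asymptotics
open scoped Real Topology Nat
open Literature.NumberTheory.LFunctions

/-! ### Step 1: `Γ_ℝ` recursion and the shifted Mellin transform of `h_0` -/

/-- `Γ_ℝ(w + 2k) = Γ_ℝ(w) · Π_{j<k}(w/2 + j) / π^k` for `Re w > 0`. [folklore] -/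
private theorem Gammaℝ_add_two_mul {w : ℂ} (hw : 0 < w.re) (k : ℕ) :
    Gammaℝ (w + 2 * k) = Gammaℝ w * (∏ j ∈ Finset.range k, (w / 2 + j)) / (π : ℂ) ^ k := by
  induction k with
  | zero => simp
  | succ k ih =>
    have hne : w + 2 * k ≠ 0 := by
      intro h
      have := congrArg Complex.re h
      simp at this
      linarith [k.cast_nonneg (α := ℝ)]
    rw [show w + 2 * ((k + 1 : ℕ) : ℂ) = (w + 2 * k) + 2 by push_cast; ring, Gammaℝ_add_two hne, ih,
      Finset.prod_range_succ, pow_succ]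
    have hpi : (π : ℂ) ≠ 0 := ofReal_ne_zero.mpr Real.pi_ne_zero
    field_simp

/-- `Re(½ − is) = ½ + Im s`. [folklore] -/
private theorem re_w (s : ℂ) : (1 / 2 - I * s).re = 1 / 2 + s.im := by
  simp

/-- `𝒰(h_0)(s + 2ki) = 𝒰(h_0)(s) · Π_{j<k}(j + ¼ − is/2) / π^k` on `Im s > −1/2` (Thm. 3.1 (i) and the
recursion `Γ_ℝ(w+2) = Γ_ℝ(w) w/(2π)`). [cite: ConnesConsaniMoscovici2024, Thm. 3.1 (i)–(ii) p. 9 (p0008:L7)] -/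
theorem htBase_add_two_mul_I (s : ℂ) (hs : -1 / 2 < s.im) (k : ℕ) :
    htBase (s + 2 * k * I) =
      htBase s * (∏ j ∈ Finset.range k, ((j : ℂ) + 1 / 4 - I / 2 * s)) / (π : ℂ) ^ k := by
  have hs' : -1 / 2 < (s + 2 * k * I).im := by
    simp; linarith [k.cast_nonneg (α := ℝ)]
  have hw : 0 < (1 / 2 - I * s).re := by rw [re_w]; linarith
  rw [CCM2024_thm_3_1_i_holds _ hs', CCM2024_thm_3_1_i_holds _ hs,
    show 1 / 2 - I * (s + 2 * k * I) = (1 / 2 - I * s) + 2 * k by ring_nf; rw [I_sq]; ring,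
    Gammaℝ_add_two_mul hw k]
  have hprod : ∏ j ∈ Finset.range k, ((1 / 2 - I * s) / 2 + (j : ℂ)) =
      ∏ j ∈ Finset.range k, ((j : ℂ) + 1 / 4 - I / 2 * s) :=
    Finset.prod_congr rfl fun j _ => by ring
  rw [hprod]
  ring

/-! ### Step 2: Mellin convergence of `h_0` and of polynomial multiples of the Gaussian -/

/-- The Mellin integral of `h_0 = 2^{1/4}e^{−πx²}` converges for `Re w > 0` (transport of
`LocalRH.mellinConvergent_gaussPoly` by `x ↦ 2√π·x`). [cite: ConnesConsaniMoscovici2024, Thm. 3.1 (i) p. 9 (p0008:L7)] -/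
theorem mellinConvergent_toC_hermiteH0 {w : ℂ} (hw : 0 < w.re) :
    MellinConvergent (toC hermiteH0) w := by
  have hc : (0 : ℝ) < 2 * Real.sqrt π := by positivity
  have h := (MellinConvergent.comp_mul_left hc
    (f := fun x => (LocalRH.gaussPoly (C ((2 : ℝ) ^ ((1 : ℝ) / 4))) x : ℂ)) (s := w)).mpr
    (LocalRH.mellinConvergent_gaussPoly _ hw)
  have hfun : (fun x : ℝ => (LocalRH.gaussPoly (C ((2 : ℝ) ^ ((1 : ℝ) / 4))) (2 * Real.sqrt π * x) : ℂ)) =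
      toC hermiteH0 := by
    funext x
    have hE : -(2 * Real.sqrt π * x) ^ 2 / 4 = -π * x ^ 2 := by
      rw [show -(2 * Real.sqrt π * x) ^ 2 / 4 = -(Real.sqrt π ^ 2) * x ^ 2 by ring,
        Real.sq_sqrt Real.pi_pos.le]
    simp only [LocalRH.gaussPoly, toC, hermiteH0, eval_C, hE]
  rwa [hfun] at h

/-- Mellin transforms of finite sums. [folklore] -/
private theorem mellin_finsetSum {ι : Type*} (S : Finset ι) (f : ι → ℝ → ℂ) (w : ℂ)
    (h : ∀ i ∈ S, MellinConvergent (f i) w) :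
    mellin (fun t => ∑ i ∈ S, f i t) w = ∑ i ∈ S, mellin (f i) w := by
  simp only [mellin, Finset.smul_sum]
  exact integral_finsetSum S h

/-- `P(x)e^{−πx²} = Σ_i (P_i/2^{1/4}) · x^i · h_0(x)`. [folklore] -/
private theorem gaussPolyFn_eq_sum (P : ℂ[X]) : gaussPolyFn P = fun x : ℝ =>
    ∑ i ∈ Finset.range (P.natDegree + 1),
      (P.coeff i / (((2 : ℝ) ^ ((1 : ℝ) / 4) : ℝ) : ℂ)) • (((x : ℂ) ^ ((i : ℕ) : ℂ)) • toC hermiteH0 x) := by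
  have h2 : (((2 : ℝ) ^ ((1 : ℝ) / 4) : ℝ) : ℂ) ≠ 0 :=
    ofReal_ne_zero.mpr (Real.rpow_pos_of_pos two_pos _).ne'
  funext x
  rw [gaussPolyFn, eval_eq_sum_range, Finset.sum_mul]
  refine Finset.sum_congr rfl fun i _ => ?_
  simp only [toC, hermiteH0, smul_eq_mul, cpow_natCast]
  push_cast
  field_simp

/-- The Mellin integral of `P(x)e^{−πx²}` converges for `Re w > 0`. [cite: ConnesConsaniMoscovici2024, Thm. 3.1 (i) p. 9 (p0008:L5)] -/
theorem mellinConvergent_gaussPolyFn (P : ℂ[X]) {w : ℂ} (hw : 0 < w.re) :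
    MellinConvergent (gaussPolyFn P) w := by
  have hterm : ∀ i ∈ Finset.range (P.natDegree + 1), MellinConvergent (fun x : ℝ =>
      (P.coeff i / (((2 : ℝ) ^ ((1 : ℝ) / 4) : ℝ) : ℂ)) • (((x : ℂ) ^ ((i : ℕ) : ℂ)) • toC hermiteH0 x)) w :=
    fun i _ => (MellinConvergent.cpow_smul.mpr
      (mellinConvergent_toC_hermiteH0 (by simp; positivity))).const_smul _
  rw [gaussPolyFn_eq_sum]
  unfold MellinConvergent at hterm ⊢
  simp only [Finset.smul_sum]
  exact integrable_finsetSum _ hterm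

/-! ### Step 3: the formula `𝒰(h_{2n})(s) = (−1)^n 𝒫_n(s) 𝒰(h_0)(s)` (Thm. 3.1 (ii)) -/

/-- sign bookkeeping `(−1)^{n−k} = (−1)^n (−1)^k` (`k ≤ n`). [folklore] -/
private theorem neg_one_pow_sub_mul {n k : ℕ} (h : k ≤ n) :
    ((-1 : ℂ)) ^ (n - k) = (-1) ^ n * (-1) ^ k := by
  have h1 : (-1 : ℂ) ^ (n - k) * (-1) ^ k = (-1) ^ n := by rw [← pow_add, Nat.sub_add_cancel h]
  have hk : ((-1 : ℂ) ^ k) * (-1) ^ k = 1 := by rw [← pow_add, ← two_mul, pow_mul]; norm_num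
  calc ((-1 : ℂ)) ^ (n - k) = (-1) ^ (n - k) * ((-1) ^ k * (-1) ^ k) := by rw [hk, mul_one]
    _ = (-1) ^ n * (-1) ^ k := by rw [← mul_assoc, h1]

/-- `h_{2n} = Σ_k c_{n,k} · x^{2k} · h_0` with explicit complex coefficients. [cite: ConnesConsaniMoscovici2024, Prop. 3.2 eq. (21) p. 11 (p0009:L5)] -/
private theorem toC_evenHermiteFn_eq_sum (n : ℕ) : toC (evenHermiteFn n) = fun x : ℝ =>
    ∑ k ∈ Finset.range (n + 1),
      ((-1 : ℂ) ^ (n - k) * (2 ^ (3 * k) / 2 ^ n) * (Real.sqrt ((2 * n)! : ℝ) : ℂ) /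
          (((2 * k)! : ℂ) * ((n - k)! : ℂ)) * (π : ℂ) ^ k) •
        (((x : ℂ) ^ ((2 * k : ℕ) : ℂ)) • toC hermiteH0 x) := by
  funext x
  simp only [toC, evenHermiteFn, hermiteH0, smul_eq_mul, cpow_natCast]
  push_cast
  refine Finset.sum_congr rfl fun k _ => ?_
  ring

/-- **Theorem 3.1 (ii), formula clause, PROVED**: `𝒰(h_{2n})(s) = (−1)^n 𝒫_n(s) 𝒰(h_0)(s)` on
`Im s > −1/2`. [cite: ConnesConsaniMoscovici2024, Thm. 3.1 (ii) p. 9 (p0008:L9), proof p. 10] -/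
theorem transformU_evenHermiteFn (n : ℕ) (s : ℂ) (hs : -1 / 2 < s.im) :
    transformU (toC (evenHermiteFn n)) s = (-1) ^ n * (htPoly n).eval s * htBase s := by
  have hw : 0 < (1 / 2 - I * s).re := by rw [re_w]; linarith
  have hsq : ((Real.sqrt π : ℝ) : ℂ) ≠ 0 := ofReal_ne_zero.mpr (Real.sqrt_pos.mpr Real.pi_pos).ne'
  have hpi : (π : ℂ) ≠ 0 := ofReal_ne_zero.mpr Real.pi_ne_zero
  have hconv : ∀ k ∈ Finset.range (n + 1), MellinConvergent (fun x : ℝ =>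
      ((-1 : ℂ) ^ (n - k) * (2 ^ (3 * k) / 2 ^ n) * (Real.sqrt ((2 * n)! : ℝ) : ℂ) /
          (((2 * k)! : ℂ) * ((n - k)! : ℂ)) * (π : ℂ) ^ k) •
        (((x : ℂ) ^ ((2 * k : ℕ) : ℂ)) • toC hermiteH0 x)) (1 / 2 - I * s) :=
    fun k _ => (MellinConvergent.cpow_smul.mpr
      (mellinConvergent_toC_hermiteH0 (by
        simp; linarith [(Nat.cast_nonneg (α := ℝ) (2 * k)), (Nat.cast_nonneg (α := ℝ) k)]))).const_smul _
  -- `mellin h_0 (w + 2k) = √π · 𝒰(h_0)(s + 2ki)`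
  have hshift : ∀ k : ℕ, mellin (toC hermiteH0) (1 / 2 - I * s + ((2 * k : ℕ) : ℂ)) =
      ((Real.sqrt π : ℝ) : ℂ) * htBase (s + 2 * k * I) := by
    intro k
    rw [htBase, transformU, ← mul_assoc, mul_inv_cancel₀ hsq, one_mul]
    congr 1
    push_cast
    ring_nf
    rw [I_sq]
    ring
  rw [transformU, toC_evenHermiteFn_eq_sum, mellin_finsetSum _ _ _ hconv]
  simp_rw [mellin_const_smul, mellin_cpow_smul, hshift, htBase_add_two_mul_I s hs, smul_eq_mul]
  rw [htPoly, eval_mul, eval_C, eval_finsetSum, Finset.mul_sum, Finset.mul_sum, Finset.mul_sum,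
    Finset.sum_mul]
  refine Finset.sum_congr rfl fun k hk => ?_
  have hkn : k ≤ n := Nat.lt_succ_iff.mp (Finset.mem_range.mp hk)
  have hf1 : ((2 * k)! : ℂ) ≠ 0 := by exact_mod_cast Nat.factorial_ne_zero _
  have hf2 : ((n - k)! : ℂ) ≠ 0 := by exact_mod_cast Nat.factorial_ne_zero _
  rw [eval_mul, eval_C, neg_one_pow_sub_mul hkn]
  simp only [eval_prod, eval_sub, eval_mul, eval_C, eval_X]
  generalize (∏ j ∈ Finset.range k, ((j : ℂ) + 1 / 4 - I / 2 * s)) = Pk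
  field_simp

/-- **Theorem 3.1 (iv), second clause, PROVED**: `𝒱(h_{2n}) = (−1)^n 𝒫_n` on `ℝ`.
[cite: ConnesConsaniMoscovici2024, Thm. 3.1 (iv) p. 9 (p0008:L13)] -/
theorem transformV_evenHermiteFn (n : ℕ) (s : ℝ) :
    transformV (toC (evenHermiteFn n)) s = (-1) ^ n * (htPoly n).eval (s : ℂ) := by
  show (htBase s)⁻¹ * transformU (toC (evenHermiteFn n)) s = _
  rw [transformU_evenHermiteFn n s (by simp; norm_num)]
  field_simp [htBase_ne_zero s]


/-! ### Step 4: `𝒰(𝕊f)(s) = s·𝒰(f)(s)` on `f = P(x)e^{−πx²}` (Thm. 3.1 (iv), first clause) -/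

/-- `d/dx (P(x)e^{−πx²}) = (P' − 2πX·P)(x)·e^{−πx²}` (the space `{P(x)e^{−πx²}}` is stable under
`∂_x`, as used in the proof of Thm. 3.1). [cite: ConnesConsaniMoscovici2024, Thm. 3.1 proof p. 10 (p0008:L60)] -/
theorem hasDerivAt_gaussPolyFn (P : ℂ[X]) (x : ℝ) :
    HasDerivAt (gaussPolyFn P) (gaussPolyFn (derivative P - C (2 * (π : ℂ)) * X * P) x) x := by
  have h1 : HasDerivAt (fun y : ℝ => P.eval (y : ℂ)) ((derivative P).eval (x : ℂ)) x :=
    (P.hasDerivAt (x : ℂ)).comp_ofReal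
  have h2 : HasDerivAt (fun y : ℝ => ((Real.exp (-π * y ^ 2) : ℝ) : ℂ))
      (((Real.exp (-π * x ^ 2) * (-π * (2 * x))) : ℝ) : ℂ) x := by
    have h := ((hasDerivAt_pow 2 x).const_mul (-π)).exp
    have h' : HasDerivAt (fun y : ℝ => Real.exp (-π * y ^ 2))
        (Real.exp (-π * x ^ 2) * (-π * (2 * x))) x := by
      convert h using 2
      simp
    exact h'.ofReal_comp
  have h := h1.mul h2
  have e : gaussPolyFn (derivative P - C (2 * (π : ℂ)) * X * P) x =
      (derivative P).eval (x : ℂ) * ((Real.exp (-π * x ^ 2) : ℝ) : ℂ) +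
        P.eval (x : ℂ) * (((Real.exp (-π * x ^ 2) * (-π * (2 * x))) : ℝ) : ℂ) := by
    simp only [gaussPolyFn, eval_sub, eval_mul, eval_C, eval_X]
    push_cast
    ring
  rw [e]
  exact h

/-- `𝕊(P·e^{−πx²}) = (−i(X(P' − 2πXP) + P/2))·e^{−πx²}`: the scaling operator preserves the space
`{P(x)e^{−πx²}}`. [cite: ConnesConsaniMoscovici2024, Thm. 3.1 proof p. 10 (p0008:L60)] -/
theorem scalingOpFun_gaussPolyFn (P : ℂ[X]) :
    scalingOpFun (gaussPolyFn P) =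
      gaussPolyFn (C (-I) * (X * (derivative P - C (2 * (π : ℂ)) * X * P) + C (1 / 2) * P)) := by
  funext x
  rw [scalingOpFun, (hasDerivAt_gaussPolyFn P x).deriv]
  simp only [gaussPolyFn, eval_mul, eval_add, eval_sub, eval_C, eval_X]
  ring

/-- `‖P(x)‖ ≤ Σ_i ‖P_i‖ x^i` for `x ≥ 0`. [folklore] -/
private theorem norm_eval_ofReal_le (P : ℂ[X]) {x : ℝ} (hx : 0 ≤ x) :
    ‖P.eval (x : ℂ)‖ ≤ ∑ i ∈ Finset.range (P.natDegree + 1), ‖P.coeff i‖ * x ^ i := by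
  rw [eval_eq_sum_range]
  refine (norm_sum_le _ _).trans (le_of_eq (Finset.sum_congr rfl fun i _ => ?_))
  rw [norm_mul, norm_pow, Complex.norm_real, Real.norm_of_nonneg hx]

/-- The boundary term at `+∞`: `P(x)e^{−πx²}·x^w → 0`. [folklore] -/
private theorem tendsto_gaussPolyFn_mul_cpow (P : ℂ[X]) (w : ℂ) :
    Tendsto (fun x : ℝ => gaussPolyFn P x * (x : ℂ) ^ w) atTop (𝓝 0) := by
  have hmaj : Tendsto (fun x : ℝ => ∑ i ∈ Finset.range (P.natDegree + 1),
      ‖P.coeff i‖ * (x ^ ((i : ℝ) + w.re) * Real.exp (-π * x ^ 2))) atTop (𝓝 0) := by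
    have : (0 : ℝ) = ∑ i ∈ Finset.range (P.natDegree + 1), ‖P.coeff i‖ * 0 := by simp
    rw [this]
    have hexp : Tendsto (fun x : ℝ => Real.exp (-(1 / 2) * x)) atTop (𝓝 0) :=
      Real.tendsto_exp_comp_nhds_zero.mpr (tendsto_id.const_mul_atTop_of_neg (by norm_num))
    refine tendsto_finsetSum _ fun i _ => ?_
    exact ((rpow_mul_exp_neg_mul_sq_isLittleO_exp_neg Real.pi_pos _).trans_tendsto hexp).const_mul _
  refine squeeze_zero_norm' ?_ hmaj
  filter_upwards [eventually_gt_atTop 0] with x hx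
  rw [norm_mul, Complex.norm_cpow_eq_rpow_re_of_pos hx, gaussPolyFn, norm_mul, Complex.norm_real,
    Real.norm_of_nonneg (Real.exp_pos _).le]
  calc ‖P.eval (x : ℂ)‖ * Real.exp (-π * x ^ 2) * x ^ w.re
      ≤ (∑ i ∈ Finset.range (P.natDegree + 1), ‖P.coeff i‖ * x ^ i) *
          Real.exp (-π * x ^ 2) * x ^ w.re := by
        gcongr
        exact norm_eval_ofReal_le P hx.le
    _ = ∑ i ∈ Finset.range (P.natDegree + 1),
          ‖P.coeff i‖ * (x ^ ((i : ℝ) + w.re) * Real.exp (-π * x ^ 2)) := by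
        rw [Finset.sum_mul, Finset.sum_mul]
        refine Finset.sum_congr rfl fun i _ => ?_
        rw [Real.rpow_add hx, Real.rpow_natCast]
        ring

/-- `P(x)e^{−πx²}` is continuous. [folklore] -/
private theorem continuous_gaussPolyFn (P : ℂ[X]) : Continuous (gaussPolyFn P) := by
  change Continuous fun x : ℝ => P.eval (x : ℂ) * ((Real.exp (-π * x ^ 2) : ℝ) : ℂ)
  exact (P.continuous.comp Complex.continuous_ofReal).mul
    (Complex.continuous_ofReal.comp (by fun_prop))

/-- **Integration by parts on the Mellin side** for `f = P·e^{−πx²}`: `M[f'](w+1) = −w·M[f](w)`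
(`Re w > 0`; boundary terms vanish). [cite: ConnesConsaniMoscovici2024, Thm. 3.1 (iv) proof p. 10 (p0008:L60)] -/
theorem mellin_gaussPolyFn_deriv (P : ℂ[X]) {w : ℂ} (hw : 0 < w.re) :
    mellin (gaussPolyFn (derivative P - C (2 * (π : ℂ)) * X * P)) (w + 1) =
      -w * mellin (gaussPolyFn P) w := by
  have hw0 : w ≠ 0 := fun h => by simp [h] at hw
  set D := derivative P - C (2 * (π : ℂ)) * X * P with hD
  set g : ℝ → ℂ := fun x => gaussPolyFn P x * (x : ℂ) ^ w with hg
  set g' : ℝ → ℂ := fun x => gaussPolyFn D x * (x : ℂ) ^ w +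
    gaussPolyFn P x * (w * (x : ℂ) ^ (w - 1)) with hg'
  have hderiv : ∀ x ∈ Ioi (0:ℝ), HasDerivAt g (g' x) x := by
    intro x hx
    have h2 : HasDerivAt (fun y : ℝ => (y : ℂ) ^ w) (w * (x : ℂ) ^ (w - 1)) x := by
      have := (Complex.hasStrictDerivAt_cpow_const (x := (x : ℂ)) (c := w)
        (Or.inl (by simpa using hx))).hasDerivAt
      exact this.comp_ofReal
    exact (hasDerivAt_gaussPolyFn P x).mul h2
  have hcont : ContinuousWithinAt g (Ici 0) 0 :=
    (((continuous_gaussPolyFn P).continuousAt).mul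
      (Complex.continuousAt_ofReal_cpow_const 0 w (Or.inl hw))).continuousWithinAt
  have hint1 : IntegrableOn (fun x : ℝ => gaussPolyFn D x * (x : ℂ) ^ w) (Ioi 0) := by
    have h := mellinConvergent_gaussPolyFn D (w := w + 1) (by simp; linarith)
    refine (integrableOn_congr_fun (fun x _ => ?_) measurableSet_Ioi).mp h
    simp [smul_eq_mul, mul_comm]
  have hint2 : IntegrableOn (fun x : ℝ => gaussPolyFn P x * (w * (x : ℂ) ^ (w - 1))) (Ioi 0) := by
    have h := (mellinConvergent_gaussPolyFn P hw).const_smul w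
    refine (integrableOn_congr_fun (fun x _ => ?_) measurableSet_Ioi).mp h
    simp [smul_eq_mul]
    ring
  have hint : IntegrableOn g' (Ioi 0) := hint1.add hint2
  have hFTC := integral_Ioi_of_hasDerivAt_of_tendsto hcont hderiv hint
    (tendsto_gaussPolyFn_mul_cpow P w)
  have hg0 : g 0 = 0 := by simp [hg, Complex.zero_cpow hw0]
  rw [hg0, sub_zero, hg', integral_add hint1 hint2] at hFTC
  have e1 : ∫ x in Ioi (0:ℝ), gaussPolyFn D x * (x : ℂ) ^ w = mellin (gaussPolyFn D) (w + 1) := by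
    rw [mellin]
    refine setIntegral_congr_fun measurableSet_Ioi fun x _ => ?_
    simp [smul_eq_mul, mul_comm]
  have e2 : ∫ x in Ioi (0:ℝ), gaussPolyFn P x * (w * (x : ℂ) ^ (w - 1)) =
      w * mellin (gaussPolyFn P) w := by
    rw [mellin, ← integral_const_mul]
    refine setIntegral_congr_fun measurableSet_Ioi fun x _ => ?_
    simp [smul_eq_mul]
    ring
  rw [e1, e2] at hFTC
  linear_combination hFTC

/-- **Theorem 3.1 (iv), first clause, PROVED**: `𝒰(𝕊f)(s) = s·𝒰(f)(s)` for `f = P(x)e^{−πx²}`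
and `Im s > −1/2`. [cite: ConnesConsaniMoscovici2024, Thm. 3.1 (iv) p. 9 (p0008:L13), proof p. 10] -/
theorem transformU_scalingOpFun_gaussPolyFn (P : ℂ[X]) (s : ℂ) (hs : -1 / 2 < s.im) :
    transformU (scalingOpFun (gaussPolyFn P)) s = s * transformU (gaussPolyFn P) s := by
  have hw : 0 < (1 / 2 - I * s).re := by rw [re_w]; linarith
  have hpt : scalingOpFun (gaussPolyFn P) = fun x : ℝ =>
      (-I) • (((x : ℂ) ^ (1 : ℂ) • gaussPolyFn (derivative P - C (2 * (π : ℂ)) * X * P) x) +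
        ((1 / 2 : ℂ) • gaussPolyFn P x)) := by
    rw [scalingOpFun_gaussPolyFn]
    funext x
    simp only [gaussPolyFn, eval_mul, eval_add, eval_sub, eval_C, eval_X, smul_eq_mul, cpow_one]
    ring
  have hc1 : MellinConvergent (fun x : ℝ =>
      (x : ℂ) ^ (1 : ℂ) • gaussPolyFn (derivative P - C (2 * (π : ℂ)) * X * P) x) (1 / 2 - I * s) :=
    MellinConvergent.cpow_smul.mpr (mellinConvergent_gaussPolyFn _ (by simp; linarith))
  have hc2 : MellinConvergent (fun x : ℝ => (1 / 2 : ℂ) • gaussPolyFn P x) (1 / 2 - I * s) :=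
    (mellinConvergent_gaussPolyFn P hw).const_smul _
  rw [transformU, transformU, hpt, mellin_const_smul, (hasMellin_add hc1 hc2).2, mellin_cpow_smul,
    mellin_const_smul, mellin_gaussPolyFn_deriv P hw]
  simp only [smul_eq_mul]
  ring_nf
  rw [I_sq]
  ring

/-- **Theorem 3.1 (iv) DISCHARGED** (both clauses). [cite: ConnesConsaniMoscovici2024, Thm. 3.1 (iv) p. 9 (p0008:L13)] -/
theorem CCM2024_thm_3_1_iv_holds : CCM2024_thm_3_1_iv :=
  ⟨fun P s hs => transformU_scalingOpFun_gaussPolyFn P s hs, fun n s => transformV_evenHermiteFn n s⟩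


/-! ### Step 5: Corollary 3.2 from Prop. 3.2 (i) -/

/-- `h_{2n} = Q(x)e^{−πx²}` for an explicit polynomial `Q` (eq. (21)). [cite: ConnesConsaniMoscovici2024, Prop. 3.2 eq. (21) p. 11 (p0009:L5)] -/
theorem exists_gaussPolyFn_eq_toC_evenHermiteFn (n : ℕ) :
    ∃ Q : ℂ[X], gaussPolyFn Q = toC (evenHermiteFn n) := by
  refine ⟨∑ k ∈ Finset.range (n + 1), C ((((-1 : ℝ) ^ (n - k) *
      ((2 : ℝ) ^ (1 / 4 : ℝ) * 2 ^ (3 * k) / 2 ^ n) * Real.sqrt ((2 * n)! : ℝ) /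
      (((2 * k)! : ℝ) * ((n - k)! : ℝ)) * π ^ k : ℝ) : ℂ)) * X ^ (2 * k), ?_⟩
  funext x
  simp only [gaussPolyFn, toC, evenHermiteFn, eval_finsetSum, eval_mul, eval_C, eval_pow, eval_X,
    Finset.sum_mul]
  push_cast
  rfl

/-- `P(x)e^{−πx²}` is smooth (these functions lie in `𝒮(ℝ)`, Thm. 3.1 proof). [cite: ConnesConsaniMoscovici2024, Thm. 3.1 proof p. 10 (p0008:L60)] -/
theorem contDiff_gaussPolyFn (Q : ℂ[X]) {m : WithTop ℕ∞} : ContDiff ℝ m (gaussPolyFn Q) := by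
  change ContDiff ℝ m (fun x : ℝ => Q.eval (x : ℂ) * ((Real.exp (-π * x ^ 2) : ℝ) : ℂ))
  have h1 : ContDiff ℂ m (fun x : ℂ => Q.eval x) := by
    simpa using Q.contDiff_aeval (𝕜 := ℂ) m
  have h2 : ContDiff ℝ m (fun x : ℝ => Real.exp (-π * x ^ 2)) := by fun_prop
  exact ((h1.restrict_scalars ℝ).comp Complex.ofRealCLM.contDiff).mul
    (Complex.ofRealCLM.contDiff.comp h2)

/-- **Corollary 3.2 from Prop. 3.2 (i)**: `𝒰(W_λ h_{2n})(s) = (−s² + 2πλ²(4n+1) − ¼)·𝒰(h_{2n})(s)` on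
`Im s > −1/2`, from `W_λ = −𝕊² − ¼ + λ²𝐇` (dictionary, PROVED), Thm. 3.1 (iv) and `𝐇h_{2n} = 2π(4n+1)h_{2n}`.
[cite: ConnesConsaniMoscovici2024, Cor. 3.2 p. 11 (p0009:L1)] -/
theorem CCM2024_cor_3_2_of_prop_3_2 (h : CCM2024_prop_3_2) : CCM2024_cor_3_2 := by
  intro lam n s hs
  have hw : 0 < (1 / 2 - I * s).re := by rw [re_w]; linarith
  obtain ⟨Q, hQ⟩ := exists_gaussPolyFn_eq_toC_evenHermiteFn n
  have hcd : ContDiff ℝ 2 (toC (evenHermiteFn n)) := hQ ▸ contDiff_gaussPolyFn Q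
  -- `𝒰(𝕊²f) = s²·𝒰(f)`
  have hSS : transformU (scalingOpFun (scalingOpFun (gaussPolyFn Q))) s =
      s * (s * transformU (gaussPolyFn Q) s) := by
    rw [scalingOpFun_gaussPolyFn Q, transformU_scalingOpFun_gaussPolyFn _ s hs,
      ← scalingOpFun_gaussPolyFn Q, transformU_scalingOpFun_gaussPolyFn _ s hs]
  -- `W_λ f = (−¼ + 2πλ²(4n+1))·f − 𝕊²f` pointwise
  have hW : prolateWaveOpFun lam (toC (evenHermiteFn n)) = fun x =>
      ((-(1 / 4 : ℂ)) + (lam : ℂ) ^ 2 * (2 * π * (4 * n + 1))) • gaussPolyFn Q x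
        - scalingOpFun (scalingOpFun (gaussPolyFn Q)) x := by
    funext x
    have hx : (evenHermiteFn n x : ℂ) = gaussPolyFn Q x := by rw [hQ]; rfl
    rw [prolateWaveOpFun_eq_add_hermite lam hcd x, ← neg_scalingOpFun_sq_eq hcd x, h.1 n x, hx, ← hQ]
    simp only [smul_eq_mul]
    ring
  have hcQ : MellinConvergent (gaussPolyFn Q) (1 / 2 - I * s) := mellinConvergent_gaussPolyFn Q hw
  have hcSS : MellinConvergent (scalingOpFun (scalingOpFun (gaussPolyFn Q))) (1 / 2 - I * s) := by
    rw [scalingOpFun_gaussPolyFn, scalingOpFun_gaussPolyFn]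
    exact mellinConvergent_gaussPolyFn _ hw
  have hU : transformU (toC (evenHermiteFn n)) s =
      ((Real.sqrt π : ℝ) : ℂ)⁻¹ * mellin (gaussPolyFn Q) (1 / 2 - I * s) := by rw [← hQ]; rfl
  have hUSS : ((Real.sqrt π : ℝ) : ℂ)⁻¹ * mellin (scalingOpFun (scalingOpFun (gaussPolyFn Q))) (1 / 2 - I * s) =
      s * (s * (((Real.sqrt π : ℝ) : ℂ)⁻¹ * mellin (gaussPolyFn Q) (1 / 2 - I * s))) := hSS
  rw [hW, transformU, (hasMellin_sub (hcQ.const_smul _) hcSS).2, mellin_const_smul, hU, smul_eq_mul]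
  linear_combination -hUSS

end Literature.NumberTheory.ConnesConsani2024

/-! ## Discharge: Lemma 3.3 (i), transform clauses

RH-FREE.  Printed proof (p. 15): `𝔽_μ(w_∞ψ)(s) = √π·𝒰(ψ)(s)`; `𝒰` is linear, `𝒰(h_{2n}) = (−1)^n𝒫_n𝒰(h_0)`
(Thm. 3.1 (ii)), `𝒰(h_0) = 2^{−3/4}π^{−1/2}L_∞` (Thm. 3.1 (i)); the constants of `ψ^±_ℓ` are `𝒫_{2ℓ}(i/2)`
resp. `−2i𝒫_{2ℓ+1}(i/2)/𝒫_1'`, which is eq. (34) (Lemma 3.3 (ii), PROVED earlier).  Nothing here bears on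
the truth of RH. -/

namespace Literature.NumberTheory.ConnesConsani2024

open _root_.MeasureTheory Complex Polynomial Filter Set Asymptotics
open scoped Real Topology Nat
open Literature.NumberTheory.LFunctions

/-- `𝔽_μ(w_∞ g)(s) = √π · 𝒰(g)(s)`: `∫₀^∞ u^{1/2} g(u) u^{−is} d*u = ∫₀^∞ g(u) u^{½−is−1} du`
(§3.1.2 eq. (16) and §3.1.3). [cite: ConnesConsaniMoscovici2024, §3.1 eqs. (15)–(16) p. 10 (p0008:L42)] -/
theorem mulHaarFourier_wInfty (g : ℝ → ℝ) (s : ℂ) :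
    mulHaarFourier (toC (wInfty g)) s = ((Real.sqrt π : ℝ) : ℂ) * transformU (toC g) s := by
  have hsq : ((Real.sqrt π : ℝ) : ℂ) ≠ 0 := ofReal_ne_zero.mpr (Real.sqrt_pos.mpr Real.pi_pos).ne'
  rw [transformU, ← mul_assoc, mul_inv_cancel₀ hsq, one_mul, mulHaarFourier,
    show (1 / 2 : ℂ) - I * s = -(I * s) + 1 / 2 by ring, ← mellin_cpow_smul]
  refine setIntegral_congr_fun measurableSet_Ioi fun u hu => ?_
  simp only [toC, wInfty, smul_eq_mul, Complex.ofReal_mul, Real.sqrt_eq_rpow,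
    Complex.ofReal_cpow (le_of_lt hu)]
  push_cast
  ring

/-- The Mellin integral of `h_{2n}` converges for `Re w > 0`. [cite: ConnesConsaniMoscovici2024, Thm. 3.1 (i)–(ii) p. 9 (p0008:L5)] -/
theorem mellinConvergent_toC_evenHermiteFn (n : ℕ) {w : ℂ} (hw : 0 < w.re) :
    MellinConvergent (toC (evenHermiteFn n)) w := by
  obtain ⟨Q, hQ⟩ := exists_gaussPolyFn_eq_toC_evenHermiteFn n
  rw [← hQ]
  exact mellinConvergent_gaussPolyFn Q hw

/-- `𝒰(ψ⁺_ℓ) = 𝒰(h_{4ℓ}) − (h_{4ℓ}(0)/h_0(0))·𝒰(h_0)` on `Im s > −1/2`. [cite: ConnesConsaniMoscovici2024, §3.6 eq. (29) p. 14 (p0010:L28)] -/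
theorem transformU_psiPlus (ℓ : ℕ) (s : ℂ) (hs : -1 / 2 < s.im) :
    transformU (toC (psiPlus ℓ)) s = transformU (toC (evenHermiteFn (2 * ℓ))) s -
      ((evenHermiteFn (2 * ℓ) 0 / hermiteH0 0 : ℝ) : ℂ) * htBase s := by
  have hw : 0 < (1 / 2 - I * s).re := by rw [re_w]; linarith
  have hpt : toC (psiPlus ℓ) = fun x : ℝ => toC (evenHermiteFn (2 * ℓ)) x -
      ((evenHermiteFn (2 * ℓ) 0 / hermiteH0 0 : ℝ) : ℂ) • toC hermiteH0 x := by
    funext x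
    simp only [toC, psiPlus, smul_eq_mul]
    push_cast
    ring
  rw [htBase, transformU, transformU, transformU, hpt,
    (hasMellin_sub (mellinConvergent_toC_evenHermiteFn (2 * ℓ) hw)
      ((mellinConvergent_toC_hermiteH0 hw).const_smul _)).2, mellin_const_smul, smul_eq_mul]
  ring

/-- `𝒰(ψ⁻_ℓ) = −𝒰(h_{4ℓ+2}) + (h_{4ℓ+2}(0)/h_2(0))·𝒰(h_2)` on `Im s > −1/2`. [cite: ConnesConsaniMoscovici2024, §3.6 eq. (29) p. 14 (p0010:L28)] -/
theorem transformU_psiMinus (ℓ : ℕ) (s : ℂ) (hs : -1 / 2 < s.im) :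
    transformU (toC (psiMinus ℓ)) s = -transformU (toC (evenHermiteFn (2 * ℓ + 1))) s +
      ((evenHermiteFn (2 * ℓ + 1) 0 / evenHermiteFn 1 0 : ℝ) : ℂ) *
        transformU (toC (evenHermiteFn 1)) s := by
  have hw : 0 < (1 / 2 - I * s).re := by rw [re_w]; linarith
  have hpt : toC (psiMinus ℓ) = fun x : ℝ =>
      ((evenHermiteFn (2 * ℓ + 1) 0 / evenHermiteFn 1 0 : ℝ) : ℂ) • toC (evenHermiteFn 1) x -
        toC (evenHermiteFn (2 * ℓ + 1)) x := by
    funext x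
    simp only [toC, psiMinus, smul_eq_mul]
    push_cast
    ring
  rw [transformU, transformU, transformU, hpt,
    (hasMellin_sub ((mellinConvergent_toC_evenHermiteFn 1 hw).const_smul _)
      (mellinConvergent_toC_evenHermiteFn (2 * ℓ + 1) hw)).2, mellin_const_smul, smul_eq_mul]
  ring

/-- `h_0(0) = 2^{1/4}`. [folklore] -/
private theorem hermiteH0_apply_zero : hermiteH0 0 = (2 : ℝ) ^ (1 / 4 : ℝ) := by simp [hermiteH0]

/-- The constant of `ψ⁺_ℓ`: `h_{4ℓ}(0)/h_0(0) = 𝒫_{2ℓ}(i/2)` (display p. 15: `∫ψ = 0 ⇔ 𝒰ψ(i/2) = 0`).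
[cite: ConnesConsaniMoscovici2024, Lemma 3.3 proof p. 15 (p0010:L83)] -/
theorem psiPlus_const_eq (ℓ : ℕ) :
    ((evenHermiteFn (2 * ℓ) 0 / hermiteH0 0 : ℝ) : ℂ) = (htPoly (2 * ℓ)).eval (I / 2) := by
  have h2 : (((2 : ℝ) ^ (1 / 4 : ℝ) : ℝ) : ℂ) ≠ 0 :=
    ofReal_ne_zero.mpr (Real.rpow_pos_of_pos two_pos _).ne'
  have hf : (((2 * ℓ)! : ℕ) : ℂ) ≠ 0 := by exact_mod_cast Nat.factorial_ne_zero _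
  rw [htPoly_eq_smul_htPolyS, eval_smul, htPolyS_eval_I_half, evenHermiteFn_apply_zero,
    hermiteH0_apply_zero, smul_eq_mul, pow_mul]
  push_cast
  norm_num
  field_simp

/-- The constant of `ψ⁻_ℓ` against `𝒫_1(s) = i√2·s`:
`(h_{4ℓ+2}(0)/h_2(0))·𝒫_1(s) = −2is·𝒫_{2ℓ+1}(i/2)`. [cite: ConnesConsaniMoscovici2024, Lemma 3.3 proof p. 15 (p0010:L77–L83)] -/
theorem psiMinus_const_mul_htPoly_one (ℓ : ℕ) (s : ℂ) :
    ((evenHermiteFn (2 * ℓ + 1) 0 / evenHermiteFn 1 0 : ℝ) : ℂ) * (htPoly 1).eval s =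
      -(2 * I * (htPoly (2 * ℓ + 1)).eval (I / 2)) * s := by
  have h2 : (((2 : ℝ) ^ (1 / 4 : ℝ) : ℝ) : ℂ) ≠ 0 :=
    ofReal_ne_zero.mpr (Real.rpow_pos_of_pos two_pos _).ne'
  have hf : (((2 * ℓ + 1)! : ℕ) : ℂ) ≠ 0 := by exact_mod_cast Nat.factorial_ne_zero _
  have hs2 : ((Real.sqrt 2 : ℝ) : ℂ) ≠ 0 := ofReal_ne_zero.mpr (Real.sqrt_pos.mpr two_pos).ne'
  have e1 : (-1 : ℝ) ^ (2 * ℓ + 1) = -1 := by rw [pow_succ, pow_mul]; norm_num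
  have e2 : (-1 : ℂ) ^ (2 * ℓ + 1) = -1 := by rw [pow_succ, pow_mul]; norm_num
  rw [htPoly_eq_smul_htPolyS, htPoly_eq_smul_htPolyS, eval_smul, eval_smul, htPolyS_eval_I_half,
    htPolyS_one, evenHermiteFn_apply_zero, evenHermiteFn_apply_zero, smul_eq_mul, smul_eq_mul,
    e1, e2]
  simp only [Nat.mul_one, Nat.factorial_two, Nat.factorial_one, Nat.cast_ofNat, Nat.cast_one,
    pow_one, eval_smul, eval_X, smul_eq_mul]
  push_cast
  field_simp

/-- **Lemma 3.3 (i), transform of `ψ⁺_ℓ`, PROVED**: `𝔽_μ(w_∞ψ⁺_ℓ)(s) = L_∞(½ − is)·P⁺_ℓ(s)`,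
`Im s > −1/2`. [cite: ConnesConsaniMoscovici2024, Lemma 3.3 (i) p. 14 (p0010:L55); proof p. 15] -/
theorem mulHaarFourier_wInfty_psiPlus (ℓ : ℕ) (s : ℂ) (hs : -1 / 2 < s.im) :
    mulHaarFourier (toC (wInfty (psiPlus ℓ))) s = Gammaℝ (1 / 2 - I * s) * (polyPplus ℓ).eval s := by
  have hsq : ((Real.sqrt π : ℝ) : ℂ) ≠ 0 := ofReal_ne_zero.mpr (Real.sqrt_pos.mpr Real.pi_pos).ne'
  have h1 : ((-1 : ℂ)) ^ (2 * ℓ) = 1 := by rw [pow_mul]; norm_num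
  have hB : ((Real.sqrt π : ℝ) : ℂ) * htBase s =
      (((2 : ℝ) ^ (-(3 / 4 : ℝ)) : ℝ) : ℂ) * Gammaℝ (1 / 2 - I * s) := by
    rw [CCM2024_thm_3_1_i_holds s hs]
    field_simp
  have hU : transformU (toC (psiPlus ℓ)) s =
      ((htPoly (2 * ℓ)).eval s - (htPoly (2 * ℓ)).eval (I / 2)) * htBase s := by
    rw [transformU_psiPlus ℓ s hs, transformU_evenHermiteFn _ s hs, psiPlus_const_eq, h1]
    ring
  rw [mulHaarFourier_wInfty, hU, polyPplus_eq]
  simp only [eval_mul, eval_sub, eval_C]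
  conv_lhs => rw [mul_left_comm]
  rw [hB]
  ring

/-- **Lemma 3.3 (i), transform of `ψ⁻_ℓ`, PROVED**: `𝔽_μ(w_∞ψ⁻_ℓ)(s) = L_∞(½ − is)·P⁻_ℓ(s)`,
`Im s > −1/2`. [cite: ConnesConsaniMoscovici2024, Lemma 3.3 (i) p. 14 (p0010:L55); proof p. 15] -/
theorem mulHaarFourier_wInfty_psiMinus (ℓ : ℕ) (s : ℂ) (hs : -1 / 2 < s.im) :
    mulHaarFourier (toC (wInfty (psiMinus ℓ))) s =
      Gammaℝ (1 / 2 - I * s) * (polyPminus ℓ).eval s := by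
  have hsq : ((Real.sqrt π : ℝ) : ℂ) ≠ 0 := ofReal_ne_zero.mpr (Real.sqrt_pos.mpr Real.pi_pos).ne'
  have h1 : ((-1 : ℂ)) ^ (2 * ℓ + 1) = -1 := by rw [pow_succ, pow_mul]; norm_num
  have hc := psiMinus_const_mul_htPoly_one ℓ s
  have hB : ((Real.sqrt π : ℝ) : ℂ) * htBase s =
      (((2 : ℝ) ^ (-(3 / 4 : ℝ)) : ℝ) : ℂ) * Gammaℝ (1 / 2 - I * s) := by
    rw [CCM2024_thm_3_1_i_holds s hs]
    field_simp
  have hU : transformU (toC (psiMinus ℓ)) s =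
      ((htPoly (2 * ℓ + 1)).eval s -
        ((evenHermiteFn (2 * ℓ + 1) 0 / evenHermiteFn 1 0 : ℝ) : ℂ) * (htPoly 1).eval s) * htBase s := by
    rw [transformU_psiMinus ℓ s hs, transformU_evenHermiteFn _ s hs, transformU_evenHermiteFn 1 s hs,
      h1, pow_one]
    ring
  rw [mulHaarFourier_wInfty, hU, polyPminus_eq]
  simp only [eval_mul, eval_add, eval_C, eval_X]
  conv_lhs => rw [mul_left_comm]
  rw [hB]
  linear_combination (-((((2 : ℝ) ^ (-(3 / 4 : ℝ)) : ℝ) : ℂ) * Gammaℝ (1 / 2 - I * s))) * hc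

/-- **Lemma 3.3 (i), transform clauses, DISCHARGED.** [cite: ConnesConsaniMoscovici2024, Lemma 3.3 (i) p. 14 (p0010:L55); proof p. 15 (p0010:L83)] -/
theorem CCM2024_lemma_3_3_i_holds : CCM2024_lemma_3_3_i := by
  have hI : -1 / 2 < (I / 2).im := by simp; norm_num
  refine ⟨fun ℓ s hs => ⟨mulHaarFourier_wInfty_psiPlus ℓ s hs, mulHaarFourier_wInfty_psiMinus ℓ s hs⟩,
    fun ℓ => ⟨?_, ?_⟩⟩
  · rw [mulHaarFourier_wInfty_psiPlus ℓ _ hI, polyPplus_eval_I_half, mul_zero]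
  · rw [mulHaarFourier_wInfty_psiMinus ℓ _ hI, polyPminus_eval_I_half, mul_zero]

end Literature.NumberTheory.ConnesConsani2024
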